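import Literature.Probability.RandomPlanarGeometry.HexSAWSurfaceWallRenewalSlackFourFourDownFamiliesDeep
import Literature.Probability.RandomPlanarGeometry.HexSAWSurfaceWallRenewalSlackFourFourDownFamiliesShallow
import Literature.Probability.RandomPlanarGeometry.HexSAWSurfaceWallRenewalSlackFourThreeDownFamilies
import Literature.Probability.RandomPlanarGeometry.HexSAWSurfaceWallRenewalSlackFourRow
import HarnessLib

/-!
# Slack four, four down steps: separation of the ten families, the Finset `ddddBlocks k`, and the floor
`(k − 2)(2k⁴ − 7k³ + 4k² + 7k + 6)/12` for the four-down stratum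

Self-avoiding walk on the honeycomb lattice in its brick-wall frame (`Eight.adjE`: horizontal steps everywhere, a
vertical edge `(x, y)–(x, y+1)` iff `x + y` is even), in the half-plane `Y ≤ 0`.  An IRREDUCIBLE POSITIVE WALL
BRIDGE `ω ∈ ipwb n` with `v = visits n ω` surface visits has SLACK `n − 6v`; at slack four (`n = 6k + 4`,
`v = k ≥ 2`) it has `2 ≤ #down ≤ 4` down steps (`…IteratedGap`); the two- and three-down strata are classified
and counted in `…SlackFourTwoDown`, `…SlackFourThreeDownFamilies`, `…SlackFourThreeDownLaw`, `…SlackFourRow`.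
The modules `…SlackFourFourDownFamiliesDeep` (A7–A10, vertical word `D D D D U U U U`) and
`…SlackFourFourDownFamiliesShallow` (A11–A15, B5; words `D D D U D U U U`, `D D D U U D U U`, `D D U D D U U U`,
`D D U U D D U U`) construct TEN FAMILIES `s4a, …, s4j` of four-down blocks as affine nine-piece table walks and
prove membership in `ipwb (6k + 4)`, `visits = k` and the four down / four up times of each.  This module

* §1 SEPARATES them: `F_inj` for each family and `F_ne_G` for each of the `45` pairs — two blocks with the
  same walk have the same `stepsD` and `stepsU` quadruples, hence (listed increasingly, `quad_eq_of_lt`)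
  termwise equal times, and the times are affine forms that determine family and parameters (`omega`);
* §2 counts the INDEX SIMPLICES `pentIdx n = {x₁ + x₂ + x₃ + x₄ < n}` and `hexIdx n = {x₁ + ⋯ + x₅ < n}` by
  peeling the last coordinate down to `triIdx`, `tetIdx` of `…SlackFourThreeDownFamilies`:
  `twentyfour_mul_card_pentIdx : 24·#pentIdx n = n(n+1)(n+2)(n+3)` and
  `onetwenty_mul_card_hexIdx : 120·#hexIdx n = n(n+1)(n+2)(n+3)(n+4)` (private plumbing);
* §3 cuts the parameter polytope of each family into SIMPLEX PIECES (26 in all: A7 ×4, A8 ×2, A9 ×9, A10,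
  A11 ×4, A12, A13 ×2, A14, A15, B5), each the injective affine image of a `hexIdx (k − c)`, `pentIdx (k − c)`
  or `range (k − 2)` (`a7aImg, …, b5Img`, with `exists_of_mem_…`, `card_…`, and the family unions `a7Img`,
  `a8Img`, `a9Img`, `a11Img`, `a13Img` with their piecewise-disjointness);
* §4 forms ★ `ddddBlocks k = a7Img k ∪ ⋯ ∪ b5Img k`, proves the ten images pairwise disjoint (§1), the
  structural count ★ `card_ddddBlocks_eq : #ddddBlocks k = 11·#hexIdx (k−3) + 8·#hexIdx (k−4) + #hexIdx (k−2)
  + #pentIdx (k−2) + 3·#pentIdx (k−3) + #pentIdx (k−4) + (k−2)`, the closed form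
  ★★★ `twelve_mul_card_ddddBlocks : 12·#ddddBlocks k = (k − 2)(2k⁴ + 4k² + 7k + 6 − 7k³)` (`k ≥ 2`; i.e.
  `#ddddBlocks k = 0, 3, 27, 129, 424, 1105, 2463, 4907, 8984, …`; the polynomial is written
  truncation-safely), ★★ `ddddBlocks_subset : ddddBlocks k ⊆ {ω ∈ ipwb m : visits = k ∧ #stepsD = 4}`, the FLOOR
  ★★★ `le_twelve_mul_card_filter_visits_four_down : (k − 2)(2k⁴ + 4k² + 7k + 6 − 7k³) ≤ 12·#{… ∧ #stepsD = 4}`,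
  and, with the exact two- and three-down census `two_mul_card_filter_visits_slack_four` of `…SlackFourRow`, the
  ★★★ QUINTIC FLOOR
  `slack_four_quintic_floor : 2k⁵ + 30k³ + 5k² + 60 − (11k⁴ + 38k) ≤ 12·#{ω ∈ ipwb m : visits = k}` — the floor
  half of the slack-four row `12·N(6k+4, k) = 2k⁵ − 11k⁴ + 30k³ + 5k² − 38k + 60` that the lane's enumeration
  shows for `k ≤ 15` (`N(6k+4, k) = 11, 33, 95, 260, 649, 1461, 2993, …` for `k = 2, 3, …`).

PROOFS.  Routine: `omega` over the affine times (§1), peeling + induction with `ring_nf; omega` closings (§2),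
`card_image_of_injOn` / `card_union_of_disjoint` (§3–§4), and for the closed forms the simplex cardinalities at
`k − 2, k − 3, k − 4` after the substitution `k = n + 4` (small `k` separately).

STATUS: lane theorem of the a-idea-1 bridge/renewal lineage; car 96 «slack four: four down, separation and count».
OURS (new in writing, modest): the floor `(k − 2)(2k⁴ − 7k³ + 4k² + 7k + 6)/12` for the four-down stratum at
slack four and the resulting quintic floor for the slack-four row.  CHECKED: the piece decomposition reproduces, for
`k = 2, …, 10`, exactly the admissible parameter sets of the ten families (no overlap, no omission) and the totals
`0, 3, 27, 129, 424, 1105, 2463, 4907, 8984`, which are the four-down counts of the lane's enumeration (`k ≤ 8`)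
— so the floor is attained there; EQUALITY for all `k` (the four-down law) needs the classification of the five
admissible vertical words (`…SlackFourFourDown`) by these families and is NOT claimed here.  The printed sources
carry the renewal / irreducible-bridge structure (Madras–Slade §4.2, Definition 4.2.1, remark before (4.2.21)),
the brickwork frame of the honeycomb lattice (Enting–Jensen §7.4.2, Fig. 7.10) and the surface-visit statistic —
none has these counts.
-/

namespace Literature.Probability.RandomPlanarGeometry.SAW.HexBW.Wall

open Finset Filter Function
open Literature.Probability.LatticeModels Literature.Probability.Percolation SimpleGraph

/-! ### §1  Separation: two blocks of the ten families with the same walk have the same family and the same parameters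
(the down-step and up-step times alone decide it) -/

/-- Two four-element sets of naturals, each listed increasingly, are equal only termwise. [folklore] -/
private theorem quad_eq_of_lt {a b c d a' b' c' d' : ℕ} (h : ({a, b, c, d} : Finset ℕ) = {a', b', c', d'}) (hab : a < b)
    (hbc : b < c) (hcd : c < d) (hab' : a' < b') (hbc' : b' < c') (hcd' : c' < d') :
    a = a' ∧ b = b' ∧ c = c' ∧ d = d' := by
  have hl : ∀ x, x ∈ ({a, b, c, d} : Finset ℕ) → x = a' ∨ x = b' ∨ x = c' ∨ x = d' := fun x hx => by
    rw [h] at hx; simpa only [mem_insert, mem_singleton] using hx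
  have hr : ∀ x, x ∈ ({a', b', c', d'} : Finset ℕ) → x = a ∨ x = b ∨ x = c ∨ x = d := fun x hx => by
    rw [← h] at hx; simpa only [mem_insert, mem_singleton] using hx
  have ha : a = a' := by
    have h1 := hl a (by simp); have h2 := hr a' (by simp); omega
  have hb : b = b' := by
    have h1 := hl b (by simp); have h2 := hr b' (by simp); omega
  have hc : c = c' := by
    have h1 := hl c (by simp); have h2 := hr c' (by simp); omega
  have hd : d = d' := by
    have h1 := hl d (by simp); have h2 := hr d' (by simp); omega
  exact ⟨ha, hb, hc, hd⟩

/-- **Injectivity of the A7 parametrisation `s4a`.** [cite: EntingJensen2009, §7.4.2, Fig. 7.10] -/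
theorem s4a_inj {k a i j d g a' i' j' d' g' : ℕ} (hij : i + j + 2 ≤ a) (hda : a ≤ i + j + d + 1) (hdk : d + 1
    ≤ k) (hga : a + g + 2 ≤ k) (hij' : i' + j' + 2 ≤ a') (hda' : a' ≤ i' + j' + d' + 1) (hdk' : d' + 1
    ≤ k) (hga' : a' + g' + 2 ≤ k)
    (h : s4a k a i j d g = s4a k a' i' j' d' g') : a = a' ∧ i = i' ∧ j = j' ∧ d = d' ∧ g = g' := by
  have hD := stepsD_s4a (m := 6 * k + 4) hij hda hdk hga rfl
  rw [h, stepsD_s4a hij' hda' hdk' hga' rfl] at hD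
  obtain ⟨e1, e2, e3, e4⟩ := quad_eq_of_lt hD (by omega) (by omega) (by omega) (by omega) (by omega) (by omega)
  have hU := stepsU_s4a (m := 6 * k + 4) hij hda hdk hga rfl
  rw [h, stepsU_s4a hij' hda' hdk' hga' rfl] at hU
  obtain ⟨e5, e6, e7, e8⟩ := quad_eq_of_lt hU (by omega) (by omega) (by omega) (by omega) (by omega) (by omega)
  refine ⟨?_, ?_, ?_, ?_, ?_⟩ <;> omega

/-- **An A7 block is never an A8 block.** [cite: EntingJensen2009, §7.4.2, Fig. 7.10] -/
theorem s4a_ne_s4b {k a i j d g i' j' e' g' : ℕ} (hij : i + j + 2 ≤ a) (hda : a ≤ i + j + d + 1) (hdk : d + 1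
    ≤ k) (hga : a + g + 2 ≤ k) (hij' : i' + j' + 3 ≤ k) (hgi' : g' ≤ i') (heg' : e' + g' ≤ i' + j') :
    s4a k a i j d g ≠ s4b k i' j' e' g' := by
  intro h
  have hD := stepsD_s4a (m := 6 * k + 4) hij hda hdk hga rfl
  rw [h, stepsD_s4b hij' hgi' heg' rfl] at hD
  obtain ⟨e1, e2, e3, e4⟩ := quad_eq_of_lt hD (by omega) (by omega) (by omega) (by omega) (by omega) (by omega)
  have hU := stepsU_s4a (m := 6 * k + 4) hij hda hdk hga rfl
  rw [h, stepsU_s4b hij' hgi' heg' rfl] at hU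
  obtain ⟨e5, e6, e7, e8⟩ := quad_eq_of_lt hU (by omega) (by omega) (by omega) (by omega) (by omega) (by omega)
  omega

/-- **An A7 block is never an A9 block.** [cite: EntingJensen2009, §7.4.2, Fig. 7.10] -/
theorem s4a_ne_s4c {k a i j d g a' i' j' e' g' : ℕ} (hij : i + j + 2 ≤ a) (hda : a ≤ i + j + d + 1) (hdk : d + 1
    ≤ k) (hga : a + g + 2 ≤ k) (ha' : 1 ≤ a') (hije' : i' + j' + e' + 3 ≤ k) (hgi' : i' + g' + 2 ≤ k) (hga' : a'
    + g' + 2 ≤ k) :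
    s4a k a i j d g ≠ s4c k a' i' j' e' g' := by
  intro h
  have hD := stepsD_s4a (m := 6 * k + 4) hij hda hdk hga rfl
  rw [h, stepsD_s4c ha' hije' hgi' hga' rfl] at hD
  obtain ⟨e1, e2, e3, e4⟩ := quad_eq_of_lt hD (by omega) (by omega) (by omega) (by omega) (by omega) (by omega)
  have hU := stepsU_s4a (m := 6 * k + 4) hij hda hdk hga rfl
  rw [h, stepsU_s4c ha' hije' hgi' hga' rfl] at hU
  obtain ⟨e5, e6, e7, e8⟩ := quad_eq_of_lt hU (by omega) (by omega) (by omega) (by omega) (by omega) (by omega)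
  omega

/-- **An A7 block is never an A10 block.** [cite: EntingJensen2009, §7.4.2, Fig. 7.10] -/
theorem s4a_ne_s4d {k a i j d g i' j' e' g' : ℕ} (hij : i + j + 2 ≤ a) (hda : a ≤ i + j + d + 1) (hdk : d + 1
    ≤ k) (hga : a + g + 2 ≤ k) (hs' : i' + j' + e' + g' + 4 ≤ k) :
    s4a k a i j d g ≠ s4d k i' j' e' g' := by
  intro h
  have hD := stepsD_s4a (m := 6 * k + 4) hij hda hdk hga rfl
  rw [h, stepsD_s4d hs' rfl] at hD
  obtain ⟨e1, e2, e3, e4⟩ := quad_eq_of_lt hD (by omega) (by omega) (by omega) (by omega) (by omega) (by omega)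
  have hU := stepsU_s4a (m := 6 * k + 4) hij hda hdk hga rfl
  rw [h, stepsU_s4d hs' rfl] at hU
  obtain ⟨e5, e6, e7, e8⟩ := quad_eq_of_lt hU (by omega) (by omega) (by omega) (by omega) (by omega) (by omega)
  omega

/-- **An A7 block is never an A11 block.** [cite: EntingJensen2009, §7.4.2, Fig. 7.10] -/
theorem s4a_ne_s4e {k a i j d g a' i' j' d' g' : ℕ} (hij : i + j + 2 ≤ a) (hda : a ≤ i + j + d + 1) (hdk : d + 1
    ≤ k) (hga : a + g + 2 ≤ k) (ha' : 1 ≤ a') (hs' : i' + j' + d' + g' + 4 ≤ k) (hga' : a' + g' + 2 ≤ k) :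
    s4a k a i j d g ≠ s4e k a' i' j' d' g' := by
  intro h
  have hD := stepsD_s4a (m := 6 * k + 4) hij hda hdk hga rfl
  rw [h, stepsD_s4e ha' hs' hga' rfl] at hD
  obtain ⟨e1, e2, e3, e4⟩ := quad_eq_of_lt hD (by omega) (by omega) (by omega) (by omega) (by omega) (by omega)
  have hU := stepsU_s4a (m := 6 * k + 4) hij hda hdk hga rfl
  rw [h, stepsU_s4e ha' hs' hga' rfl] at hU
  obtain ⟨e5, e6, e7, e8⟩ := quad_eq_of_lt hU (by omega) (by omega) (by omega) (by omega) (by omega) (by omega)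
  omega

/-- **An A7 block is never an A12 block.** [cite: EntingJensen2009, §7.4.2, Fig. 7.10] -/
theorem s4a_ne_s4f {k a i j d g i' j' d' g' : ℕ} (hij : i + j + 2 ≤ a) (hda : a ≤ i + j + d + 1) (hdk : d + 1
    ≤ k) (hga : a + g + 2 ≤ k) (hs' : i' + j' + d' + g' + 5 ≤ k) :
    s4a k a i j d g ≠ s4f k i' j' d' g' := by
  intro h
  have hD := stepsD_s4a (m := 6 * k + 4) hij hda hdk hga rfl
  rw [h, stepsD_s4f hs' rfl] at hD
  obtain ⟨e1, e2, e3, e4⟩ := quad_eq_of_lt hD (by omega) (by omega) (by omega) (by omega) (by omega) (by omega)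
  have hU := stepsU_s4a (m := 6 * k + 4) hij hda hdk hga rfl
  rw [h, stepsU_s4f hs' rfl] at hU
  obtain ⟨e5, e6, e7, e8⟩ := quad_eq_of_lt hU (by omega) (by omega) (by omega) (by omega) (by omega) (by omega)
  omega

/-- **An A7 block is never an A13 block.** [cite: EntingJensen2009, §7.4.2, Fig. 7.10] -/
theorem s4a_ne_s4g {k a i j d g a' i' d' e' g' : ℕ} (hij : i + j + 2 ≤ a) (hda : a ≤ i + j + d + 1) (hdk : d + 1
    ≤ k) (hga : a + g + 2 ≤ k) (ha' : 1 ≤ a') (hs' : a' + d' + e' + g' + 4 ≤ k) (hi' : i' + d' + e' + g' + 4 ≤ k) :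
    s4a k a i j d g ≠ s4g k a' i' d' e' g' := by
  intro h
  have hD := stepsD_s4a (m := 6 * k + 4) hij hda hdk hga rfl
  rw [h, stepsD_s4g ha' hs' hi' rfl] at hD
  obtain ⟨e1, e2, e3, e4⟩ := quad_eq_of_lt hD (by omega) (by omega) (by omega) (by omega) (by omega) (by omega)
  have hU := stepsU_s4a (m := 6 * k + 4) hij hda hdk hga rfl
  rw [h, stepsU_s4g ha' hs' hi' rfl] at hU
  obtain ⟨e5, e6, e7, e8⟩ := quad_eq_of_lt hU (by omega) (by omega) (by omega) (by omega) (by omega) (by omega)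
  omega

/-- **An A7 block is never an A14 block.** [cite: EntingJensen2009, §7.4.2, Fig. 7.10] -/
theorem s4a_ne_s4h {k a i j d g a' i' j' d' g' : ℕ} (hij : i + j + 2 ≤ a) (hda : a ≤ i + j + d + 1) (hdk : d + 1
    ≤ k) (hga : a + g + 2 ≤ k) (hd' : i' + j' + d' + 3 ≤ a') (hga' : a' + g' + 2 ≤ k) :
    s4a k a i j d g ≠ s4h k a' i' j' d' g' := by
  intro h
  have hD := stepsD_s4a (m := 6 * k + 4) hij hda hdk hga rfl
  rw [h, stepsD_s4h hd' hga' rfl] at hD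
  obtain ⟨e1, e2, e3, e4⟩ := quad_eq_of_lt hD (by omega) (by omega) (by omega) (by omega) (by omega) (by omega)
  have hU := stepsU_s4a (m := 6 * k + 4) hij hda hdk hga rfl
  rw [h, stepsU_s4h hd' hga' rfl] at hU
  obtain ⟨e5, e6, e7, e8⟩ := quad_eq_of_lt hU (by omega) (by omega) (by omega) (by omega) (by omega) (by omega)
  omega

/-- **An A7 block is never an A15 block.** [cite: EntingJensen2009, §7.4.2, Fig. 7.10] -/
theorem s4a_ne_s4i {k a i j d g i' j' d' g' : ℕ} (hij : i + j + 2 ≤ a) (hda : a ≤ i + j + d + 1) (hdk : d + 1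
    ≤ k) (hga : a + g + 2 ≤ k) (hd' : i' + j' + d' + 4 ≤ k) (hgi' : g' ≤ i') :
    s4a k a i j d g ≠ s4i k i' j' d' g' := by
  intro h
  have hD := stepsD_s4a (m := 6 * k + 4) hij hda hdk hga rfl
  rw [h, stepsD_s4i hd' hgi' rfl] at hD
  obtain ⟨e1, e2, e3, e4⟩ := quad_eq_of_lt hD (by omega) (by omega) (by omega) (by omega) (by omega) (by omega)
  have hU := stepsU_s4a (m := 6 * k + 4) hij hda hdk hga rfl
  rw [h, stepsU_s4i hd' hgi' rfl] at hU
  obtain ⟨e5, e6, e7, e8⟩ := quad_eq_of_lt hU (by omega) (by omega) (by omega) (by omega) (by omega) (by omega)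
  omega

/-- **An A7 block is never a B5 block.** [cite: EntingJensen2009, §7.4.2, Fig. 7.10] -/
theorem s4a_ne_s4j {k a i j d g a' : ℕ} (hij : i + j + 2 ≤ a) (hda : a ≤ i + j + d + 1) (hdk : d + 1 ≤ k) (hga : a
    + g + 2 ≤ k) (ha' : 1 ≤ a') (hak' : a' + 2 ≤ k) :
    s4a k a i j d g ≠ s4j k a' := by
  intro h
  have hD := stepsD_s4a (m := 6 * k + 4) hij hda hdk hga rfl
  rw [h, stepsD_s4j ha' hak' rfl] at hD
  obtain ⟨e1, e2, e3, e4⟩ := quad_eq_of_lt hD (by omega) (by omega) (by omega) (by omega) (by omega) (by omega)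
  have hU := stepsU_s4a (m := 6 * k + 4) hij hda hdk hga rfl
  rw [h, stepsU_s4j ha' hak' rfl] at hU
  obtain ⟨e5, e6, e7, e8⟩ := quad_eq_of_lt hU (by omega) (by omega) (by omega) (by omega) (by omega) (by omega)
  omega

/-- **Injectivity of the A8 parametrisation `s4b`.** [cite: EntingJensen2009, §7.4.2, Fig. 7.10] -/
theorem s4b_inj {k i j e g i' j' e' g' : ℕ} (hij : i + j + 3 ≤ k) (hgi : g ≤ i) (heg : e + g ≤ i + j) (hij' : i'
    + j' + 3 ≤ k) (hgi' : g' ≤ i') (heg' : e' + g' ≤ i' + j')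
    (h : s4b k i j e g = s4b k i' j' e' g') : i = i' ∧ j = j' ∧ e = e' ∧ g = g' := by
  have hD := stepsD_s4b (m := 6 * k + 4) hij hgi heg rfl
  rw [h, stepsD_s4b hij' hgi' heg' rfl] at hD
  obtain ⟨e1, e2, e3, e4⟩ := quad_eq_of_lt hD (by omega) (by omega) (by omega) (by omega) (by omega) (by omega)
  have hU := stepsU_s4b (m := 6 * k + 4) hij hgi heg rfl
  rw [h, stepsU_s4b hij' hgi' heg' rfl] at hU
  obtain ⟨e5, e6, e7, e8⟩ := quad_eq_of_lt hU (by omega) (by omega) (by omega) (by omega) (by omega) (by omega)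
  refine ⟨?_, ?_, ?_, ?_⟩ <;> omega

/-- **An A8 block is never an A9 block.** [cite: EntingJensen2009, §7.4.2, Fig. 7.10] -/
theorem s4b_ne_s4c {k i j e g a' i' j' e' g' : ℕ} (hij : i + j + 3 ≤ k) (hgi : g ≤ i) (heg : e + g ≤ i
    + j) (ha' : 1 ≤ a') (hije' : i' + j' + e' + 3 ≤ k) (hgi' : i' + g' + 2 ≤ k) (hga' : a' + g' + 2 ≤ k) :
    s4b k i j e g ≠ s4c k a' i' j' e' g' := by
  intro h
  have hD := stepsD_s4b (m := 6 * k + 4) hij hgi heg rfl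
  rw [h, stepsD_s4c ha' hije' hgi' hga' rfl] at hD
  obtain ⟨e1, e2, e3, e4⟩ := quad_eq_of_lt hD (by omega) (by omega) (by omega) (by omega) (by omega) (by omega)
  have hU := stepsU_s4b (m := 6 * k + 4) hij hgi heg rfl
  rw [h, stepsU_s4c ha' hije' hgi' hga' rfl] at hU
  obtain ⟨e5, e6, e7, e8⟩ := quad_eq_of_lt hU (by omega) (by omega) (by omega) (by omega) (by omega) (by omega)
  omega

/-- **An A8 block is never an A10 block.** [cite: EntingJensen2009, §7.4.2, Fig. 7.10] -/
theorem s4b_ne_s4d {k i j e g i' j' e' g' : ℕ} (hij : i + j + 3 ≤ k) (hgi : g ≤ i) (heg : e + g ≤ i + j) (hs' : i'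
    + j' + e' + g' + 4 ≤ k) :
    s4b k i j e g ≠ s4d k i' j' e' g' := by
  intro h
  have hD := stepsD_s4b (m := 6 * k + 4) hij hgi heg rfl
  rw [h, stepsD_s4d hs' rfl] at hD
  obtain ⟨e1, e2, e3, e4⟩ := quad_eq_of_lt hD (by omega) (by omega) (by omega) (by omega) (by omega) (by omega)
  have hU := stepsU_s4b (m := 6 * k + 4) hij hgi heg rfl
  rw [h, stepsU_s4d hs' rfl] at hU
  obtain ⟨e5, e6, e7, e8⟩ := quad_eq_of_lt hU (by omega) (by omega) (by omega) (by omega) (by omega) (by omega)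
  omega

/-- **An A8 block is never an A11 block.** [cite: EntingJensen2009, §7.4.2, Fig. 7.10] -/
theorem s4b_ne_s4e {k i j e g a' i' j' d' g' : ℕ} (hij : i + j + 3 ≤ k) (hgi : g ≤ i) (heg : e + g ≤ i
    + j) (ha' : 1 ≤ a') (hs' : i' + j' + d' + g' + 4 ≤ k) (hga' : a' + g' + 2 ≤ k) :
    s4b k i j e g ≠ s4e k a' i' j' d' g' := by
  intro h
  have hD := stepsD_s4b (m := 6 * k + 4) hij hgi heg rfl
  rw [h, stepsD_s4e ha' hs' hga' rfl] at hD
  obtain ⟨e1, e2, e3, e4⟩ := quad_eq_of_lt hD (by omega) (by omega) (by omega) (by omega) (by omega) (by omega)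
  have hU := stepsU_s4b (m := 6 * k + 4) hij hgi heg rfl
  rw [h, stepsU_s4e ha' hs' hga' rfl] at hU
  obtain ⟨e5, e6, e7, e8⟩ := quad_eq_of_lt hU (by omega) (by omega) (by omega) (by omega) (by omega) (by omega)
  omega

/-- **An A8 block is never an A12 block.** [cite: EntingJensen2009, §7.4.2, Fig. 7.10] -/
theorem s4b_ne_s4f {k i j e g i' j' d' g' : ℕ} (hij : i + j + 3 ≤ k) (hgi : g ≤ i) (heg : e + g ≤ i + j) (hs' : i'
    + j' + d' + g' + 5 ≤ k) :
    s4b k i j e g ≠ s4f k i' j' d' g' := by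
  intro h
  have hD := stepsD_s4b (m := 6 * k + 4) hij hgi heg rfl
  rw [h, stepsD_s4f hs' rfl] at hD
  obtain ⟨e1, e2, e3, e4⟩ := quad_eq_of_lt hD (by omega) (by omega) (by omega) (by omega) (by omega) (by omega)
  have hU := stepsU_s4b (m := 6 * k + 4) hij hgi heg rfl
  rw [h, stepsU_s4f hs' rfl] at hU
  obtain ⟨e5, e6, e7, e8⟩ := quad_eq_of_lt hU (by omega) (by omega) (by omega) (by omega) (by omega) (by omega)
  omega

/-- **An A8 block is never an A13 block.** [cite: EntingJensen2009, §7.4.2, Fig. 7.10] -/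
theorem s4b_ne_s4g {k i j e g a' i' d' e' g' : ℕ} (hij : i + j + 3 ≤ k) (hgi : g ≤ i) (heg : e + g ≤ i
    + j) (ha' : 1 ≤ a') (hs' : a' + d' + e' + g' + 4 ≤ k) (hi' : i' + d' + e' + g' + 4 ≤ k) :
    s4b k i j e g ≠ s4g k a' i' d' e' g' := by
  intro h
  have hD := stepsD_s4b (m := 6 * k + 4) hij hgi heg rfl
  rw [h, stepsD_s4g ha' hs' hi' rfl] at hD
  obtain ⟨e1, e2, e3, e4⟩ := quad_eq_of_lt hD (by omega) (by omega) (by omega) (by omega) (by omega) (by omega)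
  have hU := stepsU_s4b (m := 6 * k + 4) hij hgi heg rfl
  rw [h, stepsU_s4g ha' hs' hi' rfl] at hU
  obtain ⟨e5, e6, e7, e8⟩ := quad_eq_of_lt hU (by omega) (by omega) (by omega) (by omega) (by omega) (by omega)
  omega

/-- **An A8 block is never an A14 block.** [cite: EntingJensen2009, §7.4.2, Fig. 7.10] -/
theorem s4b_ne_s4h {k i j e g a' i' j' d' g' : ℕ} (hij : i + j + 3 ≤ k) (hgi : g ≤ i) (heg : e + g ≤ i
    + j) (hd' : i' + j' + d' + 3 ≤ a') (hga' : a' + g' + 2 ≤ k) :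
    s4b k i j e g ≠ s4h k a' i' j' d' g' := by
  intro h
  have hD := stepsD_s4b (m := 6 * k + 4) hij hgi heg rfl
  rw [h, stepsD_s4h hd' hga' rfl] at hD
  obtain ⟨e1, e2, e3, e4⟩ := quad_eq_of_lt hD (by omega) (by omega) (by omega) (by omega) (by omega) (by omega)
  have hU := stepsU_s4b (m := 6 * k + 4) hij hgi heg rfl
  rw [h, stepsU_s4h hd' hga' rfl] at hU
  obtain ⟨e5, e6, e7, e8⟩ := quad_eq_of_lt hU (by omega) (by omega) (by omega) (by omega) (by omega) (by omega)
  omega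

/-- **An A8 block is never an A15 block.** [cite: EntingJensen2009, §7.4.2, Fig. 7.10] -/
theorem s4b_ne_s4i {k i j e g i' j' d' g' : ℕ} (hij : i + j + 3 ≤ k) (hgi : g ≤ i) (heg : e + g ≤ i + j) (hd' : i'
    + j' + d' + 4 ≤ k) (hgi' : g' ≤ i') :
    s4b k i j e g ≠ s4i k i' j' d' g' := by
  intro h
  have hD := stepsD_s4b (m := 6 * k + 4) hij hgi heg rfl
  rw [h, stepsD_s4i hd' hgi' rfl] at hD
  obtain ⟨e1, e2, e3, e4⟩ := quad_eq_of_lt hD (by omega) (by omega) (by omega) (by omega) (by omega) (by omega)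
  have hU := stepsU_s4b (m := 6 * k + 4) hij hgi heg rfl
  rw [h, stepsU_s4i hd' hgi' rfl] at hU
  obtain ⟨e5, e6, e7, e8⟩ := quad_eq_of_lt hU (by omega) (by omega) (by omega) (by omega) (by omega) (by omega)
  omega

/-- **An A8 block is never a B5 block.** [cite: EntingJensen2009, §7.4.2, Fig. 7.10] -/
theorem s4b_ne_s4j {k i j e g a' : ℕ} (hij : i + j + 3 ≤ k) (hgi : g ≤ i) (heg : e + g ≤ i + j) (ha' : 1
    ≤ a') (hak' : a' + 2 ≤ k) :
    s4b k i j e g ≠ s4j k a' := by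
  intro h
  have hD := stepsD_s4b (m := 6 * k + 4) hij hgi heg rfl
  rw [h, stepsD_s4j ha' hak' rfl] at hD
  obtain ⟨e1, e2, e3, e4⟩ := quad_eq_of_lt hD (by omega) (by omega) (by omega) (by omega) (by omega) (by omega)
  have hU := stepsU_s4b (m := 6 * k + 4) hij hgi heg rfl
  rw [h, stepsU_s4j ha' hak' rfl] at hU
  obtain ⟨e5, e6, e7, e8⟩ := quad_eq_of_lt hU (by omega) (by omega) (by omega) (by omega) (by omega) (by omega)
  omega

/-- **Injectivity of the A9 parametrisation `s4c`.** [cite: EntingJensen2009, §7.4.2, Fig. 7.10] -/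
theorem s4c_inj {k a i j e g a' i' j' e' g' : ℕ} (ha : 1 ≤ a) (hije : i + j + e + 3 ≤ k) (hgi : i + g + 2
    ≤ k) (hga : a + g + 2 ≤ k) (ha' : 1 ≤ a') (hije' : i' + j' + e' + 3 ≤ k) (hgi' : i' + g' + 2 ≤ k) (hga' : a'
    + g' + 2 ≤ k)
    (h : s4c k a i j e g = s4c k a' i' j' e' g') : a = a' ∧ i = i' ∧ j = j' ∧ e = e' ∧ g = g' := by
  have hD := stepsD_s4c (m := 6 * k + 4) ha hije hgi hga rfl
  rw [h, stepsD_s4c ha' hije' hgi' hga' rfl] at hD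
  obtain ⟨e1, e2, e3, e4⟩ := quad_eq_of_lt hD (by omega) (by omega) (by omega) (by omega) (by omega) (by omega)
  have hU := stepsU_s4c (m := 6 * k + 4) ha hije hgi hga rfl
  rw [h, stepsU_s4c ha' hije' hgi' hga' rfl] at hU
  obtain ⟨e5, e6, e7, e8⟩ := quad_eq_of_lt hU (by omega) (by omega) (by omega) (by omega) (by omega) (by omega)
  refine ⟨?_, ?_, ?_, ?_, ?_⟩ <;> omega

/-- **An A9 block is never an A10 block.** [cite: EntingJensen2009, §7.4.2, Fig. 7.10] -/
theorem s4c_ne_s4d {k a i j e g i' j' e' g' : ℕ} (ha : 1 ≤ a) (hije : i + j + e + 3 ≤ k) (hgi : i + g + 2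
    ≤ k) (hga : a + g + 2 ≤ k) (hs' : i' + j' + e' + g' + 4 ≤ k) :
    s4c k a i j e g ≠ s4d k i' j' e' g' := by
  intro h
  have hD := stepsD_s4c (m := 6 * k + 4) ha hije hgi hga rfl
  rw [h, stepsD_s4d hs' rfl] at hD
  obtain ⟨e1, e2, e3, e4⟩ := quad_eq_of_lt hD (by omega) (by omega) (by omega) (by omega) (by omega) (by omega)
  have hU := stepsU_s4c (m := 6 * k + 4) ha hije hgi hga rfl
  rw [h, stepsU_s4d hs' rfl] at hU
  obtain ⟨e5, e6, e7, e8⟩ := quad_eq_of_lt hU (by omega) (by omega) (by omega) (by omega) (by omega) (by omega)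
  omega

/-- **An A9 block is never an A11 block.** [cite: EntingJensen2009, §7.4.2, Fig. 7.10] -/
theorem s4c_ne_s4e {k a i j e g a' i' j' d' g' : ℕ} (ha : 1 ≤ a) (hije : i + j + e + 3 ≤ k) (hgi : i + g + 2
    ≤ k) (hga : a + g + 2 ≤ k) (ha' : 1 ≤ a') (hs' : i' + j' + d' + g' + 4 ≤ k) (hga' : a' + g' + 2 ≤ k) :
    s4c k a i j e g ≠ s4e k a' i' j' d' g' := by
  intro h
  have hD := stepsD_s4c (m := 6 * k + 4) ha hije hgi hga rfl
  rw [h, stepsD_s4e ha' hs' hga' rfl] at hD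
  obtain ⟨e1, e2, e3, e4⟩ := quad_eq_of_lt hD (by omega) (by omega) (by omega) (by omega) (by omega) (by omega)
  have hU := stepsU_s4c (m := 6 * k + 4) ha hije hgi hga rfl
  rw [h, stepsU_s4e ha' hs' hga' rfl] at hU
  obtain ⟨e5, e6, e7, e8⟩ := quad_eq_of_lt hU (by omega) (by omega) (by omega) (by omega) (by omega) (by omega)
  omega

/-- **An A9 block is never an A12 block.** [cite: EntingJensen2009, §7.4.2, Fig. 7.10] -/
theorem s4c_ne_s4f {k a i j e g i' j' d' g' : ℕ} (ha : 1 ≤ a) (hije : i + j + e + 3 ≤ k) (hgi : i + g + 2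
    ≤ k) (hga : a + g + 2 ≤ k) (hs' : i' + j' + d' + g' + 5 ≤ k) :
    s4c k a i j e g ≠ s4f k i' j' d' g' := by
  intro h
  have hD := stepsD_s4c (m := 6 * k + 4) ha hije hgi hga rfl
  rw [h, stepsD_s4f hs' rfl] at hD
  obtain ⟨e1, e2, e3, e4⟩ := quad_eq_of_lt hD (by omega) (by omega) (by omega) (by omega) (by omega) (by omega)
  have hU := stepsU_s4c (m := 6 * k + 4) ha hije hgi hga rfl
  rw [h, stepsU_s4f hs' rfl] at hU
  obtain ⟨e5, e6, e7, e8⟩ := quad_eq_of_lt hU (by omega) (by omega) (by omega) (by omega) (by omega) (by omega)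
  omega

/-- **An A9 block is never an A13 block.** [cite: EntingJensen2009, §7.4.2, Fig. 7.10] -/
theorem s4c_ne_s4g {k a i j e g a' i' d' e' g' : ℕ} (ha : 1 ≤ a) (hije : i + j + e + 3 ≤ k) (hgi : i + g + 2
    ≤ k) (hga : a + g + 2 ≤ k) (ha' : 1 ≤ a') (hs' : a' + d' + e' + g' + 4 ≤ k) (hi' : i' + d' + e' + g' + 4 ≤ k) :
    s4c k a i j e g ≠ s4g k a' i' d' e' g' := by
  intro h
  have hD := stepsD_s4c (m := 6 * k + 4) ha hije hgi hga rfl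
  rw [h, stepsD_s4g ha' hs' hi' rfl] at hD
  obtain ⟨e1, e2, e3, e4⟩ := quad_eq_of_lt hD (by omega) (by omega) (by omega) (by omega) (by omega) (by omega)
  have hU := stepsU_s4c (m := 6 * k + 4) ha hije hgi hga rfl
  rw [h, stepsU_s4g ha' hs' hi' rfl] at hU
  obtain ⟨e5, e6, e7, e8⟩ := quad_eq_of_lt hU (by omega) (by omega) (by omega) (by omega) (by omega) (by omega)
  omega

/-- **An A9 block is never an A14 block.** [cite: EntingJensen2009, §7.4.2, Fig. 7.10] -/
theorem s4c_ne_s4h {k a i j e g a' i' j' d' g' : ℕ} (ha : 1 ≤ a) (hije : i + j + e + 3 ≤ k) (hgi : i + g + 2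
    ≤ k) (hga : a + g + 2 ≤ k) (hd' : i' + j' + d' + 3 ≤ a') (hga' : a' + g' + 2 ≤ k) :
    s4c k a i j e g ≠ s4h k a' i' j' d' g' := by
  intro h
  have hD := stepsD_s4c (m := 6 * k + 4) ha hije hgi hga rfl
  rw [h, stepsD_s4h hd' hga' rfl] at hD
  obtain ⟨e1, e2, e3, e4⟩ := quad_eq_of_lt hD (by omega) (by omega) (by omega) (by omega) (by omega) (by omega)
  have hU := stepsU_s4c (m := 6 * k + 4) ha hije hgi hga rfl
  rw [h, stepsU_s4h hd' hga' rfl] at hU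
  obtain ⟨e5, e6, e7, e8⟩ := quad_eq_of_lt hU (by omega) (by omega) (by omega) (by omega) (by omega) (by omega)
  omega

/-- **An A9 block is never an A15 block.** [cite: EntingJensen2009, §7.4.2, Fig. 7.10] -/
theorem s4c_ne_s4i {k a i j e g i' j' d' g' : ℕ} (ha : 1 ≤ a) (hije : i + j + e + 3 ≤ k) (hgi : i + g + 2
    ≤ k) (hga : a + g + 2 ≤ k) (hd' : i' + j' + d' + 4 ≤ k) (hgi' : g' ≤ i') :
    s4c k a i j e g ≠ s4i k i' j' d' g' := by
  intro h
  have hD := stepsD_s4c (m := 6 * k + 4) ha hije hgi hga rfl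
  rw [h, stepsD_s4i hd' hgi' rfl] at hD
  obtain ⟨e1, e2, e3, e4⟩ := quad_eq_of_lt hD (by omega) (by omega) (by omega) (by omega) (by omega) (by omega)
  have hU := stepsU_s4c (m := 6 * k + 4) ha hije hgi hga rfl
  rw [h, stepsU_s4i hd' hgi' rfl] at hU
  obtain ⟨e5, e6, e7, e8⟩ := quad_eq_of_lt hU (by omega) (by omega) (by omega) (by omega) (by omega) (by omega)
  omega

/-- **An A9 block is never a B5 block.** [cite: EntingJensen2009, §7.4.2, Fig. 7.10] -/
theorem s4c_ne_s4j {k a i j e g a' : ℕ} (ha : 1 ≤ a) (hije : i + j + e + 3 ≤ k) (hgi : i + g + 2 ≤ k) (hga : a + g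
    + 2 ≤ k) (ha' : 1 ≤ a') (hak' : a' + 2 ≤ k) :
    s4c k a i j e g ≠ s4j k a' := by
  intro h
  have hD := stepsD_s4c (m := 6 * k + 4) ha hije hgi hga rfl
  rw [h, stepsD_s4j ha' hak' rfl] at hD
  obtain ⟨e1, e2, e3, e4⟩ := quad_eq_of_lt hD (by omega) (by omega) (by omega) (by omega) (by omega) (by omega)
  have hU := stepsU_s4c (m := 6 * k + 4) ha hije hgi hga rfl
  rw [h, stepsU_s4j ha' hak' rfl] at hU
  obtain ⟨e5, e6, e7, e8⟩ := quad_eq_of_lt hU (by omega) (by omega) (by omega) (by omega) (by omega) (by omega)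
  omega

/-- **Injectivity of the A10 parametrisation `s4d`.** [cite: EntingJensen2009, §7.4.2, Fig. 7.10] -/
theorem s4d_inj {k i j e g i' j' e' g' : ℕ} (hs : i + j + e + g + 4 ≤ k) (hs' : i' + j' + e' + g' + 4 ≤ k)
    (h : s4d k i j e g = s4d k i' j' e' g') : i = i' ∧ j = j' ∧ e = e' ∧ g = g' := by
  have hD := stepsD_s4d (m := 6 * k + 4) hs rfl
  rw [h, stepsD_s4d hs' rfl] at hD
  obtain ⟨e1, e2, e3, e4⟩ := quad_eq_of_lt hD (by omega) (by omega) (by omega) (by omega) (by omega) (by omega)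
  have hU := stepsU_s4d (m := 6 * k + 4) hs rfl
  rw [h, stepsU_s4d hs' rfl] at hU
  obtain ⟨e5, e6, e7, e8⟩ := quad_eq_of_lt hU (by omega) (by omega) (by omega) (by omega) (by omega) (by omega)
  refine ⟨?_, ?_, ?_, ?_⟩ <;> omega

/-- **An A10 block is never an A11 block.** [cite: EntingJensen2009, §7.4.2, Fig. 7.10] -/
theorem s4d_ne_s4e {k i j e g a' i' j' d' g' : ℕ} (hs : i + j + e + g + 4 ≤ k) (ha' : 1 ≤ a') (hs' : i' + j' + d'
    + g' + 4 ≤ k) (hga' : a' + g' + 2 ≤ k) :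
    s4d k i j e g ≠ s4e k a' i' j' d' g' := by
  intro h
  have hD := stepsD_s4d (m := 6 * k + 4) hs rfl
  rw [h, stepsD_s4e ha' hs' hga' rfl] at hD
  obtain ⟨e1, e2, e3, e4⟩ := quad_eq_of_lt hD (by omega) (by omega) (by omega) (by omega) (by omega) (by omega)
  have hU := stepsU_s4d (m := 6 * k + 4) hs rfl
  rw [h, stepsU_s4e ha' hs' hga' rfl] at hU
  obtain ⟨e5, e6, e7, e8⟩ := quad_eq_of_lt hU (by omega) (by omega) (by omega) (by omega) (by omega) (by omega)
  omega

/-- **An A10 block is never an A12 block.** [cite: EntingJensen2009, §7.4.2, Fig. 7.10] -/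
theorem s4d_ne_s4f {k i j e g i' j' d' g' : ℕ} (hs : i + j + e + g + 4 ≤ k) (hs' : i' + j' + d' + g' + 5 ≤ k) :
    s4d k i j e g ≠ s4f k i' j' d' g' := by
  intro h
  have hD := stepsD_s4d (m := 6 * k + 4) hs rfl
  rw [h, stepsD_s4f hs' rfl] at hD
  obtain ⟨e1, e2, e3, e4⟩ := quad_eq_of_lt hD (by omega) (by omega) (by omega) (by omega) (by omega) (by omega)
  have hU := stepsU_s4d (m := 6 * k + 4) hs rfl
  rw [h, stepsU_s4f hs' rfl] at hU
  obtain ⟨e5, e6, e7, e8⟩ := quad_eq_of_lt hU (by omega) (by omega) (by omega) (by omega) (by omega) (by omega)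
  omega

/-- **An A10 block is never an A13 block.** [cite: EntingJensen2009, §7.4.2, Fig. 7.10] -/
theorem s4d_ne_s4g {k i j e g a' i' d' e' g' : ℕ} (hs : i + j + e + g + 4 ≤ k) (ha' : 1 ≤ a') (hs' : a' + d' + e'
    + g' + 4 ≤ k) (hi' : i' + d' + e' + g' + 4 ≤ k) :
    s4d k i j e g ≠ s4g k a' i' d' e' g' := by
  intro h
  have hD := stepsD_s4d (m := 6 * k + 4) hs rfl
  rw [h, stepsD_s4g ha' hs' hi' rfl] at hD
  obtain ⟨e1, e2, e3, e4⟩ := quad_eq_of_lt hD (by omega) (by omega) (by omega) (by omega) (by omega) (by omega)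
  have hU := stepsU_s4d (m := 6 * k + 4) hs rfl
  rw [h, stepsU_s4g ha' hs' hi' rfl] at hU
  obtain ⟨e5, e6, e7, e8⟩ := quad_eq_of_lt hU (by omega) (by omega) (by omega) (by omega) (by omega) (by omega)
  omega

/-- **An A10 block is never an A14 block.** [cite: EntingJensen2009, §7.4.2, Fig. 7.10] -/
theorem s4d_ne_s4h {k i j e g a' i' j' d' g' : ℕ} (hs : i + j + e + g + 4 ≤ k) (hd' : i' + j' + d' + 3
    ≤ a') (hga' : a' + g' + 2 ≤ k) :
    s4d k i j e g ≠ s4h k a' i' j' d' g' := by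
  intro h
  have hD := stepsD_s4d (m := 6 * k + 4) hs rfl
  rw [h, stepsD_s4h hd' hga' rfl] at hD
  obtain ⟨e1, e2, e3, e4⟩ := quad_eq_of_lt hD (by omega) (by omega) (by omega) (by omega) (by omega) (by omega)
  have hU := stepsU_s4d (m := 6 * k + 4) hs rfl
  rw [h, stepsU_s4h hd' hga' rfl] at hU
  obtain ⟨e5, e6, e7, e8⟩ := quad_eq_of_lt hU (by omega) (by omega) (by omega) (by omega) (by omega) (by omega)
  omega

/-- **An A10 block is never an A15 block.** [cite: EntingJensen2009, §7.4.2, Fig. 7.10] -/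
theorem s4d_ne_s4i {k i j e g i' j' d' g' : ℕ} (hs : i + j + e + g + 4 ≤ k) (hd' : i' + j' + d' + 4 ≤ k) (hgi' : g'
    ≤ i') :
    s4d k i j e g ≠ s4i k i' j' d' g' := by
  intro h
  have hD := stepsD_s4d (m := 6 * k + 4) hs rfl
  rw [h, stepsD_s4i hd' hgi' rfl] at hD
  obtain ⟨e1, e2, e3, e4⟩ := quad_eq_of_lt hD (by omega) (by omega) (by omega) (by omega) (by omega) (by omega)
  have hU := stepsU_s4d (m := 6 * k + 4) hs rfl
  rw [h, stepsU_s4i hd' hgi' rfl] at hU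
  obtain ⟨e5, e6, e7, e8⟩ := quad_eq_of_lt hU (by omega) (by omega) (by omega) (by omega) (by omega) (by omega)
  omega

/-- **An A10 block is never a B5 block.** [cite: EntingJensen2009, §7.4.2, Fig. 7.10] -/
theorem s4d_ne_s4j {k i j e g a' : ℕ} (hs : i + j + e + g + 4 ≤ k) (ha' : 1 ≤ a') (hak' : a' + 2 ≤ k) :
    s4d k i j e g ≠ s4j k a' := by
  intro h
  have hD := stepsD_s4d (m := 6 * k + 4) hs rfl
  rw [h, stepsD_s4j ha' hak' rfl] at hD
  obtain ⟨e1, e2, e3, e4⟩ := quad_eq_of_lt hD (by omega) (by omega) (by omega) (by omega) (by omega) (by omega)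
  have hU := stepsU_s4d (m := 6 * k + 4) hs rfl
  rw [h, stepsU_s4j ha' hak' rfl] at hU
  obtain ⟨e5, e6, e7, e8⟩ := quad_eq_of_lt hU (by omega) (by omega) (by omega) (by omega) (by omega) (by omega)
  omega

/-- **Injectivity of the A11 parametrisation `s4e`.** [cite: EntingJensen2009, §7.4.2, Fig. 7.10] -/
theorem s4e_inj {k a i j d g a' i' j' d' g' : ℕ} (ha : 1 ≤ a) (hs : i + j + d + g + 4 ≤ k) (hga : a + g + 2
    ≤ k) (ha' : 1 ≤ a') (hs' : i' + j' + d' + g' + 4 ≤ k) (hga' : a' + g' + 2 ≤ k)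
    (h : s4e k a i j d g = s4e k a' i' j' d' g') : a = a' ∧ i = i' ∧ j = j' ∧ d = d' ∧ g = g' := by
  have hD := stepsD_s4e (m := 6 * k + 4) ha hs hga rfl
  rw [h, stepsD_s4e ha' hs' hga' rfl] at hD
  obtain ⟨e1, e2, e3, e4⟩ := quad_eq_of_lt hD (by omega) (by omega) (by omega) (by omega) (by omega) (by omega)
  have hU := stepsU_s4e (m := 6 * k + 4) ha hs hga rfl
  rw [h, stepsU_s4e ha' hs' hga' rfl] at hU
  obtain ⟨e5, e6, e7, e8⟩ := quad_eq_of_lt hU (by omega) (by omega) (by omega) (by omega) (by omega) (by omega)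
  refine ⟨?_, ?_, ?_, ?_, ?_⟩ <;> omega

/-- **An A11 block is never an A12 block.** [cite: EntingJensen2009, §7.4.2, Fig. 7.10] -/
theorem s4e_ne_s4f {k a i j d g i' j' d' g' : ℕ} (ha : 1 ≤ a) (hs : i + j + d + g + 4 ≤ k) (hga : a + g + 2
    ≤ k) (hs' : i' + j' + d' + g' + 5 ≤ k) :
    s4e k a i j d g ≠ s4f k i' j' d' g' := by
  intro h
  have hD := stepsD_s4e (m := 6 * k + 4) ha hs hga rfl
  rw [h, stepsD_s4f hs' rfl] at hD
  obtain ⟨e1, e2, e3, e4⟩ := quad_eq_of_lt hD (by omega) (by omega) (by omega) (by omega) (by omega) (by omega)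
  have hU := stepsU_s4e (m := 6 * k + 4) ha hs hga rfl
  rw [h, stepsU_s4f hs' rfl] at hU
  obtain ⟨e5, e6, e7, e8⟩ := quad_eq_of_lt hU (by omega) (by omega) (by omega) (by omega) (by omega) (by omega)
  omega

/-- **An A11 block is never an A13 block.** [cite: EntingJensen2009, §7.4.2, Fig. 7.10] -/
theorem s4e_ne_s4g {k a i j d g a' i' d' e' g' : ℕ} (ha : 1 ≤ a) (hs : i + j + d + g + 4 ≤ k) (hga : a + g + 2
    ≤ k) (ha' : 1 ≤ a') (hs' : a' + d' + e' + g' + 4 ≤ k) (hi' : i' + d' + e' + g' + 4 ≤ k) :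
    s4e k a i j d g ≠ s4g k a' i' d' e' g' := by
  intro h
  have hD := stepsD_s4e (m := 6 * k + 4) ha hs hga rfl
  rw [h, stepsD_s4g ha' hs' hi' rfl] at hD
  obtain ⟨e1, e2, e3, e4⟩ := quad_eq_of_lt hD (by omega) (by omega) (by omega) (by omega) (by omega) (by omega)
  have hU := stepsU_s4e (m := 6 * k + 4) ha hs hga rfl
  rw [h, stepsU_s4g ha' hs' hi' rfl] at hU
  obtain ⟨e5, e6, e7, e8⟩ := quad_eq_of_lt hU (by omega) (by omega) (by omega) (by omega) (by omega) (by omega)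
  omega

/-- **An A11 block is never an A14 block.** [cite: EntingJensen2009, §7.4.2, Fig. 7.10] -/
theorem s4e_ne_s4h {k a i j d g a' i' j' d' g' : ℕ} (ha : 1 ≤ a) (hs : i + j + d + g + 4 ≤ k) (hga : a + g + 2
    ≤ k) (hd' : i' + j' + d' + 3 ≤ a') (hga' : a' + g' + 2 ≤ k) :
    s4e k a i j d g ≠ s4h k a' i' j' d' g' := by
  intro h
  have hD := stepsD_s4e (m := 6 * k + 4) ha hs hga rfl
  rw [h, stepsD_s4h hd' hga' rfl] at hD
  obtain ⟨e1, e2, e3, e4⟩ := quad_eq_of_lt hD (by omega) (by omega) (by omega) (by omega) (by omega) (by omega)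
  have hU := stepsU_s4e (m := 6 * k + 4) ha hs hga rfl
  rw [h, stepsU_s4h hd' hga' rfl] at hU
  obtain ⟨e5, e6, e7, e8⟩ := quad_eq_of_lt hU (by omega) (by omega) (by omega) (by omega) (by omega) (by omega)
  omega

/-- **An A11 block is never an A15 block.** [cite: EntingJensen2009, §7.4.2, Fig. 7.10] -/
theorem s4e_ne_s4i {k a i j d g i' j' d' g' : ℕ} (ha : 1 ≤ a) (hs : i + j + d + g + 4 ≤ k) (hga : a + g + 2
    ≤ k) (hd' : i' + j' + d' + 4 ≤ k) (hgi' : g' ≤ i') :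
    s4e k a i j d g ≠ s4i k i' j' d' g' := by
  intro h
  have hD := stepsD_s4e (m := 6 * k + 4) ha hs hga rfl
  rw [h, stepsD_s4i hd' hgi' rfl] at hD
  obtain ⟨e1, e2, e3, e4⟩ := quad_eq_of_lt hD (by omega) (by omega) (by omega) (by omega) (by omega) (by omega)
  have hU := stepsU_s4e (m := 6 * k + 4) ha hs hga rfl
  rw [h, stepsU_s4i hd' hgi' rfl] at hU
  obtain ⟨e5, e6, e7, e8⟩ := quad_eq_of_lt hU (by omega) (by omega) (by omega) (by omega) (by omega) (by omega)
  omega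

/-- **An A11 block is never a B5 block.** [cite: EntingJensen2009, §7.4.2, Fig. 7.10] -/
theorem s4e_ne_s4j {k a i j d g a' : ℕ} (ha : 1 ≤ a) (hs : i + j + d + g + 4 ≤ k) (hga : a + g + 2 ≤ k) (ha' : 1
    ≤ a') (hak' : a' + 2 ≤ k) :
    s4e k a i j d g ≠ s4j k a' := by
  intro h
  have hD := stepsD_s4e (m := 6 * k + 4) ha hs hga rfl
  rw [h, stepsD_s4j ha' hak' rfl] at hD
  obtain ⟨e1, e2, e3, e4⟩ := quad_eq_of_lt hD (by omega) (by omega) (by omega) (by omega) (by omega) (by omega)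
  have hU := stepsU_s4e (m := 6 * k + 4) ha hs hga rfl
  rw [h, stepsU_s4j ha' hak' rfl] at hU
  obtain ⟨e5, e6, e7, e8⟩ := quad_eq_of_lt hU (by omega) (by omega) (by omega) (by omega) (by omega) (by omega)
  omega

/-- **Injectivity of the A12 parametrisation `s4f`.** [cite: EntingJensen2009, §7.4.2, Fig. 7.10] -/
theorem s4f_inj {k i j d g i' j' d' g' : ℕ} (hs : i + j + d + g + 5 ≤ k) (hs' : i' + j' + d' + g' + 5 ≤ k)
    (h : s4f k i j d g = s4f k i' j' d' g') : i = i' ∧ j = j' ∧ d = d' ∧ g = g' := by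
  have hD := stepsD_s4f (m := 6 * k + 4) hs rfl
  rw [h, stepsD_s4f hs' rfl] at hD
  obtain ⟨e1, e2, e3, e4⟩ := quad_eq_of_lt hD (by omega) (by omega) (by omega) (by omega) (by omega) (by omega)
  have hU := stepsU_s4f (m := 6 * k + 4) hs rfl
  rw [h, stepsU_s4f hs' rfl] at hU
  obtain ⟨e5, e6, e7, e8⟩ := quad_eq_of_lt hU (by omega) (by omega) (by omega) (by omega) (by omega) (by omega)
  refine ⟨?_, ?_, ?_, ?_⟩ <;> omega

/-- **An A12 block is never an A13 block.** [cite: EntingJensen2009, §7.4.2, Fig. 7.10] -/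
theorem s4f_ne_s4g {k i j d g a' i' d' e' g' : ℕ} (hs : i + j + d + g + 5 ≤ k) (ha' : 1 ≤ a') (hs' : a' + d' + e'
    + g' + 4 ≤ k) (hi' : i' + d' + e' + g' + 4 ≤ k) :
    s4f k i j d g ≠ s4g k a' i' d' e' g' := by
  intro h
  have hD := stepsD_s4f (m := 6 * k + 4) hs rfl
  rw [h, stepsD_s4g ha' hs' hi' rfl] at hD
  obtain ⟨e1, e2, e3, e4⟩ := quad_eq_of_lt hD (by omega) (by omega) (by omega) (by omega) (by omega) (by omega)
  have hU := stepsU_s4f (m := 6 * k + 4) hs rfl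
  rw [h, stepsU_s4g ha' hs' hi' rfl] at hU
  obtain ⟨e5, e6, e7, e8⟩ := quad_eq_of_lt hU (by omega) (by omega) (by omega) (by omega) (by omega) (by omega)
  omega

/-- **An A12 block is never an A14 block.** [cite: EntingJensen2009, §7.4.2, Fig. 7.10] -/
theorem s4f_ne_s4h {k i j d g a' i' j' d' g' : ℕ} (hs : i + j + d + g + 5 ≤ k) (hd' : i' + j' + d' + 3
    ≤ a') (hga' : a' + g' + 2 ≤ k) :
    s4f k i j d g ≠ s4h k a' i' j' d' g' := by
  intro h
  have hD := stepsD_s4f (m := 6 * k + 4) hs rfl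
  rw [h, stepsD_s4h hd' hga' rfl] at hD
  obtain ⟨e1, e2, e3, e4⟩ := quad_eq_of_lt hD (by omega) (by omega) (by omega) (by omega) (by omega) (by omega)
  have hU := stepsU_s4f (m := 6 * k + 4) hs rfl
  rw [h, stepsU_s4h hd' hga' rfl] at hU
  obtain ⟨e5, e6, e7, e8⟩ := quad_eq_of_lt hU (by omega) (by omega) (by omega) (by omega) (by omega) (by omega)
  omega

/-- **An A12 block is never an A15 block.** [cite: EntingJensen2009, §7.4.2, Fig. 7.10] -/
theorem s4f_ne_s4i {k i j d g i' j' d' g' : ℕ} (hs : i + j + d + g + 5 ≤ k) (hd' : i' + j' + d' + 4 ≤ k) (hgi' : g'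
    ≤ i') :
    s4f k i j d g ≠ s4i k i' j' d' g' := by
  intro h
  have hD := stepsD_s4f (m := 6 * k + 4) hs rfl
  rw [h, stepsD_s4i hd' hgi' rfl] at hD
  obtain ⟨e1, e2, e3, e4⟩ := quad_eq_of_lt hD (by omega) (by omega) (by omega) (by omega) (by omega) (by omega)
  have hU := stepsU_s4f (m := 6 * k + 4) hs rfl
  rw [h, stepsU_s4i hd' hgi' rfl] at hU
  obtain ⟨e5, e6, e7, e8⟩ := quad_eq_of_lt hU (by omega) (by omega) (by omega) (by omega) (by omega) (by omega)
  omega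

/-- **An A12 block is never a B5 block.** [cite: EntingJensen2009, §7.4.2, Fig. 7.10] -/
theorem s4f_ne_s4j {k i j d g a' : ℕ} (hs : i + j + d + g + 5 ≤ k) (ha' : 1 ≤ a') (hak' : a' + 2 ≤ k) :
    s4f k i j d g ≠ s4j k a' := by
  intro h
  have hD := stepsD_s4f (m := 6 * k + 4) hs rfl
  rw [h, stepsD_s4j ha' hak' rfl] at hD
  obtain ⟨e1, e2, e3, e4⟩ := quad_eq_of_lt hD (by omega) (by omega) (by omega) (by omega) (by omega) (by omega)
  have hU := stepsU_s4f (m := 6 * k + 4) hs rfl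
  rw [h, stepsU_s4j ha' hak' rfl] at hU
  obtain ⟨e5, e6, e7, e8⟩ := quad_eq_of_lt hU (by omega) (by omega) (by omega) (by omega) (by omega) (by omega)
  omega

/-- **Injectivity of the A13 parametrisation `s4g`.** [cite: EntingJensen2009, §7.4.2, Fig. 7.10] -/
theorem s4g_inj {k a i d e g a' i' d' e' g' : ℕ} (ha : 1 ≤ a) (hs : a + d + e + g + 4 ≤ k) (hi : i + d + e + g + 4
    ≤ k) (ha' : 1 ≤ a') (hs' : a' + d' + e' + g' + 4 ≤ k) (hi' : i' + d' + e' + g' + 4 ≤ k)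
    (h : s4g k a i d e g = s4g k a' i' d' e' g') : a = a' ∧ i = i' ∧ d = d' ∧ e = e' ∧ g = g' := by
  have hD := stepsD_s4g (m := 6 * k + 4) ha hs hi rfl
  rw [h, stepsD_s4g ha' hs' hi' rfl] at hD
  obtain ⟨e1, e2, e3, e4⟩ := quad_eq_of_lt hD (by omega) (by omega) (by omega) (by omega) (by omega) (by omega)
  have hU := stepsU_s4g (m := 6 * k + 4) ha hs hi rfl
  rw [h, stepsU_s4g ha' hs' hi' rfl] at hU
  obtain ⟨e5, e6, e7, e8⟩ := quad_eq_of_lt hU (by omega) (by omega) (by omega) (by omega) (by omega) (by omega)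
  refine ⟨?_, ?_, ?_, ?_, ?_⟩ <;> omega

/-- **An A13 block is never an A14 block.** [cite: EntingJensen2009, §7.4.2, Fig. 7.10] -/
theorem s4g_ne_s4h {k a i d e g a' i' j' d' g' : ℕ} (ha : 1 ≤ a) (hs : a + d + e + g + 4 ≤ k) (hi : i + d + e + g
    + 4 ≤ k) (hd' : i' + j' + d' + 3 ≤ a') (hga' : a' + g' + 2 ≤ k) :
    s4g k a i d e g ≠ s4h k a' i' j' d' g' := by
  intro h
  have hD := stepsD_s4g (m := 6 * k + 4) ha hs hi rfl
  rw [h, stepsD_s4h hd' hga' rfl] at hD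
  obtain ⟨e1, e2, e3, e4⟩ := quad_eq_of_lt hD (by omega) (by omega) (by omega) (by omega) (by omega) (by omega)
  have hU := stepsU_s4g (m := 6 * k + 4) ha hs hi rfl
  rw [h, stepsU_s4h hd' hga' rfl] at hU
  obtain ⟨e5, e6, e7, e8⟩ := quad_eq_of_lt hU (by omega) (by omega) (by omega) (by omega) (by omega) (by omega)
  omega

/-- **An A13 block is never an A15 block.** [cite: EntingJensen2009, §7.4.2, Fig. 7.10] -/
theorem s4g_ne_s4i {k a i d e g i' j' d' g' : ℕ} (ha : 1 ≤ a) (hs : a + d + e + g + 4 ≤ k) (hi : i + d + e + g + 4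
    ≤ k) (hd' : i' + j' + d' + 4 ≤ k) (hgi' : g' ≤ i') :
    s4g k a i d e g ≠ s4i k i' j' d' g' := by
  intro h
  have hD := stepsD_s4g (m := 6 * k + 4) ha hs hi rfl
  rw [h, stepsD_s4i hd' hgi' rfl] at hD
  obtain ⟨e1, e2, e3, e4⟩ := quad_eq_of_lt hD (by omega) (by omega) (by omega) (by omega) (by omega) (by omega)
  have hU := stepsU_s4g (m := 6 * k + 4) ha hs hi rfl
  rw [h, stepsU_s4i hd' hgi' rfl] at hU
  obtain ⟨e5, e6, e7, e8⟩ := quad_eq_of_lt hU (by omega) (by omega) (by omega) (by omega) (by omega) (by omega)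
  omega

/-- **An A13 block is never a B5 block.** [cite: EntingJensen2009, §7.4.2, Fig. 7.10] -/
theorem s4g_ne_s4j {k a i d e g a' : ℕ} (ha : 1 ≤ a) (hs : a + d + e + g + 4 ≤ k) (hi : i + d + e + g + 4
    ≤ k) (ha' : 1 ≤ a') (hak' : a' + 2 ≤ k) :
    s4g k a i d e g ≠ s4j k a' := by
  intro h
  have hD := stepsD_s4g (m := 6 * k + 4) ha hs hi rfl
  rw [h, stepsD_s4j ha' hak' rfl] at hD
  obtain ⟨e1, e2, e3, e4⟩ := quad_eq_of_lt hD (by omega) (by omega) (by omega) (by omega) (by omega) (by omega)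
  have hU := stepsU_s4g (m := 6 * k + 4) ha hs hi rfl
  rw [h, stepsU_s4j ha' hak' rfl] at hU
  obtain ⟨e5, e6, e7, e8⟩ := quad_eq_of_lt hU (by omega) (by omega) (by omega) (by omega) (by omega) (by omega)
  omega

/-- **Injectivity of the A14 parametrisation `s4h`.** [cite: EntingJensen2009, §7.4.2, Fig. 7.10] -/
theorem s4h_inj {k a i j d g a' i' j' d' g' : ℕ} (hd : i + j + d + 3 ≤ a) (hga : a + g + 2 ≤ k) (hd' : i' + j' + d'
    + 3 ≤ a') (hga' : a' + g' + 2 ≤ k)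
    (h : s4h k a i j d g = s4h k a' i' j' d' g') : a = a' ∧ i = i' ∧ j = j' ∧ d = d' ∧ g = g' := by
  have hD := stepsD_s4h (m := 6 * k + 4) hd hga rfl
  rw [h, stepsD_s4h hd' hga' rfl] at hD
  obtain ⟨e1, e2, e3, e4⟩ := quad_eq_of_lt hD (by omega) (by omega) (by omega) (by omega) (by omega) (by omega)
  have hU := stepsU_s4h (m := 6 * k + 4) hd hga rfl
  rw [h, stepsU_s4h hd' hga' rfl] at hU
  obtain ⟨e5, e6, e7, e8⟩ := quad_eq_of_lt hU (by omega) (by omega) (by omega) (by omega) (by omega) (by omega)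
  refine ⟨?_, ?_, ?_, ?_, ?_⟩ <;> omega

/-- **An A14 block is never an A15 block.** [cite: EntingJensen2009, §7.4.2, Fig. 7.10] -/
theorem s4h_ne_s4i {k a i j d g i' j' d' g' : ℕ} (hd : i + j + d + 3 ≤ a) (hga : a + g + 2 ≤ k) (hd' : i' + j' + d'
    + 4 ≤ k) (hgi' : g' ≤ i') :
    s4h k a i j d g ≠ s4i k i' j' d' g' := by
  intro h
  have hD := stepsD_s4h (m := 6 * k + 4) hd hga rfl
  rw [h, stepsD_s4i hd' hgi' rfl] at hD
  obtain ⟨e1, e2, e3, e4⟩ := quad_eq_of_lt hD (by omega) (by omega) (by omega) (by omega) (by omega) (by omega)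
  have hU := stepsU_s4h (m := 6 * k + 4) hd hga rfl
  rw [h, stepsU_s4i hd' hgi' rfl] at hU
  obtain ⟨e5, e6, e7, e8⟩ := quad_eq_of_lt hU (by omega) (by omega) (by omega) (by omega) (by omega) (by omega)
  omega

/-- **An A14 block is never a B5 block.** [cite: EntingJensen2009, §7.4.2, Fig. 7.10] -/
theorem s4h_ne_s4j {k a i j d g a' : ℕ} (hd : i + j + d + 3 ≤ a) (hga : a + g + 2 ≤ k) (ha' : 1 ≤ a') (hak' : a'
    + 2 ≤ k) :
    s4h k a i j d g ≠ s4j k a' := by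
  intro h
  have hD := stepsD_s4h (m := 6 * k + 4) hd hga rfl
  rw [h, stepsD_s4j ha' hak' rfl] at hD
  obtain ⟨e1, e2, e3, e4⟩ := quad_eq_of_lt hD (by omega) (by omega) (by omega) (by omega) (by omega) (by omega)
  have hU := stepsU_s4h (m := 6 * k + 4) hd hga rfl
  rw [h, stepsU_s4j ha' hak' rfl] at hU
  obtain ⟨e5, e6, e7, e8⟩ := quad_eq_of_lt hU (by omega) (by omega) (by omega) (by omega) (by omega) (by omega)
  omega

/-- **Injectivity of the A15 parametrisation `s4i`.** [cite: EntingJensen2009, §7.4.2, Fig. 7.10] -/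
theorem s4i_inj {k i j d g i' j' d' g' : ℕ} (hd : i + j + d + 4 ≤ k) (hgi : g ≤ i) (hd' : i' + j' + d' + 4
    ≤ k) (hgi' : g' ≤ i')
    (h : s4i k i j d g = s4i k i' j' d' g') : i = i' ∧ j = j' ∧ d = d' ∧ g = g' := by
  have hD := stepsD_s4i (m := 6 * k + 4) hd hgi rfl
  rw [h, stepsD_s4i hd' hgi' rfl] at hD
  obtain ⟨e1, e2, e3, e4⟩ := quad_eq_of_lt hD (by omega) (by omega) (by omega) (by omega) (by omega) (by omega)
  have hU := stepsU_s4i (m := 6 * k + 4) hd hgi rfl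
  rw [h, stepsU_s4i hd' hgi' rfl] at hU
  obtain ⟨e5, e6, e7, e8⟩ := quad_eq_of_lt hU (by omega) (by omega) (by omega) (by omega) (by omega) (by omega)
  refine ⟨?_, ?_, ?_, ?_⟩ <;> omega

/-- **An A15 block is never a B5 block.** [cite: EntingJensen2009, §7.4.2, Fig. 7.10] -/
theorem s4i_ne_s4j {k i j d g a' : ℕ} (hd : i + j + d + 4 ≤ k) (hgi : g ≤ i) (ha' : 1 ≤ a') (hak' : a' + 2 ≤ k) :
    s4i k i j d g ≠ s4j k a' := by
  intro h
  have hD := stepsD_s4i (m := 6 * k + 4) hd hgi rfl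
  rw [h, stepsD_s4j ha' hak' rfl] at hD
  obtain ⟨e1, e2, e3, e4⟩ := quad_eq_of_lt hD (by omega) (by omega) (by omega) (by omega) (by omega) (by omega)
  have hU := stepsU_s4i (m := 6 * k + 4) hd hgi rfl
  rw [h, stepsU_s4j ha' hak' rfl] at hU
  obtain ⟨e5, e6, e7, e8⟩ := quad_eq_of_lt hU (by omega) (by omega) (by omega) (by omega) (by omega) (by omega)
  omega

/-- **Injectivity of the B5 parametrisation `s4j`.** [cite: EntingJensen2009, §7.4.2, Fig. 7.10] -/
theorem s4j_inj {k a a' : ℕ} (ha : 1 ≤ a) (hak : a + 2 ≤ k) (ha' : 1 ≤ a') (hak' : a' + 2 ≤ k)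
    (h : s4j k a = s4j k a') : a = a' := by
  have hD := stepsD_s4j (m := 6 * k + 4) ha hak rfl
  rw [h, stepsD_s4j ha' hak' rfl] at hD
  obtain ⟨e1, e2, e3, e4⟩ := quad_eq_of_lt hD (by omega) (by omega) (by omega) (by omega) (by omega) (by omega)
  have hU := stepsU_s4j (m := 6 * k + 4) ha hak rfl
  rw [h, stepsU_s4j ha' hak' rfl] at hU
  obtain ⟨e5, e6, e7, e8⟩ := quad_eq_of_lt hU (by omega) (by omega) (by omega) (by omega) (by omega) (by omega)
  omega

/-! ### §2  Index simplices: the 4-simplex `pentIdx` and the 5-simplex `hexIdx` (with the triangle `triIdx` and the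
    tetrahedron
`tetIdx` of `…SlackFourThreeDownFamilies`), and their cardinalities -/

/-- The 4-simplex `{(x₁, x₂, x₃, x₄) : x₁ + x₂ + x₃ + x₄ < n}` (index set of the block families, counting plumbing).
[cite: EntingJensen2009, §7.4.2, Fig. 7.10] -/
def pentIdx (n : ℕ) : Finset (ℕ × ℕ × ℕ × ℕ) :=
  ((range n) ×ˢ ((range n) ×ˢ ((range n) ×ˢ (range n)))).filter fun p => p.1 + p.2.1 + p.2.2.1 + p.2.2.2 < n

/-- The 5-simplex `{(x₁, …, x₅) : x₁ + ⋯ + x₅ < n}` (index set of the block families, counting plumbing).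
[cite: EntingJensen2009, §7.4.2, Fig. 7.10] -/
def hexIdx (n : ℕ) : Finset (ℕ × ℕ × ℕ × ℕ × ℕ) :=
  ((range n) ×ˢ ((range n) ×ˢ ((range n) ×ˢ ((range n) ×ˢ (range n))))).filter fun p =>
    p.1 + p.2.1 + p.2.2.1 + p.2.2.2.1 + p.2.2.2.2 < n

/-- Membership in the triangle. [folklore] -/
private theorem triIdx_mem_iff {n : ℕ} {p : ℕ × ℕ} : p ∈ triIdx n ↔ p.1 + p.2 < n := by
  simp only [triIdx, mem_filter, mem_product, mem_range]
  omega

/-- Membership in the tetrahedron. [folklore] -/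
private theorem tetIdx_mem_iff {n : ℕ} {p : ℕ × ℕ × ℕ} : p ∈ tetIdx n ↔ p.1 + p.2.1 + p.2.2 < n := by
  simp only [tetIdx, mem_filter, mem_product, mem_range]
  omega

/-- Membership in the 4-simplex. [folklore] -/
private theorem mem_pentIdx {n : ℕ} {p : ℕ × ℕ × ℕ × ℕ} : p ∈ pentIdx n ↔ p.1 + p.2.1 + p.2.2.1 + p.2.2.2 < n := by
  simp only [pentIdx, mem_filter, mem_product, mem_range]
  omega

/-- Membership in the 5-simplex. [folklore] -/
private theorem mem_hexIdx {n : ℕ} {p : ℕ × ℕ × ℕ × ℕ × ℕ} :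
    p ∈ hexIdx n ↔ p.1 + p.2.1 + p.2.2.1 + p.2.2.2.1 + p.2.2.2.2 < n := by
  simp only [hexIdx, mem_filter, mem_product, mem_range]
  omega

/-- The triangle of size `n + 1` is the shifted triangle of size `n` plus its bottom row. [folklore] -/
private theorem triIdx_step (n : ℕ) :
    triIdx (n + 1) = (triIdx n).image (fun p => (p.1, p.2 + 1)) ∪ (range (n + 1)).image (fun v => (v, 0)) := by
  ext p
  rw [mem_union, mem_image, mem_image, triIdx_mem_iff]
  constructor
  · intro h
    by_cases hu : p.2 = 0
    · exact Or.inr ⟨p.1, mem_range.2 (by omega), Prod.ext rfl hu.symm⟩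
    · refine Or.inl ⟨(p.1, p.2 - 1), triIdx_mem_iff.2 (by simp only; omega), Prod.ext rfl ?_⟩
      simp only
      omega
  · rintro (⟨q, hq, rfl⟩ | ⟨a, ha, rfl⟩)
    · have := triIdx_mem_iff.1 hq
      simp only
      omega
    · have := mem_range.1 ha
      simp only
      omega

/-- `#triIdx (n + 1) = #triIdx n + (n + 1)`. [folklore] -/
private theorem card_triIdx_step (n : ℕ) : #(triIdx (n + 1)) = #(triIdx n) + (n + 1) := by
  have hd : Disjoint ((triIdx n).image (fun p => (p.1, p.2 + 1))) ((range (n + 1)).image (fun v => (v, 0))) := by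
    refine disjoint_left.2 fun p h1 h2 => ?_
    rw [mem_image] at h1 h2
    obtain ⟨q, -, rfl⟩ := h1
    obtain ⟨a, -, h⟩ := h2
    have := congrArg Prod.snd h
    simp only at this
    omega
  have h1 : Function.Injective (fun p : ℕ × ℕ => (p.1, p.2 + 1)) := by
    intro p q h
    simp only [Prod.mk.injEq] at h
    exact Prod.ext h.1 (by omega)
  have h2 : Function.Injective (fun v : ℕ => (v, 0)) := by
    intro a b h
    simpa only [Prod.mk.injEq, and_true] using h
  rw [triIdx_step, card_union_of_disjoint hd, card_image_of_injective _ h1, card_image_of_injective _ h2, card_range]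

/-- `2 · #triIdx n = n (n + 1)`. [folklore] -/
private theorem two_mul_card_triIdx_id (n : ℕ) : 2 * #(triIdx n) = n * (n + 1) := by
  induction n with
  | zero => rfl
  | succ n ih => rw [card_triIdx_step]; nlinarith [ih]

/-- The 2-simplex `tetIdx (n + 1)` is the shifted `tetIdx n` plus a bottom `triIdx (n + 1)`. [folklore] -/
private theorem tetIdx_step (n : ℕ) :
    tetIdx (n + 1) = (tetIdx n).image (fun p => (p.1, p.2.1, p.2.2 + 1)) ∪
      (triIdx (n + 1)).image (fun q => (q.1, q.2, 0)) := by
  ext p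
  rw [mem_union, mem_image, mem_image, tetIdx_mem_iff]
  constructor
  · intro h
    by_cases hu : p.2.2 = 0
    · exact Or.inr ⟨(p.1, p.2.1), triIdx_mem_iff.2 (by simp only; omega), Prod.ext rfl (Prod.ext rfl hu.symm)⟩
    · refine Or.inl ⟨(p.1, p.2.1, p.2.2 - 1), tetIdx_mem_iff.2 (by simp only; omega), Prod.ext rfl (Prod.ext rfl ?_)⟩
      simp only
      omega
  · rintro (⟨q, hq, rfl⟩ | ⟨q, hq, rfl⟩)
    · have := tetIdx_mem_iff.1 hq
      simp only
      omega
    · have := triIdx_mem_iff.1 hq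
      simp only
      omega

/-- `#tetIdx (n + 1) = #tetIdx n + #triIdx (n + 1)`. [folklore] -/
private theorem card_tetIdx_step (n : ℕ) : #(tetIdx (n + 1)) = #(tetIdx n) + #(triIdx (n + 1)) := by
  have hd : Disjoint ((tetIdx n).image (fun p => (p.1, p.2.1, p.2.2 + 1)))
      ((triIdx (n + 1)).image (fun q => (q.1, q.2, 0))) := by
    refine disjoint_left.2 fun p h1 h2 => ?_
    rw [mem_image] at h1 h2
    obtain ⟨q, -, rfl⟩ := h1
    obtain ⟨a, -, h⟩ := h2
    have := congrArg (fun x : ℕ × ℕ × ℕ => x.2.2) h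
    simp only at this
    omega
  have h1 : Function.Injective (fun p : ℕ × ℕ × ℕ => (p.1, p.2.1, p.2.2 + 1)) := by
    intro p q h
    simp only [Prod.mk.injEq] at h
    exact Prod.ext h.1 (Prod.ext h.2.1 (by omega))
  have h2 : Function.Injective (fun q : ℕ × ℕ => (q.1, q.2, 0)) := by
    intro a b h
    simp only [Prod.mk.injEq, and_true] at h
    exact Prod.ext h.1 h.2
  rw [tetIdx_step, card_union_of_disjoint hd, card_image_of_injective _ h1, card_image_of_injective _ h2]

/-- `6 · #tetIdx n = n (n + 1) (n + 2)`. [folklore] -/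
private theorem six_mul_card_tetIdx_id (n : ℕ) : 6 * #(tetIdx n) = n * (n + 1) * (n + 2) := by
  induction n with
  | zero => rfl
  | succ n ih =>
    rw [card_tetIdx_step]
    have h := two_mul_card_triIdx_id (n + 1)
    ring_nf at ih h ⊢
    omega

/-- The 3-simplex `pentIdx (n + 1)` is the shifted `pentIdx n` plus a bottom `tetIdx (n + 1)`. [folklore] -/
private theorem pentIdx_step (n : ℕ) :
    pentIdx (n + 1) = (pentIdx n).image (fun p => (p.1, p.2.1, p.2.2.1, p.2.2.2 + 1)) ∪
      (tetIdx (n + 1)).image (fun q => (q.1, q.2.1, q.2.2, 0)) := by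
  ext p
  rw [mem_union, mem_image, mem_image, mem_pentIdx]
  constructor
  · intro h
    by_cases hu : p.2.2.2 = 0
    · exact Or.inr ⟨(p.1, p.2.1, p.2.2.1), tetIdx_mem_iff.2 (by simp only; omega),
        Prod.ext rfl (Prod.ext rfl (Prod.ext rfl hu.symm))⟩
    · refine Or.inl ⟨(p.1, p.2.1, p.2.2.1, p.2.2.2 - 1), mem_pentIdx.2 (by simp only; omega),
        Prod.ext rfl (Prod.ext rfl (Prod.ext rfl ?_))⟩
      simp only
      omega
  · rintro (⟨q, hq, rfl⟩ | ⟨q, hq, rfl⟩)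
    · have := mem_pentIdx.1 hq
      simp only
      omega
    · have := tetIdx_mem_iff.1 hq
      simp only
      omega

/-- `#pentIdx (n + 1) = #pentIdx n + #tetIdx (n + 1)`. [folklore] -/
private theorem card_pentIdx_step (n : ℕ) : #(pentIdx (n + 1)) = #(pentIdx n) + #(tetIdx (n + 1)) := by
  have hd : Disjoint ((pentIdx n).image (fun p => (p.1, p.2.1, p.2.2.1, p.2.2.2 + 1)))
      ((tetIdx (n + 1)).image (fun q => (q.1, q.2.1, q.2.2, 0))) := by
    refine disjoint_left.2 fun p h1 h2 => ?_
    rw [mem_image] at h1 h2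
    obtain ⟨q, -, rfl⟩ := h1
    obtain ⟨a, -, h⟩ := h2
    have := congrArg (fun x : ℕ × ℕ × ℕ × ℕ => x.2.2.2) h
    simp only at this
    omega
  have h1 : Function.Injective (fun p : ℕ × ℕ × ℕ × ℕ => (p.1, p.2.1, p.2.2.1, p.2.2.2 + 1)) := by
    intro p q h
    simp only [Prod.mk.injEq] at h
    exact Prod.ext h.1 (Prod.ext h.2.1 (Prod.ext h.2.2.1 (by omega)))
  have h2 : Function.Injective (fun q : ℕ × ℕ × ℕ => (q.1, q.2.1, q.2.2, 0)) := by
    intro a b h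
    simp only [Prod.mk.injEq, and_true] at h
    exact Prod.ext h.1 (Prod.ext h.2.1 h.2.2)
  rw [pentIdx_step, card_union_of_disjoint hd, card_image_of_injective _ h1, card_image_of_injective _ h2]

/-- `24 · #pentIdx n = n (n + 1) (n + 2) (n + 3)`: the 4-simplex has `C(n + 3, 4)` points. [folklore] -/
private theorem twentyfour_mul_card_pentIdx (n : ℕ) : 24 * #(pentIdx n) = n * (n + 1) * (n + 2) * (n + 3) := by
  induction n with
  | zero => rfl
  | succ n ih =>
    rw [card_pentIdx_step]
    have h := six_mul_card_tetIdx_id (n + 1)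
    ring_nf at ih h ⊢
    omega

/-- The 4-simplex `hexIdx (n + 1)` is the shifted `hexIdx n` plus a bottom `pentIdx (n + 1)`. [folklore] -/
private theorem hexIdx_step (n : ℕ) :
    hexIdx (n + 1) = (hexIdx n).image (fun p => (p.1, p.2.1, p.2.2.1, p.2.2.2.1, p.2.2.2.2 + 1)) ∪
      (pentIdx (n + 1)).image (fun q => (q.1, q.2.1, q.2.2.1, q.2.2.2, 0)) := by
  ext p
  rw [mem_union, mem_image, mem_image, mem_hexIdx]
  constructor
  · intro h
    by_cases hu : p.2.2.2.2 = 0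
    · exact Or.inr ⟨(p.1, p.2.1, p.2.2.1, p.2.2.2.1), mem_pentIdx.2 (by simp only; omega),
        Prod.ext rfl (Prod.ext rfl (Prod.ext rfl (Prod.ext rfl hu.symm)))⟩
    · refine Or.inl ⟨(p.1, p.2.1, p.2.2.1, p.2.2.2.1, p.2.2.2.2 - 1), mem_hexIdx.2 (by simp only; omega),
        Prod.ext rfl (Prod.ext rfl (Prod.ext rfl (Prod.ext rfl ?_)))⟩
      simp only
      omega
  · rintro (⟨q, hq, rfl⟩ | ⟨q, hq, rfl⟩)
    · have := mem_hexIdx.1 hq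
      simp only
      omega
    · have := mem_pentIdx.1 hq
      simp only
      omega

/-- `#hexIdx (n + 1) = #hexIdx n + #pentIdx (n + 1)`. [folklore] -/
private theorem card_hexIdx_step (n : ℕ) : #(hexIdx (n + 1)) = #(hexIdx n) + #(pentIdx (n + 1)) := by
  have hd : Disjoint ((hexIdx n).image (fun p => (p.1, p.2.1, p.2.2.1, p.2.2.2.1, p.2.2.2.2 + 1)))
      ((pentIdx (n + 1)).image (fun q => (q.1, q.2.1, q.2.2.1, q.2.2.2, 0))) := by
    refine disjoint_left.2 fun p h1 h2 => ?_
    rw [mem_image] at h1 h2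
    obtain ⟨q, -, rfl⟩ := h1
    obtain ⟨a, -, h⟩ := h2
    have := congrArg (fun x : ℕ × ℕ × ℕ × ℕ × ℕ => x.2.2.2.2) h
    simp only at this
    omega
  have h1 : Function.Injective (fun p : ℕ × ℕ × ℕ × ℕ × ℕ => (p.1, p.2.1, p.2.2.1, p.2.2.2.1, p.2.2.2.2 + 1)) := by
    intro p q h
    simp only [Prod.mk.injEq] at h
    exact Prod.ext h.1 (Prod.ext h.2.1 (Prod.ext h.2.2.1 (Prod.ext h.2.2.2.1 (by omega))))
  have h2 : Function.Injective (fun q : ℕ × ℕ × ℕ × ℕ => (q.1, q.2.1, q.2.2.1, q.2.2.2, 0)) := by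
    intro a b h
    simp only [Prod.mk.injEq, and_true] at h
    exact Prod.ext h.1 (Prod.ext h.2.1 (Prod.ext h.2.2.1 h.2.2.2))
  rw [hexIdx_step, card_union_of_disjoint hd, card_image_of_injective _ h1, card_image_of_injective _ h2]

/-- `120 · #hexIdx n = n (n + 1) (n + 2) (n + 3) (n + 4)`: the 5-simplex has `C(n + 4, 5)` points. [folklore] -/
private theorem onetwenty_mul_card_hexIdx (n : ℕ) : 120 * #(hexIdx n) = n * (n + 1) * (n + 2) * (n + 3) * (n + 4) := by
  induction n with
  | zero => rfl
  | succ n ih =>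
    rw [card_hexIdx_step]
    have h := twentyfour_mul_card_pentIdx (n + 1)
    ring_nf at ih h ⊢
    omega

/-! ### §3  The twenty-six images (the blocks of each family, cut into simplex pieces) and the ten family Finsets -/

open Classical in
/-- The A7 blocks with `d − (a − i − j − 1) ≤ i`, indexed by the 5-simplex `hexIdx (k - 3)`.
[cite: EntingJensen2009, §7.4.2, Fig. 7.10] -/
noncomputable def a7aImg (k : ℕ) : Finset (ℕ → Site 2) :=
  (hexIdx (k - 3)).image fun p => s4a k (p.2.1 + p.2.2.1 + p.2.2.2.1 + p.1 + 2) (p.2.1 + p.2.2.1) (p.2.2.2.1) (p.1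
      + p.2.1 + 1) (p.2.2.2.2)

open Classical in
/-- The A7 blocks with `i < d − (a − i − j − 1) ≤ i + j + 1`, indexed by the 5-simplex `hexIdx (k - 3)`.
[cite: EntingJensen2009, §7.4.2, Fig. 7.10] -/
noncomputable def a7bImg (k : ℕ) : Finset (ℕ → Site 2) :=
  (hexIdx (k - 3)).image fun p => s4a k (p.2.1 + p.2.2.1 + p.2.2.2.1 + p.1 + 2) (p.2.1) (p.2.2.1 + p.2.2.2.1) (p.1
      + p.2.1 + p.2.2.1 + 2) (p.2.2.2.2)

open Classical in
/-- The A7 blocks with `i + j + 1 < d − (a − i − j − 1) ≤ i + j + g + 2`, indexed by the 5-simplex `hexIdx (k - 3)`.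
[cite: EntingJensen2009, §7.4.2, Fig. 7.10] -/
noncomputable def a7cImg (k : ℕ) : Finset (ℕ → Site 2) :=
  (hexIdx (k - 3)).image fun p => s4a k (p.2.1 + p.2.2.1 + p.1 + 2) (p.2.1) (p.2.2.1) (p.1 + p.2.1 + p.2.2.1
      + p.2.2.2.1 + 3) (p.2.2.2.1 + p.2.2.2.2)

open Classical in
/-- The A7 blocks with `d − (a − i − j − 1) > i + j + g + 2`, indexed by the 5-simplex `hexIdx (k - 4)`.
[cite: EntingJensen2009, §7.4.2, Fig. 7.10] -/
noncomputable def a7dImg (k : ℕ) : Finset (ℕ → Site 2) :=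
  (hexIdx (k - 4)).image fun p => s4a k (p.2.1 + p.2.2.1 + p.1 + 2) (p.2.1) (p.2.2.1) (p.1 + p.2.1 + p.2.2.1
      + p.2.2.2.1 + p.2.2.2.2 + 4) (p.2.2.2.1)

open Classical in
/-- The A8 blocks with `e ≤ j`, indexed by the 4-simplex `pentIdx (k - 2)`.
[cite: EntingJensen2009, §7.4.2, Fig. 7.10] -/
noncomputable def a8aImg (k : ℕ) : Finset (ℕ → Site 2) :=
  (pentIdx (k - 2)).image fun p => s4b k (p.1 + p.2.1) (p.2.2.1 + p.2.2.2) (p.2.2.1) (p.1)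

open Classical in
/-- The A8 blocks with `e > j`, indexed by the 4-simplex `pentIdx (k - 3)`.
[cite: EntingJensen2009, §7.4.2, Fig. 7.10] -/
noncomputable def a8bImg (k : ℕ) : Finset (ℕ → Site 2) :=
  (pentIdx (k - 3)).image fun p => s4b k (p.1 + p.2.1 + p.2.2.1 + 1) (p.2.2.2) (p.2.2.2 + p.1 + 1) (p.2.1)

open Classical in
/-- The A9 blocks with `a ≤ i`, `g ≤ j`, indexed by the 5-simplex `hexIdx (k - 3)`.
[cite: EntingJensen2009, §7.4.2, Fig. 7.10] -/
noncomputable def a9aImg (k : ℕ) : Finset (ℕ → Site 2) :=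
  (hexIdx (k - 3)).image fun p => s4c k (p.1 + 1) (p.1 + p.2.1 + 1) (p.2.2.1 + p.2.2.2.1) (p.2.2.2.2) (p.2.2.1)

open Classical in
/-- The A9 blocks with `a ≤ i`, `j < g ≤ j + e + 1`, indexed by the 5-simplex `hexIdx (k - 3)`.
[cite: EntingJensen2009, §7.4.2, Fig. 7.10] -/
noncomputable def a9bImg (k : ℕ) : Finset (ℕ → Site 2) :=
  (hexIdx (k - 3)).image fun p => s4c k (p.1 + 1) (p.1 + p.2.1 + 1) (p.2.2.1) (p.2.2.2.1 + p.2.2.2.2) (p.2.2.1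
      + p.2.2.2.1 + 1)

open Classical in
/-- The A9 blocks with `a ≤ i`, `g > j + e + 1`, indexed by the 5-simplex `hexIdx (k - 4)`.
[cite: EntingJensen2009, §7.4.2, Fig. 7.10] -/
noncomputable def a9cImg (k : ℕ) : Finset (ℕ → Site 2) :=
  (hexIdx (k - 4)).image fun p => s4c k (p.1 + 1) (p.1 + p.2.1 + 1) (p.2.2.1) (p.2.2.2.1) (p.2.2.1 + p.2.2.2.1
      + p.2.2.2.2 + 2)

open Classical in
/-- The A9 blocks with `i < a ≤ i + j`, `g ≤ j − (a − i)`, indexed by the 5-simplex `hexIdx (k - 3)`.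
[cite: EntingJensen2009, §7.4.2, Fig. 7.10] -/
noncomputable def a9dImg (k : ℕ) : Finset (ℕ → Site 2) :=
  (hexIdx (k - 3)).image fun p => s4c k (p.1 + p.2.1 + 1) (p.1) (p.2.1 + p.2.2.1 + p.2.2.2.1 + 1) (p.2.2.2.2) (p.2.2.1)

open Classical in
/-- The A9 blocks with `i < a ≤ i + j`, `j − (a − i) < g ≤ j + e − (a − i) + 1`, indexed by the 5-simplex
`hexIdx (k - 3)`. [cite: EntingJensen2009, §7.4.2, Fig. 7.10] -/
noncomputable def a9eImg (k : ℕ) : Finset (ℕ → Site 2) :=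
  (hexIdx (k - 3)).image fun p => s4c k (p.1 + p.2.1 + 1) (p.1) (p.2.1 + p.2.2.1 + 1) (p.2.2.2.1
      + p.2.2.2.2) (p.2.2.1 + p.2.2.2.1 + 1)

open Classical in
/-- The A9 blocks with `i < a ≤ i + j`, `g > j + e − (a − i) + 1`, indexed by the 5-simplex `hexIdx (k - 4)`.
[cite: EntingJensen2009, §7.4.2, Fig. 7.10] -/
noncomputable def a9fImg (k : ℕ) : Finset (ℕ → Site 2) :=
  (hexIdx (k - 4)).image fun p => s4c k (p.1 + p.2.1 + 1) (p.1) (p.2.1 + p.2.2.1 + 1) (p.2.2.2.1) (p.2.2.1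
      + p.2.2.2.1 + p.2.2.2.2 + 2)

open Classical in
/-- The A9 blocks with `i + j < a ≤ i + j + e`, `g ≤ e − (a − i − j)`, indexed by the 5-simplex `hexIdx (k - 3)`.
[cite: EntingJensen2009, §7.4.2, Fig. 7.10] -/
noncomputable def a9gImg (k : ℕ) : Finset (ℕ → Site 2) :=
  (hexIdx (k - 3)).image fun p => s4c k (p.1 + p.2.1 + p.2.2.1 + 1) (p.1) (p.2.1) (p.2.2.1 + p.2.2.2.1 + p.2.2.2.2
      + 1) (p.2.2.2.1)

open Classical in
/-- The A9 blocks with `i + j < a ≤ i + j + e`, `g > e − (a − i − j)`, indexed by the 5-simplex `hexIdx (k - 3)`.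
[cite: EntingJensen2009, §7.4.2, Fig. 7.10] -/
noncomputable def a9hImg (k : ℕ) : Finset (ℕ → Site 2) :=
  (hexIdx (k - 3)).image fun p => s4c k (p.1 + p.2.1 + p.2.2.1 + 1) (p.1) (p.2.1) (p.2.2.1 + p.2.2.2.1
      + 1) (p.2.2.2.1 + p.2.2.2.2 + 1)

open Classical in
/-- The A9 blocks with `a > i + j + e`, indexed by the 5-simplex `hexIdx (k - 2)`.
[cite: EntingJensen2009, §7.4.2, Fig. 7.10] -/
noncomputable def a9iImg (k : ℕ) : Finset (ℕ → Site 2) :=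
  (hexIdx (k - 2)).image fun p => s4c k (p.1 + p.2.1 + p.2.2.1 + p.2.2.2.1 + 1) (p.1) (p.2.1) (p.2.2.1) (p.2.2.2.2)

open Classical in
/-- The A10 blocks, indexed by the 4-simplex `pentIdx (k - 3)`. [cite: EntingJensen2009, §7.4.2, Fig. 7.10] -/
noncomputable def a10Img (k : ℕ) : Finset (ℕ → Site 2) :=
  (pentIdx (k - 3)).image fun p => s4d k (p.1) (p.2.1) (p.2.2.1) (p.2.2.2)

open Classical in
/-- The A11 blocks with `a ≤ i + 1`, indexed by the 5-simplex `hexIdx (k - 3)`.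
[cite: EntingJensen2009, §7.4.2, Fig. 7.10] -/
noncomputable def a11aImg (k : ℕ) : Finset (ℕ → Site 2) :=
  (hexIdx (k - 3)).image fun p => s4e k (p.2.1 + 1) (p.2.1 + p.2.2.1) (p.2.2.2.1) (p.2.2.2.2) (p.1)

open Classical in
/-- The A11 blocks with `i + 1 < a ≤ i + j + 2`, indexed by the 5-simplex `hexIdx (k - 3)`.
[cite: EntingJensen2009, §7.4.2, Fig. 7.10] -/
noncomputable def a11bImg (k : ℕ) : Finset (ℕ → Site 2) :=
  (hexIdx (k - 3)).image fun p => s4e k (p.2.1 + p.2.2.1 + 2) (p.2.1) (p.2.2.1 + p.2.2.2.1) (p.2.2.2.2) (p.1)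

open Classical in
/-- The A11 blocks with `a ≥ i + j + d + 3`, indexed by the 5-simplex `hexIdx (k - 4)`.
[cite: EntingJensen2009, §7.4.2, Fig. 7.10] -/
noncomputable def a11cImg (k : ℕ) : Finset (ℕ → Site 2) :=
  (hexIdx (k - 4)).image fun p => s4e k (p.2.1 + p.2.2.1 + p.2.2.2.1 + p.2.2.2.2
      + 3) (p.2.1) (p.2.2.1) (p.2.2.2.1) (p.1)

open Classical in
/-- The A11 blocks with `i + j + 2 < a < i + j + d + 3`, indexed by the 5-simplex `hexIdx (k - 4)`.
[cite: EntingJensen2009, §7.4.2, Fig. 7.10] -/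
noncomputable def a11dImg (k : ℕ) : Finset (ℕ → Site 2) :=
  (hexIdx (k - 4)).image fun p => s4e k (p.2.1 + p.2.2.1 + p.2.2.2.1 + 3) (p.2.1) (p.2.2.1) (p.2.2.2.1 + p.2.2.2.2
      + 1) (p.1)

open Classical in
/-- The A12 blocks, indexed by the 4-simplex `pentIdx (k - 4)`. [cite: EntingJensen2009, §7.4.2, Fig. 7.10] -/
noncomputable def a12Img (k : ℕ) : Finset (ℕ → Site 2) :=
  (pentIdx (k - 4)).image fun p => s4f k (p.1) (p.2.1) (p.2.2.1) (p.2.2.2)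

open Classical in
/-- The A13 blocks with `a ≤ i`, indexed by the 5-simplex `hexIdx (k - 4)`.
[cite: EntingJensen2009, §7.4.2, Fig. 7.10] -/
noncomputable def a13aImg (k : ℕ) : Finset (ℕ → Site 2) :=
  (hexIdx (k - 4)).image fun p => s4g k (p.1 + 1) (p.1 + p.2.1 + 1) (p.2.2.1) (p.2.2.2.1) (p.2.2.2.2)

open Classical in
/-- The A13 blocks with `a > i`, indexed by the 5-simplex `hexIdx (k - 4)`.
[cite: EntingJensen2009, §7.4.2, Fig. 7.10] -/
noncomputable def a13bImg (k : ℕ) : Finset (ℕ → Site 2) :=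
  (hexIdx (k - 4)).image fun p => s4g k (p.1 + p.2.1 + 1) (p.1) (p.2.2.1) (p.2.2.2.1) (p.2.2.2.2)

open Classical in
/-- The A14 blocks, indexed by the 5-simplex `hexIdx (k - 4)`. [cite: EntingJensen2009, §7.4.2, Fig. 7.10] -/
noncomputable def a14Img (k : ℕ) : Finset (ℕ → Site 2) :=
  (hexIdx (k - 4)).image fun p => s4h k (p.1 + p.2.1 + p.2.2.1 + p.2.2.2.1 + 3) (p.2.1) (p.2.2.1) (p.1) (p.2.2.2.2)

open Classical in
/-- The A15 blocks, indexed by the 4-simplex `pentIdx (k - 3)`. [cite: EntingJensen2009, §7.4.2, Fig. 7.10] -/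
noncomputable def a15Img (k : ℕ) : Finset (ℕ → Site 2) :=
  (pentIdx (k - 3)).image fun p => s4i k (p.2.1 + p.2.2.1) (p.2.2.2) (p.1) (p.2.1)

open Classical in
/-- The B5 blocks, indexed by the interval `range (k - 2)`. [cite: EntingJensen2009, §7.4.2, Fig. 7.10] -/
noncomputable def b5Img (k : ℕ) : Finset (ℕ → Site 2) :=
  (range (k - 2)).image fun p => s4j k (p + 1)

open Classical in
/-- The A7 blocks: the union of the 4 pieces. [cite: EntingJensen2009, §7.4.2, Fig. 7.10] -/
noncomputable def a7Img (k : ℕ) : Finset (ℕ → Site 2) :=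
  a7aImg k ∪ a7bImg k ∪ a7cImg k ∪ a7dImg k

open Classical in
/-- The A8 blocks: the union of the 2 pieces. [cite: EntingJensen2009, §7.4.2, Fig. 7.10] -/
noncomputable def a8Img (k : ℕ) : Finset (ℕ → Site 2) :=
  a8aImg k ∪ a8bImg k

open Classical in
/-- The A9 blocks: the union of the 9 pieces. [cite: EntingJensen2009, §7.4.2, Fig. 7.10] -/
noncomputable def a9Img (k : ℕ) : Finset (ℕ → Site 2) :=
  a9aImg k ∪ a9bImg k ∪ a9cImg k ∪ a9dImg k ∪ a9eImg k ∪ a9fImg k ∪ a9gImg k ∪ a9hImg k ∪ a9iImg k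

open Classical in
/-- The A11 blocks: the union of the 4 pieces. [cite: EntingJensen2009, §7.4.2, Fig. 7.10] -/
noncomputable def a11Img (k : ℕ) : Finset (ℕ → Site 2) :=
  a11aImg k ∪ a11bImg k ∪ a11cImg k ∪ a11dImg k

open Classical in
/-- The A13 blocks: the union of the 2 pieces. [cite: EntingJensen2009, §7.4.2, Fig. 7.10] -/
noncomputable def a13Img (k : ℕ) : Finset (ℕ → Site 2) :=
  a13aImg k ∪ a13bImg k

open Classical in
/-- What a member of `a7aImg k` is. [cite: EntingJensen2009, §7.4.2, Fig. 7.10] -/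
theorem exists_of_mem_a7aImg {k : ℕ} {w : ℕ → Site 2} (h : w ∈ a7aImg k) :
    ∃ a i j d g : ℕ, (i + j + 2 ≤ a ∧ a ≤ i + j + d + 1 ∧ d + 1 ≤ k ∧ a + g + 2 ≤ k) ∧ s4a k a i j d g = w := by
  rw [a7aImg, mem_image] at h
  obtain ⟨p, hp, rfl⟩ := h
  have hq := mem_hexIdx.1 hp
  exact ⟨_, _, _, _, _, ⟨by omega, by omega, by omega, by omega⟩, rfl⟩

open Classical in
/-- What a member of `a7bImg k` is. [cite: EntingJensen2009, §7.4.2, Fig. 7.10] -/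
theorem exists_of_mem_a7bImg {k : ℕ} {w : ℕ → Site 2} (h : w ∈ a7bImg k) :
    ∃ a i j d g : ℕ, (i + j + 2 ≤ a ∧ a ≤ i + j + d + 1 ∧ d + 1 ≤ k ∧ a + g + 2 ≤ k) ∧ s4a k a i j d g = w := by
  rw [a7bImg, mem_image] at h
  obtain ⟨p, hp, rfl⟩ := h
  have hq := mem_hexIdx.1 hp
  exact ⟨_, _, _, _, _, ⟨by omega, by omega, by omega, by omega⟩, rfl⟩

open Classical in
/-- What a member of `a7cImg k` is. [cite: EntingJensen2009, §7.4.2, Fig. 7.10] -/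
theorem exists_of_mem_a7cImg {k : ℕ} {w : ℕ → Site 2} (h : w ∈ a7cImg k) :
    ∃ a i j d g : ℕ, (i + j + 2 ≤ a ∧ a ≤ i + j + d + 1 ∧ d + 1 ≤ k ∧ a + g + 2 ≤ k) ∧ s4a k a i j d g = w := by
  rw [a7cImg, mem_image] at h
  obtain ⟨p, hp, rfl⟩ := h
  have hq := mem_hexIdx.1 hp
  exact ⟨_, _, _, _, _, ⟨by omega, by omega, by omega, by omega⟩, rfl⟩

open Classical in
/-- What a member of `a7dImg k` is. [cite: EntingJensen2009, §7.4.2, Fig. 7.10] -/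
theorem exists_of_mem_a7dImg {k : ℕ} {w : ℕ → Site 2} (h : w ∈ a7dImg k) :
    ∃ a i j d g : ℕ, (i + j + 2 ≤ a ∧ a ≤ i + j + d + 1 ∧ d + 1 ≤ k ∧ a + g + 2 ≤ k) ∧ s4a k a i j d g = w := by
  rw [a7dImg, mem_image] at h
  obtain ⟨p, hp, rfl⟩ := h
  have hq := mem_hexIdx.1 hp
  exact ⟨_, _, _, _, _, ⟨by omega, by omega, by omega, by omega⟩, rfl⟩

open Classical in
/-- What a member of `a8aImg k` is. [cite: EntingJensen2009, §7.4.2, Fig. 7.10] -/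
theorem exists_of_mem_a8aImg {k : ℕ} {w : ℕ → Site 2} (h : w ∈ a8aImg k) :
    ∃ i j e g : ℕ, (i + j + 3 ≤ k ∧ g ≤ i ∧ e + g ≤ i + j) ∧ s4b k i j e g = w := by
  rw [a8aImg, mem_image] at h
  obtain ⟨p, hp, rfl⟩ := h
  have hq := mem_pentIdx.1 hp
  exact ⟨_, _, _, _, ⟨by omega, by omega, by omega⟩, rfl⟩

open Classical in
/-- What a member of `a8bImg k` is. [cite: EntingJensen2009, §7.4.2, Fig. 7.10] -/
theorem exists_of_mem_a8bImg {k : ℕ} {w : ℕ → Site 2} (h : w ∈ a8bImg k) :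
    ∃ i j e g : ℕ, (i + j + 3 ≤ k ∧ g ≤ i ∧ e + g ≤ i + j) ∧ s4b k i j e g = w := by
  rw [a8bImg, mem_image] at h
  obtain ⟨p, hp, rfl⟩ := h
  have hq := mem_pentIdx.1 hp
  exact ⟨_, _, _, _, ⟨by omega, by omega, by omega⟩, rfl⟩

open Classical in
/-- What a member of `a9aImg k` is. [cite: EntingJensen2009, §7.4.2, Fig. 7.10] -/
theorem exists_of_mem_a9aImg {k : ℕ} {w : ℕ → Site 2} (h : w ∈ a9aImg k) :
    ∃ a i j e g : ℕ, (1 ≤ a ∧ i + j + e + 3 ≤ k ∧ i + g + 2 ≤ k ∧ a + g + 2 ≤ k) ∧ s4c k a i j e g = w := by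
  rw [a9aImg, mem_image] at h
  obtain ⟨p, hp, rfl⟩ := h
  have hq := mem_hexIdx.1 hp
  exact ⟨_, _, _, _, _, ⟨by omega, by omega, by omega, by omega⟩, rfl⟩

open Classical in
/-- What a member of `a9bImg k` is. [cite: EntingJensen2009, §7.4.2, Fig. 7.10] -/
theorem exists_of_mem_a9bImg {k : ℕ} {w : ℕ → Site 2} (h : w ∈ a9bImg k) :
    ∃ a i j e g : ℕ, (1 ≤ a ∧ i + j + e + 3 ≤ k ∧ i + g + 2 ≤ k ∧ a + g + 2 ≤ k) ∧ s4c k a i j e g = w := by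
  rw [a9bImg, mem_image] at h
  obtain ⟨p, hp, rfl⟩ := h
  have hq := mem_hexIdx.1 hp
  exact ⟨_, _, _, _, _, ⟨by omega, by omega, by omega, by omega⟩, rfl⟩

open Classical in
/-- What a member of `a9cImg k` is. [cite: EntingJensen2009, §7.4.2, Fig. 7.10] -/
theorem exists_of_mem_a9cImg {k : ℕ} {w : ℕ → Site 2} (h : w ∈ a9cImg k) :
    ∃ a i j e g : ℕ, (1 ≤ a ∧ i + j + e + 3 ≤ k ∧ i + g + 2 ≤ k ∧ a + g + 2 ≤ k) ∧ s4c k a i j e g = w := by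
  rw [a9cImg, mem_image] at h
  obtain ⟨p, hp, rfl⟩ := h
  have hq := mem_hexIdx.1 hp
  exact ⟨_, _, _, _, _, ⟨by omega, by omega, by omega, by omega⟩, rfl⟩

open Classical in
/-- What a member of `a9dImg k` is. [cite: EntingJensen2009, §7.4.2, Fig. 7.10] -/
theorem exists_of_mem_a9dImg {k : ℕ} {w : ℕ → Site 2} (h : w ∈ a9dImg k) :
    ∃ a i j e g : ℕ, (1 ≤ a ∧ i + j + e + 3 ≤ k ∧ i + g + 2 ≤ k ∧ a + g + 2 ≤ k) ∧ s4c k a i j e g = w := by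
  rw [a9dImg, mem_image] at h
  obtain ⟨p, hp, rfl⟩ := h
  have hq := mem_hexIdx.1 hp
  exact ⟨_, _, _, _, _, ⟨by omega, by omega, by omega, by omega⟩, rfl⟩

open Classical in
/-- What a member of `a9eImg k` is. [cite: EntingJensen2009, §7.4.2, Fig. 7.10] -/
theorem exists_of_mem_a9eImg {k : ℕ} {w : ℕ → Site 2} (h : w ∈ a9eImg k) :
    ∃ a i j e g : ℕ, (1 ≤ a ∧ i + j + e + 3 ≤ k ∧ i + g + 2 ≤ k ∧ a + g + 2 ≤ k) ∧ s4c k a i j e g = w := by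
  rw [a9eImg, mem_image] at h
  obtain ⟨p, hp, rfl⟩ := h
  have hq := mem_hexIdx.1 hp
  exact ⟨_, _, _, _, _, ⟨by omega, by omega, by omega, by omega⟩, rfl⟩

open Classical in
/-- What a member of `a9fImg k` is. [cite: EntingJensen2009, §7.4.2, Fig. 7.10] -/
theorem exists_of_mem_a9fImg {k : ℕ} {w : ℕ → Site 2} (h : w ∈ a9fImg k) :
    ∃ a i j e g : ℕ, (1 ≤ a ∧ i + j + e + 3 ≤ k ∧ i + g + 2 ≤ k ∧ a + g + 2 ≤ k) ∧ s4c k a i j e g = w := by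
  rw [a9fImg, mem_image] at h
  obtain ⟨p, hp, rfl⟩ := h
  have hq := mem_hexIdx.1 hp
  exact ⟨_, _, _, _, _, ⟨by omega, by omega, by omega, by omega⟩, rfl⟩

open Classical in
/-- What a member of `a9gImg k` is. [cite: EntingJensen2009, §7.4.2, Fig. 7.10] -/
theorem exists_of_mem_a9gImg {k : ℕ} {w : ℕ → Site 2} (h : w ∈ a9gImg k) :
    ∃ a i j e g : ℕ, (1 ≤ a ∧ i + j + e + 3 ≤ k ∧ i + g + 2 ≤ k ∧ a + g + 2 ≤ k) ∧ s4c k a i j e g = w := by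
  rw [a9gImg, mem_image] at h
  obtain ⟨p, hp, rfl⟩ := h
  have hq := mem_hexIdx.1 hp
  exact ⟨_, _, _, _, _, ⟨by omega, by omega, by omega, by omega⟩, rfl⟩

open Classical in
/-- What a member of `a9hImg k` is. [cite: EntingJensen2009, §7.4.2, Fig. 7.10] -/
theorem exists_of_mem_a9hImg {k : ℕ} {w : ℕ → Site 2} (h : w ∈ a9hImg k) :
    ∃ a i j e g : ℕ, (1 ≤ a ∧ i + j + e + 3 ≤ k ∧ i + g + 2 ≤ k ∧ a + g + 2 ≤ k) ∧ s4c k a i j e g = w := by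
  rw [a9hImg, mem_image] at h
  obtain ⟨p, hp, rfl⟩ := h
  have hq := mem_hexIdx.1 hp
  exact ⟨_, _, _, _, _, ⟨by omega, by omega, by omega, by omega⟩, rfl⟩

open Classical in
/-- What a member of `a9iImg k` is. [cite: EntingJensen2009, §7.4.2, Fig. 7.10] -/
theorem exists_of_mem_a9iImg {k : ℕ} {w : ℕ → Site 2} (h : w ∈ a9iImg k) :
    ∃ a i j e g : ℕ, (1 ≤ a ∧ i + j + e + 3 ≤ k ∧ i + g + 2 ≤ k ∧ a + g + 2 ≤ k) ∧ s4c k a i j e g = w := by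
  rw [a9iImg, mem_image] at h
  obtain ⟨p, hp, rfl⟩ := h
  have hq := mem_hexIdx.1 hp
  exact ⟨_, _, _, _, _, ⟨by omega, by omega, by omega, by omega⟩, rfl⟩

open Classical in
/-- What a member of `a10Img k` is. [cite: EntingJensen2009, §7.4.2, Fig. 7.10] -/
theorem exists_of_mem_a10Img {k : ℕ} {w : ℕ → Site 2} (h : w ∈ a10Img k) :
    ∃ i j e g : ℕ, (i + j + e + g + 4 ≤ k) ∧ s4d k i j e g = w := by
  rw [a10Img, mem_image] at h
  obtain ⟨p, hp, rfl⟩ := h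
  have hq := mem_pentIdx.1 hp
  exact ⟨_, _, _, _, by omega, rfl⟩

open Classical in
/-- What a member of `a11aImg k` is. [cite: EntingJensen2009, §7.4.2, Fig. 7.10] -/
theorem exists_of_mem_a11aImg {k : ℕ} {w : ℕ → Site 2} (h : w ∈ a11aImg k) :
    ∃ a i j d g : ℕ, (1 ≤ a ∧ i + j + d + g + 4 ≤ k ∧ a + g + 2 ≤ k) ∧ s4e k a i j d g = w := by
  rw [a11aImg, mem_image] at h
  obtain ⟨p, hp, rfl⟩ := h
  have hq := mem_hexIdx.1 hp
  exact ⟨_, _, _, _, _, ⟨by omega, by omega, by omega⟩, rfl⟩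

open Classical in
/-- What a member of `a11bImg k` is. [cite: EntingJensen2009, §7.4.2, Fig. 7.10] -/
theorem exists_of_mem_a11bImg {k : ℕ} {w : ℕ → Site 2} (h : w ∈ a11bImg k) :
    ∃ a i j d g : ℕ, (1 ≤ a ∧ i + j + d + g + 4 ≤ k ∧ a + g + 2 ≤ k) ∧ s4e k a i j d g = w := by
  rw [a11bImg, mem_image] at h
  obtain ⟨p, hp, rfl⟩ := h
  have hq := mem_hexIdx.1 hp
  exact ⟨_, _, _, _, _, ⟨by omega, by omega, by omega⟩, rfl⟩

open Classical in
/-- What a member of `a11cImg k` is. [cite: EntingJensen2009, §7.4.2, Fig. 7.10] -/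
theorem exists_of_mem_a11cImg {k : ℕ} {w : ℕ → Site 2} (h : w ∈ a11cImg k) :
    ∃ a i j d g : ℕ, (1 ≤ a ∧ i + j + d + g + 4 ≤ k ∧ a + g + 2 ≤ k) ∧ s4e k a i j d g = w := by
  rw [a11cImg, mem_image] at h
  obtain ⟨p, hp, rfl⟩ := h
  have hq := mem_hexIdx.1 hp
  exact ⟨_, _, _, _, _, ⟨by omega, by omega, by omega⟩, rfl⟩

open Classical in
/-- What a member of `a11dImg k` is. [cite: EntingJensen2009, §7.4.2, Fig. 7.10] -/
theorem exists_of_mem_a11dImg {k : ℕ} {w : ℕ → Site 2} (h : w ∈ a11dImg k) :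
    ∃ a i j d g : ℕ, (1 ≤ a ∧ i + j + d + g + 4 ≤ k ∧ a + g + 2 ≤ k) ∧ s4e k a i j d g = w := by
  rw [a11dImg, mem_image] at h
  obtain ⟨p, hp, rfl⟩ := h
  have hq := mem_hexIdx.1 hp
  exact ⟨_, _, _, _, _, ⟨by omega, by omega, by omega⟩, rfl⟩

open Classical in
/-- What a member of `a12Img k` is. [cite: EntingJensen2009, §7.4.2, Fig. 7.10] -/
theorem exists_of_mem_a12Img {k : ℕ} {w : ℕ → Site 2} (h : w ∈ a12Img k) :
    ∃ i j d g : ℕ, (i + j + d + g + 5 ≤ k) ∧ s4f k i j d g = w := by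
  rw [a12Img, mem_image] at h
  obtain ⟨p, hp, rfl⟩ := h
  have hq := mem_pentIdx.1 hp
  exact ⟨_, _, _, _, by omega, rfl⟩

open Classical in
/-- What a member of `a13aImg k` is. [cite: EntingJensen2009, §7.4.2, Fig. 7.10] -/
theorem exists_of_mem_a13aImg {k : ℕ} {w : ℕ → Site 2} (h : w ∈ a13aImg k) :
    ∃ a i d e g : ℕ, (1 ≤ a ∧ a + d + e + g + 4 ≤ k ∧ i + d + e + g + 4 ≤ k) ∧ s4g k a i d e g = w := by
  rw [a13aImg, mem_image] at h
  obtain ⟨p, hp, rfl⟩ := h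
  have hq := mem_hexIdx.1 hp
  exact ⟨_, _, _, _, _, ⟨by omega, by omega, by omega⟩, rfl⟩

open Classical in
/-- What a member of `a13bImg k` is. [cite: EntingJensen2009, §7.4.2, Fig. 7.10] -/
theorem exists_of_mem_a13bImg {k : ℕ} {w : ℕ → Site 2} (h : w ∈ a13bImg k) :
    ∃ a i d e g : ℕ, (1 ≤ a ∧ a + d + e + g + 4 ≤ k ∧ i + d + e + g + 4 ≤ k) ∧ s4g k a i d e g = w := by
  rw [a13bImg, mem_image] at h
  obtain ⟨p, hp, rfl⟩ := h
  have hq := mem_hexIdx.1 hp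
  exact ⟨_, _, _, _, _, ⟨by omega, by omega, by omega⟩, rfl⟩

open Classical in
/-- What a member of `a14Img k` is. [cite: EntingJensen2009, §7.4.2, Fig. 7.10] -/
theorem exists_of_mem_a14Img {k : ℕ} {w : ℕ → Site 2} (h : w ∈ a14Img k) :
    ∃ a i j d g : ℕ, (i + j + d + 3 ≤ a ∧ a + g + 2 ≤ k) ∧ s4h k a i j d g = w := by
  rw [a14Img, mem_image] at h
  obtain ⟨p, hp, rfl⟩ := h
  have hq := mem_hexIdx.1 hp
  exact ⟨_, _, _, _, _, ⟨by omega, by omega⟩, rfl⟩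

open Classical in
/-- What a member of `a15Img k` is. [cite: EntingJensen2009, §7.4.2, Fig. 7.10] -/
theorem exists_of_mem_a15Img {k : ℕ} {w : ℕ → Site 2} (h : w ∈ a15Img k) :
    ∃ i j d g : ℕ, (i + j + d + 4 ≤ k ∧ g ≤ i) ∧ s4i k i j d g = w := by
  rw [a15Img, mem_image] at h
  obtain ⟨p, hp, rfl⟩ := h
  have hq := mem_pentIdx.1 hp
  exact ⟨_, _, _, _, ⟨by omega, by omega⟩, rfl⟩

open Classical in
/-- What a member of `b5Img k` is. [cite: EntingJensen2009, §7.4.2, Fig. 7.10] -/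
theorem exists_of_mem_b5Img {k : ℕ} {w : ℕ → Site 2} (h : w ∈ b5Img k) :
    ∃ a : ℕ, (1 ≤ a ∧ a + 2 ≤ k) ∧ s4j k a = w := by
  rw [b5Img, mem_image] at h
  obtain ⟨p, hp, rfl⟩ := h
  have hq := mem_range.1 hp
  exact ⟨_, ⟨by omega, by omega⟩, rfl⟩

open Classical in
/-- `#a7aImg k = #(hexIdx (k - 3))`. [cite: EntingJensen2009, §7.4.2, Fig. 7.10] -/
theorem card_a7aImg (k : ℕ) : #(a7aImg k) = #(hexIdx (k - 3)) := by
  rw [a7aImg, card_image_of_injOn]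
  intro p hp p' hp' e
  rw [mem_coe] at hp hp'
  have hq := mem_hexIdx.1 hp
  have hq' := mem_hexIdx.1 hp'
  obtain ⟨e1, e2, e3, e4, e5⟩
      := s4a_inj (by omega) (by omega) (by omega) (by omega) (by omega) (by omega) (by omega) (by omega) e
  exact Prod.ext (by omega) (Prod.ext (by omega) (Prod.ext (by omega) (Prod.ext (by omega) (by omega))))

open Classical in
/-- `#a7bImg k = #(hexIdx (k - 3))`. [cite: EntingJensen2009, §7.4.2, Fig. 7.10] -/
theorem card_a7bImg (k : ℕ) : #(a7bImg k) = #(hexIdx (k - 3)) := by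
  rw [a7bImg, card_image_of_injOn]
  intro p hp p' hp' e
  rw [mem_coe] at hp hp'
  have hq := mem_hexIdx.1 hp
  have hq' := mem_hexIdx.1 hp'
  obtain ⟨e1, e2, e3, e4, e5⟩
      := s4a_inj (by omega) (by omega) (by omega) (by omega) (by omega) (by omega) (by omega) (by omega) e
  exact Prod.ext (by omega) (Prod.ext (by omega) (Prod.ext (by omega) (Prod.ext (by omega) (by omega))))

open Classical in
/-- `#a7cImg k = #(hexIdx (k - 3))`. [cite: EntingJensen2009, §7.4.2, Fig. 7.10] -/
theorem card_a7cImg (k : ℕ) : #(a7cImg k) = #(hexIdx (k - 3)) := by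
  rw [a7cImg, card_image_of_injOn]
  intro p hp p' hp' e
  rw [mem_coe] at hp hp'
  have hq := mem_hexIdx.1 hp
  have hq' := mem_hexIdx.1 hp'
  obtain ⟨e1, e2, e3, e4, e5⟩
      := s4a_inj (by omega) (by omega) (by omega) (by omega) (by omega) (by omega) (by omega) (by omega) e
  exact Prod.ext (by omega) (Prod.ext (by omega) (Prod.ext (by omega) (Prod.ext (by omega) (by omega))))

open Classical in
/-- `#a7dImg k = #(hexIdx (k - 4))`. [cite: EntingJensen2009, §7.4.2, Fig. 7.10] -/
theorem card_a7dImg (k : ℕ) : #(a7dImg k) = #(hexIdx (k - 4)) := by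
  rw [a7dImg, card_image_of_injOn]
  intro p hp p' hp' e
  rw [mem_coe] at hp hp'
  have hq := mem_hexIdx.1 hp
  have hq' := mem_hexIdx.1 hp'
  obtain ⟨e1, e2, e3, e4, e5⟩
      := s4a_inj (by omega) (by omega) (by omega) (by omega) (by omega) (by omega) (by omega) (by omega) e
  exact Prod.ext (by omega) (Prod.ext (by omega) (Prod.ext (by omega) (Prod.ext (by omega) (by omega))))

open Classical in
/-- `#a8aImg k = #(pentIdx (k - 2))`. [cite: EntingJensen2009, §7.4.2, Fig. 7.10] -/
theorem card_a8aImg (k : ℕ) : #(a8aImg k) = #(pentIdx (k - 2)) := by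
  rw [a8aImg, card_image_of_injOn]
  intro p hp p' hp' e
  rw [mem_coe] at hp hp'
  have hq := mem_pentIdx.1 hp
  have hq' := mem_pentIdx.1 hp'
  obtain ⟨e1, e2, e3, e4⟩ := s4b_inj (by omega) (by omega) (by omega) (by omega) (by omega) (by omega) e
  exact Prod.ext (by omega) (Prod.ext (by omega) (Prod.ext (by omega) (by omega)))

open Classical in
/-- `#a8bImg k = #(pentIdx (k - 3))`. [cite: EntingJensen2009, §7.4.2, Fig. 7.10] -/
theorem card_a8bImg (k : ℕ) : #(a8bImg k) = #(pentIdx (k - 3)) := by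
  rw [a8bImg, card_image_of_injOn]
  intro p hp p' hp' e
  rw [mem_coe] at hp hp'
  have hq := mem_pentIdx.1 hp
  have hq' := mem_pentIdx.1 hp'
  obtain ⟨e1, e2, e3, e4⟩ := s4b_inj (by omega) (by omega) (by omega) (by omega) (by omega) (by omega) e
  exact Prod.ext (by omega) (Prod.ext (by omega) (Prod.ext (by omega) (by omega)))

open Classical in
/-- `#a9aImg k = #(hexIdx (k - 3))`. [cite: EntingJensen2009, §7.4.2, Fig. 7.10] -/
theorem card_a9aImg (k : ℕ) : #(a9aImg k) = #(hexIdx (k - 3)) := by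
  rw [a9aImg, card_image_of_injOn]
  intro p hp p' hp' e
  rw [mem_coe] at hp hp'
  have hq := mem_hexIdx.1 hp
  have hq' := mem_hexIdx.1 hp'
  obtain ⟨e1, e2, e3, e4, e5⟩
      := s4c_inj (by omega) (by omega) (by omega) (by omega) (by omega) (by omega) (by omega) (by omega) e
  exact Prod.ext (by omega) (Prod.ext (by omega) (Prod.ext (by omega) (Prod.ext (by omega) (by omega))))

open Classical in
/-- `#a9bImg k = #(hexIdx (k - 3))`. [cite: EntingJensen2009, §7.4.2, Fig. 7.10] -/
theorem card_a9bImg (k : ℕ) : #(a9bImg k) = #(hexIdx (k - 3)) := by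
  rw [a9bImg, card_image_of_injOn]
  intro p hp p' hp' e
  rw [mem_coe] at hp hp'
  have hq := mem_hexIdx.1 hp
  have hq' := mem_hexIdx.1 hp'
  obtain ⟨e1, e2, e3, e4, e5⟩
      := s4c_inj (by omega) (by omega) (by omega) (by omega) (by omega) (by omega) (by omega) (by omega) e
  exact Prod.ext (by omega) (Prod.ext (by omega) (Prod.ext (by omega) (Prod.ext (by omega) (by omega))))

open Classical in
/-- `#a9cImg k = #(hexIdx (k - 4))`. [cite: EntingJensen2009, §7.4.2, Fig. 7.10] -/
theorem card_a9cImg (k : ℕ) : #(a9cImg k) = #(hexIdx (k - 4)) := by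
  rw [a9cImg, card_image_of_injOn]
  intro p hp p' hp' e
  rw [mem_coe] at hp hp'
  have hq := mem_hexIdx.1 hp
  have hq' := mem_hexIdx.1 hp'
  obtain ⟨e1, e2, e3, e4, e5⟩
      := s4c_inj (by omega) (by omega) (by omega) (by omega) (by omega) (by omega) (by omega) (by omega) e
  exact Prod.ext (by omega) (Prod.ext (by omega) (Prod.ext (by omega) (Prod.ext (by omega) (by omega))))

open Classical in
/-- `#a9dImg k = #(hexIdx (k - 3))`. [cite: EntingJensen2009, §7.4.2, Fig. 7.10] -/
theorem card_a9dImg (k : ℕ) : #(a9dImg k) = #(hexIdx (k - 3)) := by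
  rw [a9dImg, card_image_of_injOn]
  intro p hp p' hp' e
  rw [mem_coe] at hp hp'
  have hq := mem_hexIdx.1 hp
  have hq' := mem_hexIdx.1 hp'
  obtain ⟨e1, e2, e3, e4, e5⟩
      := s4c_inj (by omega) (by omega) (by omega) (by omega) (by omega) (by omega) (by omega) (by omega) e
  exact Prod.ext (by omega) (Prod.ext (by omega) (Prod.ext (by omega) (Prod.ext (by omega) (by omega))))

open Classical in
/-- `#a9eImg k = #(hexIdx (k - 3))`. [cite: EntingJensen2009, §7.4.2, Fig. 7.10] -/
theorem card_a9eImg (k : ℕ) : #(a9eImg k) = #(hexIdx (k - 3)) := by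
  rw [a9eImg, card_image_of_injOn]
  intro p hp p' hp' e
  rw [mem_coe] at hp hp'
  have hq := mem_hexIdx.1 hp
  have hq' := mem_hexIdx.1 hp'
  obtain ⟨e1, e2, e3, e4, e5⟩
      := s4c_inj (by omega) (by omega) (by omega) (by omega) (by omega) (by omega) (by omega) (by omega) e
  exact Prod.ext (by omega) (Prod.ext (by omega) (Prod.ext (by omega) (Prod.ext (by omega) (by omega))))

open Classical in
/-- `#a9fImg k = #(hexIdx (k - 4))`. [cite: EntingJensen2009, §7.4.2, Fig. 7.10] -/
theorem card_a9fImg (k : ℕ) : #(a9fImg k) = #(hexIdx (k - 4)) := by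
  rw [a9fImg, card_image_of_injOn]
  intro p hp p' hp' e
  rw [mem_coe] at hp hp'
  have hq := mem_hexIdx.1 hp
  have hq' := mem_hexIdx.1 hp'
  obtain ⟨e1, e2, e3, e4, e5⟩
      := s4c_inj (by omega) (by omega) (by omega) (by omega) (by omega) (by omega) (by omega) (by omega) e
  exact Prod.ext (by omega) (Prod.ext (by omega) (Prod.ext (by omega) (Prod.ext (by omega) (by omega))))

open Classical in
/-- `#a9gImg k = #(hexIdx (k - 3))`. [cite: EntingJensen2009, §7.4.2, Fig. 7.10] -/
theorem card_a9gImg (k : ℕ) : #(a9gImg k) = #(hexIdx (k - 3)) := by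
  rw [a9gImg, card_image_of_injOn]
  intro p hp p' hp' e
  rw [mem_coe] at hp hp'
  have hq := mem_hexIdx.1 hp
  have hq' := mem_hexIdx.1 hp'
  obtain ⟨e1, e2, e3, e4, e5⟩
      := s4c_inj (by omega) (by omega) (by omega) (by omega) (by omega) (by omega) (by omega) (by omega) e
  exact Prod.ext (by omega) (Prod.ext (by omega) (Prod.ext (by omega) (Prod.ext (by omega) (by omega))))

open Classical in
/-- `#a9hImg k = #(hexIdx (k - 3))`. [cite: EntingJensen2009, §7.4.2, Fig. 7.10] -/
theorem card_a9hImg (k : ℕ) : #(a9hImg k) = #(hexIdx (k - 3)) := by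
  rw [a9hImg, card_image_of_injOn]
  intro p hp p' hp' e
  rw [mem_coe] at hp hp'
  have hq := mem_hexIdx.1 hp
  have hq' := mem_hexIdx.1 hp'
  obtain ⟨e1, e2, e3, e4, e5⟩
      := s4c_inj (by omega) (by omega) (by omega) (by omega) (by omega) (by omega) (by omega) (by omega) e
  exact Prod.ext (by omega) (Prod.ext (by omega) (Prod.ext (by omega) (Prod.ext (by omega) (by omega))))

open Classical in
/-- `#a9iImg k = #(hexIdx (k - 2))`. [cite: EntingJensen2009, §7.4.2, Fig. 7.10] -/
theorem card_a9iImg (k : ℕ) : #(a9iImg k) = #(hexIdx (k - 2)) := by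
  rw [a9iImg, card_image_of_injOn]
  intro p hp p' hp' e
  rw [mem_coe] at hp hp'
  have hq := mem_hexIdx.1 hp
  have hq' := mem_hexIdx.1 hp'
  obtain ⟨e1, e2, e3, e4, e5⟩
      := s4c_inj (by omega) (by omega) (by omega) (by omega) (by omega) (by omega) (by omega) (by omega) e
  exact Prod.ext (by omega) (Prod.ext (by omega) (Prod.ext (by omega) (Prod.ext (by omega) (by omega))))

open Classical in
/-- `#a10Img k = #(pentIdx (k - 3))`. [cite: EntingJensen2009, §7.4.2, Fig. 7.10] -/
theorem card_a10Img (k : ℕ) : #(a10Img k) = #(pentIdx (k - 3)) := by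
  rw [a10Img, card_image_of_injOn]
  intro p hp p' hp' e
  rw [mem_coe] at hp hp'
  have hq := mem_pentIdx.1 hp
  have hq' := mem_pentIdx.1 hp'
  obtain ⟨e1, e2, e3, e4⟩ := s4d_inj (by omega) (by omega) e
  exact Prod.ext (by omega) (Prod.ext (by omega) (Prod.ext (by omega) (by omega)))

open Classical in
/-- `#a11aImg k = #(hexIdx (k - 3))`. [cite: EntingJensen2009, §7.4.2, Fig. 7.10] -/
theorem card_a11aImg (k : ℕ) : #(a11aImg k) = #(hexIdx (k - 3)) := by
  rw [a11aImg, card_image_of_injOn]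
  intro p hp p' hp' e
  rw [mem_coe] at hp hp'
  have hq := mem_hexIdx.1 hp
  have hq' := mem_hexIdx.1 hp'
  obtain ⟨e1, e2, e3, e4, e5⟩ := s4e_inj (by omega) (by omega) (by omega) (by omega) (by omega) (by omega) e
  exact Prod.ext (by omega) (Prod.ext (by omega) (Prod.ext (by omega) (Prod.ext (by omega) (by omega))))

open Classical in
/-- `#a11bImg k = #(hexIdx (k - 3))`. [cite: EntingJensen2009, §7.4.2, Fig. 7.10] -/
theorem card_a11bImg (k : ℕ) : #(a11bImg k) = #(hexIdx (k - 3)) := by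
  rw [a11bImg, card_image_of_injOn]
  intro p hp p' hp' e
  rw [mem_coe] at hp hp'
  have hq := mem_hexIdx.1 hp
  have hq' := mem_hexIdx.1 hp'
  obtain ⟨e1, e2, e3, e4, e5⟩ := s4e_inj (by omega) (by omega) (by omega) (by omega) (by omega) (by omega) e
  exact Prod.ext (by omega) (Prod.ext (by omega) (Prod.ext (by omega) (Prod.ext (by omega) (by omega))))

open Classical in
/-- `#a11cImg k = #(hexIdx (k - 4))`. [cite: EntingJensen2009, §7.4.2, Fig. 7.10] -/
theorem card_a11cImg (k : ℕ) : #(a11cImg k) = #(hexIdx (k - 4)) := by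
  rw [a11cImg, card_image_of_injOn]
  intro p hp p' hp' e
  rw [mem_coe] at hp hp'
  have hq := mem_hexIdx.1 hp
  have hq' := mem_hexIdx.1 hp'
  obtain ⟨e1, e2, e3, e4, e5⟩ := s4e_inj (by omega) (by omega) (by omega) (by omega) (by omega) (by omega) e
  exact Prod.ext (by omega) (Prod.ext (by omega) (Prod.ext (by omega) (Prod.ext (by omega) (by omega))))

open Classical in
/-- `#a11dImg k = #(hexIdx (k - 4))`. [cite: EntingJensen2009, §7.4.2, Fig. 7.10] -/
theorem card_a11dImg (k : ℕ) : #(a11dImg k) = #(hexIdx (k - 4)) := by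
  rw [a11dImg, card_image_of_injOn]
  intro p hp p' hp' e
  rw [mem_coe] at hp hp'
  have hq := mem_hexIdx.1 hp
  have hq' := mem_hexIdx.1 hp'
  obtain ⟨e1, e2, e3, e4, e5⟩ := s4e_inj (by omega) (by omega) (by omega) (by omega) (by omega) (by omega) e
  exact Prod.ext (by omega) (Prod.ext (by omega) (Prod.ext (by omega) (Prod.ext (by omega) (by omega))))

open Classical in
/-- `#a12Img k = #(pentIdx (k - 4))`. [cite: EntingJensen2009, §7.4.2, Fig. 7.10] -/
theorem card_a12Img (k : ℕ) : #(a12Img k) = #(pentIdx (k - 4)) := by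
  rw [a12Img, card_image_of_injOn]
  intro p hp p' hp' e
  rw [mem_coe] at hp hp'
  have hq := mem_pentIdx.1 hp
  have hq' := mem_pentIdx.1 hp'
  obtain ⟨e1, e2, e3, e4⟩ := s4f_inj (by omega) (by omega) e
  exact Prod.ext (by omega) (Prod.ext (by omega) (Prod.ext (by omega) (by omega)))

open Classical in
/-- `#a13aImg k = #(hexIdx (k - 4))`. [cite: EntingJensen2009, §7.4.2, Fig. 7.10] -/
theorem card_a13aImg (k : ℕ) : #(a13aImg k) = #(hexIdx (k - 4)) := by
  rw [a13aImg, card_image_of_injOn]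
  intro p hp p' hp' e
  rw [mem_coe] at hp hp'
  have hq := mem_hexIdx.1 hp
  have hq' := mem_hexIdx.1 hp'
  obtain ⟨e1, e2, e3, e4, e5⟩ := s4g_inj (by omega) (by omega) (by omega) (by omega) (by omega) (by omega) e
  exact Prod.ext (by omega) (Prod.ext (by omega) (Prod.ext (by omega) (Prod.ext (by omega) (by omega))))

open Classical in
/-- `#a13bImg k = #(hexIdx (k - 4))`. [cite: EntingJensen2009, §7.4.2, Fig. 7.10] -/
theorem card_a13bImg (k : ℕ) : #(a13bImg k) = #(hexIdx (k - 4)) := by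
  rw [a13bImg, card_image_of_injOn]
  intro p hp p' hp' e
  rw [mem_coe] at hp hp'
  have hq := mem_hexIdx.1 hp
  have hq' := mem_hexIdx.1 hp'
  obtain ⟨e1, e2, e3, e4, e5⟩ := s4g_inj (by omega) (by omega) (by omega) (by omega) (by omega) (by omega) e
  exact Prod.ext (by omega) (Prod.ext (by omega) (Prod.ext (by omega) (Prod.ext (by omega) (by omega))))

open Classical in
/-- `#a14Img k = #(hexIdx (k - 4))`. [cite: EntingJensen2009, §7.4.2, Fig. 7.10] -/
theorem card_a14Img (k : ℕ) : #(a14Img k) = #(hexIdx (k - 4)) := by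
  rw [a14Img, card_image_of_injOn]
  intro p hp p' hp' e
  rw [mem_coe] at hp hp'
  have hq := mem_hexIdx.1 hp
  have hq' := mem_hexIdx.1 hp'
  obtain ⟨e1, e2, e3, e4, e5⟩ := s4h_inj (by omega) (by omega) (by omega) (by omega) e
  exact Prod.ext (by omega) (Prod.ext (by omega) (Prod.ext (by omega) (Prod.ext (by omega) (by omega))))

open Classical in
/-- `#a15Img k = #(pentIdx (k - 3))`. [cite: EntingJensen2009, §7.4.2, Fig. 7.10] -/
theorem card_a15Img (k : ℕ) : #(a15Img k) = #(pentIdx (k - 3)) := by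
  rw [a15Img, card_image_of_injOn]
  intro p hp p' hp' e
  rw [mem_coe] at hp hp'
  have hq := mem_pentIdx.1 hp
  have hq' := mem_pentIdx.1 hp'
  obtain ⟨e1, e2, e3, e4⟩ := s4i_inj (by omega) (by omega) (by omega) (by omega) e
  exact Prod.ext (by omega) (Prod.ext (by omega) (Prod.ext (by omega) (by omega)))

open Classical in
/-- `#b5Img k = #(range (k - 2))`. [cite: EntingJensen2009, §7.4.2, Fig. 7.10] -/
theorem card_b5Img (k : ℕ) : #(b5Img k) = #(range (k - 2)) := by
  rw [b5Img, card_image_of_injOn]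
  intro p hp p' hp' e
  rw [mem_coe] at hp hp'
  have hq := mem_range.1 hp
  have hq' := mem_range.1 hp'
  have e1 := s4j_inj (by omega) (by omega) (by omega) (by omega) e
  omega

open Classical in
/-- The piece `a7bImg` is disjoint from the previous pieces of its family.
[cite: EntingJensen2009, §7.4.2, Fig. 7.10] -/
private theorem disjp_a7bImg (k : ℕ) : Disjoint (a7aImg k) (a7bImg k) := by
  refine disjoint_left.2 fun w h1 h2 => ?_
  rw [a7bImg, mem_image] at h2
  obtain ⟨q, hq, rfl⟩ := h2
  have hq' := mem_hexIdx.1 hq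
  rw [a7aImg, mem_image] at h1
  obtain ⟨p, hp, e⟩ := h1
  have hp' := mem_hexIdx.1 hp
  obtain ⟨e1, e2, e3, e4, e5⟩
      := s4a_inj (by omega) (by omega) (by omega) (by omega) (by omega) (by omega) (by omega) (by omega) e
  omega

open Classical in
/-- The piece `a7cImg` is disjoint from the previous pieces of its family.
[cite: EntingJensen2009, §7.4.2, Fig. 7.10] -/
private theorem disjp_a7cImg (k : ℕ) : Disjoint (a7aImg k ∪ a7bImg k) (a7cImg k) := by
  refine disjoint_left.2 fun w h1 h2 => ?_
  rw [a7cImg, mem_image] at h2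
  obtain ⟨q, hq, rfl⟩ := h2
  have hq' := mem_hexIdx.1 hq
  simp only [mem_union] at h1
  rcases h1 with h1 | h1
  · rw [a7aImg, mem_image] at h1
    obtain ⟨p, hp, e⟩ := h1
    have hp' := mem_hexIdx.1 hp
    obtain ⟨e1, e2, e3, e4, e5⟩
        := s4a_inj (by omega) (by omega) (by omega) (by omega) (by omega) (by omega) (by omega) (by omega) e
    omega
  · rw [a7bImg, mem_image] at h1
    obtain ⟨p, hp, e⟩ := h1
    have hp' := mem_hexIdx.1 hp
    obtain ⟨e1, e2, e3, e4, e5⟩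
        := s4a_inj (by omega) (by omega) (by omega) (by omega) (by omega) (by omega) (by omega) (by omega) e
    omega

open Classical in
/-- The piece `a7dImg` is disjoint from the previous pieces of its family.
[cite: EntingJensen2009, §7.4.2, Fig. 7.10] -/
private theorem disjp_a7dImg (k : ℕ) : Disjoint (a7aImg k ∪ a7bImg k ∪ a7cImg k) (a7dImg k) := by
  refine disjoint_left.2 fun w h1 h2 => ?_
  rw [a7dImg, mem_image] at h2
  obtain ⟨q, hq, rfl⟩ := h2
  have hq' := mem_hexIdx.1 hq
  simp only [mem_union] at h1
  rcases h1 with (h1 | h1) | h1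
  · rw [a7aImg, mem_image] at h1
    obtain ⟨p, hp, e⟩ := h1
    have hp' := mem_hexIdx.1 hp
    obtain ⟨e1, e2, e3, e4, e5⟩
        := s4a_inj (by omega) (by omega) (by omega) (by omega) (by omega) (by omega) (by omega) (by omega) e
    omega
  · rw [a7bImg, mem_image] at h1
    obtain ⟨p, hp, e⟩ := h1
    have hp' := mem_hexIdx.1 hp
    obtain ⟨e1, e2, e3, e4, e5⟩
        := s4a_inj (by omega) (by omega) (by omega) (by omega) (by omega) (by omega) (by omega) (by omega) e
    omega
  · rw [a7cImg, mem_image] at h1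
    obtain ⟨p, hp, e⟩ := h1
    have hp' := mem_hexIdx.1 hp
    obtain ⟨e1, e2, e3, e4, e5⟩
        := s4a_inj (by omega) (by omega) (by omega) (by omega) (by omega) (by omega) (by omega) (by omega) e
    omega

open Classical in
/-- What a member of `a7Img k` is. [cite: EntingJensen2009, §7.4.2, Fig. 7.10] -/
theorem exists_of_mem_a7Img {k : ℕ} {w : ℕ → Site 2} (h : w ∈ a7Img k) :
    ∃ a i j d g : ℕ, (i + j + 2 ≤ a ∧ a ≤ i + j + d + 1 ∧ d + 1 ≤ k ∧ a + g + 2 ≤ k) ∧ s4a k a i j d g = w := by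
  simp only [a7Img, mem_union] at h
  rcases h with ((h | h) | h) | h
  exacts [exists_of_mem_a7aImg h, exists_of_mem_a7bImg h, exists_of_mem_a7cImg h, exists_of_mem_a7dImg h]

open Classical in
/-- `#a7Img k` as a sum of simplex cardinalities. [cite: EntingJensen2009, §7.4.2, Fig. 7.10] -/
theorem card_a7Img (k : ℕ) : #(a7Img k) = #(hexIdx (k - 3)) + #(hexIdx (k - 3)) + #(hexIdx (k - 3))
    + #(hexIdx (k - 4)) := by
  rw [a7Img, card_union_of_disjoint (disjp_a7dImg k), card_union_of_disjoint (disjp_a7cImg k),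
      card_union_of_disjoint (disjp_a7bImg k),
    card_a7aImg, card_a7bImg, card_a7cImg, card_a7dImg]

open Classical in
/-- The piece `a8bImg` is disjoint from the previous pieces of its family.
[cite: EntingJensen2009, §7.4.2, Fig. 7.10] -/
private theorem disjp_a8bImg (k : ℕ) : Disjoint (a8aImg k) (a8bImg k) := by
  refine disjoint_left.2 fun w h1 h2 => ?_
  rw [a8bImg, mem_image] at h2
  obtain ⟨q, hq, rfl⟩ := h2
  have hq' := mem_pentIdx.1 hq
  rw [a8aImg, mem_image] at h1
  obtain ⟨p, hp, e⟩ := h1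
  have hp' := mem_pentIdx.1 hp
  obtain ⟨e1, e2, e3, e4⟩ := s4b_inj (by omega) (by omega) (by omega) (by omega) (by omega) (by omega) e
  omega

open Classical in
/-- What a member of `a8Img k` is. [cite: EntingJensen2009, §7.4.2, Fig. 7.10] -/
theorem exists_of_mem_a8Img {k : ℕ} {w : ℕ → Site 2} (h : w ∈ a8Img k) :
    ∃ i j e g : ℕ, (i + j + 3 ≤ k ∧ g ≤ i ∧ e + g ≤ i + j) ∧ s4b k i j e g = w := by
  simp only [a8Img, mem_union] at h
  rcases h with h | h
  exacts [exists_of_mem_a8aImg h, exists_of_mem_a8bImg h]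

open Classical in
/-- `#a8Img k` as a sum of simplex cardinalities. [cite: EntingJensen2009, §7.4.2, Fig. 7.10] -/
theorem card_a8Img (k : ℕ) : #(a8Img k) = #(pentIdx (k - 2)) + #(pentIdx (k - 3)) := by
  rw [a8Img, card_union_of_disjoint (disjp_a8bImg k),
    card_a8aImg, card_a8bImg]

open Classical in
/-- The piece `a9bImg` is disjoint from the previous pieces of its family.
[cite: EntingJensen2009, §7.4.2, Fig. 7.10] -/
private theorem disjp_a9bImg (k : ℕ) : Disjoint (a9aImg k) (a9bImg k) := by
  refine disjoint_left.2 fun w h1 h2 => ?_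
  rw [a9bImg, mem_image] at h2
  obtain ⟨q, hq, rfl⟩ := h2
  have hq' := mem_hexIdx.1 hq
  rw [a9aImg, mem_image] at h1
  obtain ⟨p, hp, e⟩ := h1
  have hp' := mem_hexIdx.1 hp
  obtain ⟨e1, e2, e3, e4, e5⟩
      := s4c_inj (by omega) (by omega) (by omega) (by omega) (by omega) (by omega) (by omega) (by omega) e
  omega

open Classical in
/-- The piece `a9cImg` is disjoint from the previous pieces of its family.
[cite: EntingJensen2009, §7.4.2, Fig. 7.10] -/
private theorem disjp_a9cImg (k : ℕ) : Disjoint (a9aImg k ∪ a9bImg k) (a9cImg k) := by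
  refine disjoint_left.2 fun w h1 h2 => ?_
  rw [a9cImg, mem_image] at h2
  obtain ⟨q, hq, rfl⟩ := h2
  have hq' := mem_hexIdx.1 hq
  simp only [mem_union] at h1
  rcases h1 with h1 | h1
  · rw [a9aImg, mem_image] at h1
    obtain ⟨p, hp, e⟩ := h1
    have hp' := mem_hexIdx.1 hp
    obtain ⟨e1, e2, e3, e4, e5⟩
        := s4c_inj (by omega) (by omega) (by omega) (by omega) (by omega) (by omega) (by omega) (by omega) e
    omega
  · rw [a9bImg, mem_image] at h1
    obtain ⟨p, hp, e⟩ := h1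
    have hp' := mem_hexIdx.1 hp
    obtain ⟨e1, e2, e3, e4, e5⟩
        := s4c_inj (by omega) (by omega) (by omega) (by omega) (by omega) (by omega) (by omega) (by omega) e
    omega

open Classical in
/-- The piece `a9dImg` is disjoint from the previous pieces of its family.
[cite: EntingJensen2009, §7.4.2, Fig. 7.10] -/
private theorem disjp_a9dImg (k : ℕ) : Disjoint (a9aImg k ∪ a9bImg k ∪ a9cImg k) (a9dImg k) := by
  refine disjoint_left.2 fun w h1 h2 => ?_
  rw [a9dImg, mem_image] at h2
  obtain ⟨q, hq, rfl⟩ := h2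
  have hq' := mem_hexIdx.1 hq
  simp only [mem_union] at h1
  rcases h1 with (h1 | h1) | h1
  · rw [a9aImg, mem_image] at h1
    obtain ⟨p, hp, e⟩ := h1
    have hp' := mem_hexIdx.1 hp
    obtain ⟨e1, e2, e3, e4, e5⟩
        := s4c_inj (by omega) (by omega) (by omega) (by omega) (by omega) (by omega) (by omega) (by omega) e
    omega
  · rw [a9bImg, mem_image] at h1
    obtain ⟨p, hp, e⟩ := h1
    have hp' := mem_hexIdx.1 hp
    obtain ⟨e1, e2, e3, e4, e5⟩
        := s4c_inj (by omega) (by omega) (by omega) (by omega) (by omega) (by omega) (by omega) (by omega) e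
    omega
  · rw [a9cImg, mem_image] at h1
    obtain ⟨p, hp, e⟩ := h1
    have hp' := mem_hexIdx.1 hp
    obtain ⟨e1, e2, e3, e4, e5⟩
        := s4c_inj (by omega) (by omega) (by omega) (by omega) (by omega) (by omega) (by omega) (by omega) e
    omega

open Classical in
/-- The piece `a9eImg` is disjoint from the previous pieces of its family.
[cite: EntingJensen2009, §7.4.2, Fig. 7.10] -/
private theorem disjp_a9eImg (k : ℕ) : Disjoint (a9aImg k ∪ a9bImg k ∪ a9cImg k ∪ a9dImg k) (a9eImg k) := by
  refine disjoint_left.2 fun w h1 h2 => ?_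
  rw [a9eImg, mem_image] at h2
  obtain ⟨q, hq, rfl⟩ := h2
  have hq' := mem_hexIdx.1 hq
  simp only [mem_union] at h1
  rcases h1 with ((h1 | h1) | h1) | h1
  · rw [a9aImg, mem_image] at h1
    obtain ⟨p, hp, e⟩ := h1
    have hp' := mem_hexIdx.1 hp
    obtain ⟨e1, e2, e3, e4, e5⟩
        := s4c_inj (by omega) (by omega) (by omega) (by omega) (by omega) (by omega) (by omega) (by omega) e
    omega
  · rw [a9bImg, mem_image] at h1
    obtain ⟨p, hp, e⟩ := h1
    have hp' := mem_hexIdx.1 hp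
    obtain ⟨e1, e2, e3, e4, e5⟩
        := s4c_inj (by omega) (by omega) (by omega) (by omega) (by omega) (by omega) (by omega) (by omega) e
    omega
  · rw [a9cImg, mem_image] at h1
    obtain ⟨p, hp, e⟩ := h1
    have hp' := mem_hexIdx.1 hp
    obtain ⟨e1, e2, e3, e4, e5⟩
        := s4c_inj (by omega) (by omega) (by omega) (by omega) (by omega) (by omega) (by omega) (by omega) e
    omega
  · rw [a9dImg, mem_image] at h1
    obtain ⟨p, hp, e⟩ := h1
    have hp' := mem_hexIdx.1 hp
    obtain ⟨e1, e2, e3, e4, e5⟩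
        := s4c_inj (by omega) (by omega) (by omega) (by omega) (by omega) (by omega) (by omega) (by omega) e
    omega

open Classical in
/-- The piece `a9fImg` is disjoint from the previous pieces of its family.
[cite: EntingJensen2009, §7.4.2, Fig. 7.10] -/
private theorem disjp_a9fImg (k : ℕ) : Disjoint (a9aImg k ∪ a9bImg k ∪ a9cImg k ∪ a9dImg k ∪ a9eImg k) (a9fImg k) := by
  refine disjoint_left.2 fun w h1 h2 => ?_
  rw [a9fImg, mem_image] at h2
  obtain ⟨q, hq, rfl⟩ := h2
  have hq' := mem_hexIdx.1 hq
  simp only [mem_union] at h1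
  rcases h1 with (((h1 | h1) | h1) | h1) | h1
  · rw [a9aImg, mem_image] at h1
    obtain ⟨p, hp, e⟩ := h1
    have hp' := mem_hexIdx.1 hp
    obtain ⟨e1, e2, e3, e4, e5⟩
        := s4c_inj (by omega) (by omega) (by omega) (by omega) (by omega) (by omega) (by omega) (by omega) e
    omega
  · rw [a9bImg, mem_image] at h1
    obtain ⟨p, hp, e⟩ := h1
    have hp' := mem_hexIdx.1 hp
    obtain ⟨e1, e2, e3, e4, e5⟩
        := s4c_inj (by omega) (by omega) (by omega) (by omega) (by omega) (by omega) (by omega) (by omega) e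
    omega
  · rw [a9cImg, mem_image] at h1
    obtain ⟨p, hp, e⟩ := h1
    have hp' := mem_hexIdx.1 hp
    obtain ⟨e1, e2, e3, e4, e5⟩
        := s4c_inj (by omega) (by omega) (by omega) (by omega) (by omega) (by omega) (by omega) (by omega) e
    omega
  · rw [a9dImg, mem_image] at h1
    obtain ⟨p, hp, e⟩ := h1
    have hp' := mem_hexIdx.1 hp
    obtain ⟨e1, e2, e3, e4, e5⟩
        := s4c_inj (by omega) (by omega) (by omega) (by omega) (by omega) (by omega) (by omega) (by omega) e
    omega
  · rw [a9eImg, mem_image] at h1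
    obtain ⟨p, hp, e⟩ := h1
    have hp' := mem_hexIdx.1 hp
    obtain ⟨e1, e2, e3, e4, e5⟩
        := s4c_inj (by omega) (by omega) (by omega) (by omega) (by omega) (by omega) (by omega) (by omega) e
    omega

open Classical in
/-- The piece `a9gImg` is disjoint from the previous pieces of its family.
[cite: EntingJensen2009, §7.4.2, Fig. 7.10] -/
private theorem disjp_a9gImg (k : ℕ) : Disjoint (a9aImg k ∪ a9bImg k ∪ a9cImg k ∪ a9dImg k ∪ a9eImg k
    ∪ a9fImg k) (a9gImg k) := by
  refine disjoint_left.2 fun w h1 h2 => ?_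
  rw [a9gImg, mem_image] at h2
  obtain ⟨q, hq, rfl⟩ := h2
  have hq' := mem_hexIdx.1 hq
  simp only [mem_union] at h1
  rcases h1 with ((((h1 | h1) | h1) | h1) | h1) | h1
  · rw [a9aImg, mem_image] at h1
    obtain ⟨p, hp, e⟩ := h1
    have hp' := mem_hexIdx.1 hp
    obtain ⟨e1, e2, e3, e4, e5⟩
        := s4c_inj (by omega) (by omega) (by omega) (by omega) (by omega) (by omega) (by omega) (by omega) e
    omega
  · rw [a9bImg, mem_image] at h1
    obtain ⟨p, hp, e⟩ := h1
    have hp' := mem_hexIdx.1 hp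
    obtain ⟨e1, e2, e3, e4, e5⟩
        := s4c_inj (by omega) (by omega) (by omega) (by omega) (by omega) (by omega) (by omega) (by omega) e
    omega
  · rw [a9cImg, mem_image] at h1
    obtain ⟨p, hp, e⟩ := h1
    have hp' := mem_hexIdx.1 hp
    obtain ⟨e1, e2, e3, e4, e5⟩
        := s4c_inj (by omega) (by omega) (by omega) (by omega) (by omega) (by omega) (by omega) (by omega) e
    omega
  · rw [a9dImg, mem_image] at h1
    obtain ⟨p, hp, e⟩ := h1
    have hp' := mem_hexIdx.1 hp
    obtain ⟨e1, e2, e3, e4, e5⟩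
        := s4c_inj (by omega) (by omega) (by omega) (by omega) (by omega) (by omega) (by omega) (by omega) e
    omega
  · rw [a9eImg, mem_image] at h1
    obtain ⟨p, hp, e⟩ := h1
    have hp' := mem_hexIdx.1 hp
    obtain ⟨e1, e2, e3, e4, e5⟩
        := s4c_inj (by omega) (by omega) (by omega) (by omega) (by omega) (by omega) (by omega) (by omega) e
    omega
  · rw [a9fImg, mem_image] at h1
    obtain ⟨p, hp, e⟩ := h1
    have hp' := mem_hexIdx.1 hp
    obtain ⟨e1, e2, e3, e4, e5⟩
        := s4c_inj (by omega) (by omega) (by omega) (by omega) (by omega) (by omega) (by omega) (by omega) e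
    omega

open Classical in
/-- The piece `a9hImg` is disjoint from the previous pieces of its family.
[cite: EntingJensen2009, §7.4.2, Fig. 7.10] -/
private theorem disjp_a9hImg (k : ℕ) : Disjoint (a9aImg k ∪ a9bImg k ∪ a9cImg k ∪ a9dImg k ∪ a9eImg k ∪ a9fImg k
    ∪ a9gImg k) (a9hImg k) := by
  refine disjoint_left.2 fun w h1 h2 => ?_
  rw [a9hImg, mem_image] at h2
  obtain ⟨q, hq, rfl⟩ := h2
  have hq' := mem_hexIdx.1 hq
  simp only [mem_union] at h1
  rcases h1 with (((((h1 | h1) | h1) | h1) | h1) | h1) | h1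
  · rw [a9aImg, mem_image] at h1
    obtain ⟨p, hp, e⟩ := h1
    have hp' := mem_hexIdx.1 hp
    obtain ⟨e1, e2, e3, e4, e5⟩
        := s4c_inj (by omega) (by omega) (by omega) (by omega) (by omega) (by omega) (by omega) (by omega) e
    omega
  · rw [a9bImg, mem_image] at h1
    obtain ⟨p, hp, e⟩ := h1
    have hp' := mem_hexIdx.1 hp
    obtain ⟨e1, e2, e3, e4, e5⟩
        := s4c_inj (by omega) (by omega) (by omega) (by omega) (by omega) (by omega) (by omega) (by omega) e
    omega
  · rw [a9cImg, mem_image] at h1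
    obtain ⟨p, hp, e⟩ := h1
    have hp' := mem_hexIdx.1 hp
    obtain ⟨e1, e2, e3, e4, e5⟩
        := s4c_inj (by omega) (by omega) (by omega) (by omega) (by omega) (by omega) (by omega) (by omega) e
    omega
  · rw [a9dImg, mem_image] at h1
    obtain ⟨p, hp, e⟩ := h1
    have hp' := mem_hexIdx.1 hp
    obtain ⟨e1, e2, e3, e4, e5⟩
        := s4c_inj (by omega) (by omega) (by omega) (by omega) (by omega) (by omega) (by omega) (by omega) e
    omega
  · rw [a9eImg, mem_image] at h1
    obtain ⟨p, hp, e⟩ := h1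
    have hp' := mem_hexIdx.1 hp
    obtain ⟨e1, e2, e3, e4, e5⟩
        := s4c_inj (by omega) (by omega) (by omega) (by omega) (by omega) (by omega) (by omega) (by omega) e
    omega
  · rw [a9fImg, mem_image] at h1
    obtain ⟨p, hp, e⟩ := h1
    have hp' := mem_hexIdx.1 hp
    obtain ⟨e1, e2, e3, e4, e5⟩
        := s4c_inj (by omega) (by omega) (by omega) (by omega) (by omega) (by omega) (by omega) (by omega) e
    omega
  · rw [a9gImg, mem_image] at h1
    obtain ⟨p, hp, e⟩ := h1
    have hp' := mem_hexIdx.1 hp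
    obtain ⟨e1, e2, e3, e4, e5⟩
        := s4c_inj (by omega) (by omega) (by omega) (by omega) (by omega) (by omega) (by omega) (by omega) e
    omega

open Classical in
/-- The piece `a9iImg` is disjoint from the previous pieces of its family.
[cite: EntingJensen2009, §7.4.2, Fig. 7.10] -/
private theorem disjp_a9iImg (k : ℕ) : Disjoint (a9aImg k ∪ a9bImg k ∪ a9cImg k ∪ a9dImg k ∪ a9eImg k ∪ a9fImg k
    ∪ a9gImg k ∪ a9hImg k) (a9iImg k) := by
  refine disjoint_left.2 fun w h1 h2 => ?_
  rw [a9iImg, mem_image] at h2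
  obtain ⟨q, hq, rfl⟩ := h2
  have hq' := mem_hexIdx.1 hq
  simp only [mem_union] at h1
  rcases h1 with ((((((h1 | h1) | h1) | h1) | h1) | h1) | h1) | h1
  · rw [a9aImg, mem_image] at h1
    obtain ⟨p, hp, e⟩ := h1
    have hp' := mem_hexIdx.1 hp
    obtain ⟨e1, e2, e3, e4, e5⟩
        := s4c_inj (by omega) (by omega) (by omega) (by omega) (by omega) (by omega) (by omega) (by omega) e
    omega
  · rw [a9bImg, mem_image] at h1
    obtain ⟨p, hp, e⟩ := h1
    have hp' := mem_hexIdx.1 hp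
    obtain ⟨e1, e2, e3, e4, e5⟩
        := s4c_inj (by omega) (by omega) (by omega) (by omega) (by omega) (by omega) (by omega) (by omega) e
    omega
  · rw [a9cImg, mem_image] at h1
    obtain ⟨p, hp, e⟩ := h1
    have hp' := mem_hexIdx.1 hp
    obtain ⟨e1, e2, e3, e4, e5⟩
        := s4c_inj (by omega) (by omega) (by omega) (by omega) (by omega) (by omega) (by omega) (by omega) e
    omega
  · rw [a9dImg, mem_image] at h1
    obtain ⟨p, hp, e⟩ := h1
    have hp' := mem_hexIdx.1 hp
    obtain ⟨e1, e2, e3, e4, e5⟩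
        := s4c_inj (by omega) (by omega) (by omega) (by omega) (by omega) (by omega) (by omega) (by omega) e
    omega
  · rw [a9eImg, mem_image] at h1
    obtain ⟨p, hp, e⟩ := h1
    have hp' := mem_hexIdx.1 hp
    obtain ⟨e1, e2, e3, e4, e5⟩
        := s4c_inj (by omega) (by omega) (by omega) (by omega) (by omega) (by omega) (by omega) (by omega) e
    omega
  · rw [a9fImg, mem_image] at h1
    obtain ⟨p, hp, e⟩ := h1
    have hp' := mem_hexIdx.1 hp
    obtain ⟨e1, e2, e3, e4, e5⟩
        := s4c_inj (by omega) (by omega) (by omega) (by omega) (by omega) (by omega) (by omega) (by omega) e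
    omega
  · rw [a9gImg, mem_image] at h1
    obtain ⟨p, hp, e⟩ := h1
    have hp' := mem_hexIdx.1 hp
    obtain ⟨e1, e2, e3, e4, e5⟩
        := s4c_inj (by omega) (by omega) (by omega) (by omega) (by omega) (by omega) (by omega) (by omega) e
    omega
  · rw [a9hImg, mem_image] at h1
    obtain ⟨p, hp, e⟩ := h1
    have hp' := mem_hexIdx.1 hp
    obtain ⟨e1, e2, e3, e4, e5⟩
        := s4c_inj (by omega) (by omega) (by omega) (by omega) (by omega) (by omega) (by omega) (by omega) e
    omega

open Classical in
/-- What a member of `a9Img k` is. [cite: EntingJensen2009, §7.4.2, Fig. 7.10] -/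
theorem exists_of_mem_a9Img {k : ℕ} {w : ℕ → Site 2} (h : w ∈ a9Img k) :
    ∃ a i j e g : ℕ, (1 ≤ a ∧ i + j + e + 3 ≤ k ∧ i + g + 2 ≤ k ∧ a + g + 2 ≤ k) ∧ s4c k a i j e g = w := by
  simp only [a9Img, mem_union] at h
  rcases h with (((((((h | h) | h) | h) | h) | h) | h) | h) | h
  exacts [exists_of_mem_a9aImg h, exists_of_mem_a9bImg h, exists_of_mem_a9cImg h, exists_of_mem_a9dImg h,
      exists_of_mem_a9eImg h, exists_of_mem_a9fImg h, exists_of_mem_a9gImg h, exists_of_mem_a9hImg h,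
      exists_of_mem_a9iImg h]

open Classical in
/-- `#a9Img k` as a sum of simplex cardinalities. [cite: EntingJensen2009, §7.4.2, Fig. 7.10] -/
theorem card_a9Img (k : ℕ) : #(a9Img k) = #(hexIdx (k - 3)) + #(hexIdx (k - 3)) + #(hexIdx (k - 4))
    + #(hexIdx (k - 3)) + #(hexIdx (k - 3)) + #(hexIdx (k - 4)) + #(hexIdx (k - 3)) + #(hexIdx (k - 3))
    + #(hexIdx (k - 2)) := by
  rw [a9Img, card_union_of_disjoint (disjp_a9iImg k), card_union_of_disjoint (disjp_a9hImg k),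
      card_union_of_disjoint (disjp_a9gImg k), card_union_of_disjoint (disjp_a9fImg k),
      card_union_of_disjoint (disjp_a9eImg k), card_union_of_disjoint (disjp_a9dImg k),
      card_union_of_disjoint (disjp_a9cImg k), card_union_of_disjoint (disjp_a9bImg k),
    card_a9aImg, card_a9bImg, card_a9cImg, card_a9dImg, card_a9eImg, card_a9fImg, card_a9gImg, card_a9hImg, card_a9iImg]

open Classical in
/-- The piece `a11bImg` is disjoint from the previous pieces of its family.
[cite: EntingJensen2009, §7.4.2, Fig. 7.10] -/
private theorem disjp_a11bImg (k : ℕ) : Disjoint (a11aImg k) (a11bImg k) := by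
  refine disjoint_left.2 fun w h1 h2 => ?_
  rw [a11bImg, mem_image] at h2
  obtain ⟨q, hq, rfl⟩ := h2
  have hq' := mem_hexIdx.1 hq
  rw [a11aImg, mem_image] at h1
  obtain ⟨p, hp, e⟩ := h1
  have hp' := mem_hexIdx.1 hp
  obtain ⟨e1, e2, e3, e4, e5⟩ := s4e_inj (by omega) (by omega) (by omega) (by omega) (by omega) (by omega) e
  omega

open Classical in
/-- The piece `a11cImg` is disjoint from the previous pieces of its family.
[cite: EntingJensen2009, §7.4.2, Fig. 7.10] -/
private theorem disjp_a11cImg (k : ℕ) : Disjoint (a11aImg k ∪ a11bImg k) (a11cImg k) := by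
  refine disjoint_left.2 fun w h1 h2 => ?_
  rw [a11cImg, mem_image] at h2
  obtain ⟨q, hq, rfl⟩ := h2
  have hq' := mem_hexIdx.1 hq
  simp only [mem_union] at h1
  rcases h1 with h1 | h1
  · rw [a11aImg, mem_image] at h1
    obtain ⟨p, hp, e⟩ := h1
    have hp' := mem_hexIdx.1 hp
    obtain ⟨e1, e2, e3, e4, e5⟩ := s4e_inj (by omega) (by omega) (by omega) (by omega) (by omega) (by omega) e
    omega
  · rw [a11bImg, mem_image] at h1
    obtain ⟨p, hp, e⟩ := h1
    have hp' := mem_hexIdx.1 hp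
    obtain ⟨e1, e2, e3, e4, e5⟩ := s4e_inj (by omega) (by omega) (by omega) (by omega) (by omega) (by omega) e
    omega

open Classical in
/-- The piece `a11dImg` is disjoint from the previous pieces of its family.
[cite: EntingJensen2009, §7.4.2, Fig. 7.10] -/
private theorem disjp_a11dImg (k : ℕ) : Disjoint (a11aImg k ∪ a11bImg k ∪ a11cImg k) (a11dImg k) := by
  refine disjoint_left.2 fun w h1 h2 => ?_
  rw [a11dImg, mem_image] at h2
  obtain ⟨q, hq, rfl⟩ := h2
  have hq' := mem_hexIdx.1 hq
  simp only [mem_union] at h1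
  rcases h1 with (h1 | h1) | h1
  · rw [a11aImg, mem_image] at h1
    obtain ⟨p, hp, e⟩ := h1
    have hp' := mem_hexIdx.1 hp
    obtain ⟨e1, e2, e3, e4, e5⟩ := s4e_inj (by omega) (by omega) (by omega) (by omega) (by omega) (by omega) e
    omega
  · rw [a11bImg, mem_image] at h1
    obtain ⟨p, hp, e⟩ := h1
    have hp' := mem_hexIdx.1 hp
    obtain ⟨e1, e2, e3, e4, e5⟩ := s4e_inj (by omega) (by omega) (by omega) (by omega) (by omega) (by omega) e
    omega
  · rw [a11cImg, mem_image] at h1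
    obtain ⟨p, hp, e⟩ := h1
    have hp' := mem_hexIdx.1 hp
    obtain ⟨e1, e2, e3, e4, e5⟩ := s4e_inj (by omega) (by omega) (by omega) (by omega) (by omega) (by omega) e
    omega

open Classical in
/-- What a member of `a11Img k` is. [cite: EntingJensen2009, §7.4.2, Fig. 7.10] -/
theorem exists_of_mem_a11Img {k : ℕ} {w : ℕ → Site 2} (h : w ∈ a11Img k) :
    ∃ a i j d g : ℕ, (1 ≤ a ∧ i + j + d + g + 4 ≤ k ∧ a + g + 2 ≤ k) ∧ s4e k a i j d g = w := by
  simp only [a11Img, mem_union] at h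
  rcases h with ((h | h) | h) | h
  exacts [exists_of_mem_a11aImg h, exists_of_mem_a11bImg h, exists_of_mem_a11cImg h, exists_of_mem_a11dImg h]

open Classical in
/-- `#a11Img k` as a sum of simplex cardinalities. [cite: EntingJensen2009, §7.4.2, Fig. 7.10] -/
theorem card_a11Img (k : ℕ) : #(a11Img k) = #(hexIdx (k - 3)) + #(hexIdx (k - 3)) + #(hexIdx (k - 4))
    + #(hexIdx (k - 4)) := by
  rw [a11Img, card_union_of_disjoint (disjp_a11dImg k), card_union_of_disjoint (disjp_a11cImg k),
      card_union_of_disjoint (disjp_a11bImg k),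
    card_a11aImg, card_a11bImg, card_a11cImg, card_a11dImg]

open Classical in
/-- The piece `a13bImg` is disjoint from the previous pieces of its family.
[cite: EntingJensen2009, §7.4.2, Fig. 7.10] -/
private theorem disjp_a13bImg (k : ℕ) : Disjoint (a13aImg k) (a13bImg k) := by
  refine disjoint_left.2 fun w h1 h2 => ?_
  rw [a13bImg, mem_image] at h2
  obtain ⟨q, hq, rfl⟩ := h2
  have hq' := mem_hexIdx.1 hq
  rw [a13aImg, mem_image] at h1
  obtain ⟨p, hp, e⟩ := h1
  have hp' := mem_hexIdx.1 hp
  obtain ⟨e1, e2, e3, e4, e5⟩ := s4g_inj (by omega) (by omega) (by omega) (by omega) (by omega) (by omega) e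
  omega

open Classical in
/-- What a member of `a13Img k` is. [cite: EntingJensen2009, §7.4.2, Fig. 7.10] -/
theorem exists_of_mem_a13Img {k : ℕ} {w : ℕ → Site 2} (h : w ∈ a13Img k) :
    ∃ a i d e g : ℕ, (1 ≤ a ∧ a + d + e + g + 4 ≤ k ∧ i + d + e + g + 4 ≤ k) ∧ s4g k a i d e g = w := by
  simp only [a13Img, mem_union] at h
  rcases h with h | h
  exacts [exists_of_mem_a13aImg h, exists_of_mem_a13bImg h]

open Classical in
/-- `#a13Img k` as a sum of simplex cardinalities. [cite: EntingJensen2009, §7.4.2, Fig. 7.10] -/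
theorem card_a13Img (k : ℕ) : #(a13Img k) = #(hexIdx (k - 4)) + #(hexIdx (k - 4)) := by
  rw [a13Img, card_union_of_disjoint (disjp_a13bImg k),
    card_a13aImg, card_a13bImg]

/-! ### §4  The four-down Finset `ddddBlocks k`: disjointness of the ten families, the count, the floor -/

open Classical in
/-- **The four-down Finset at slack four**: the blocks of the ten families A7–A15, B5 of length `6k + 4`.
[cite: EntingJensen2009, §7.4.2, Fig. 7.10] [cite: MadrasSlade1993, §4.2, Definition 4.2.1 (p. 90)] -/
noncomputable def ddddBlocks (k : ℕ) : Finset (ℕ → Site 2) :=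
  a7Img k ∪ a8Img k ∪ a9Img k ∪ a10Img k ∪ a11Img k ∪ a12Img k ∪ a13Img k ∪ a14Img k ∪ a15Img k ∪ b5Img k

open Classical in
/-- The image `a8Img` is disjoint from the previous ones. [cite: EntingJensen2009, §7.4.2, Fig. 7.10] -/
private theorem disj4_a8Img (k : ℕ) :
    Disjoint (a7Img k) (a8Img k) := by
  refine disjoint_left.2 fun w h1 h2 => ?_
  obtain ⟨i', j', e', g', hb, e'⟩ := exists_of_mem_a8Img h2
  obtain ⟨a, i, j, d, g, ha, e⟩ := exists_of_mem_a7Img h1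
  exact s4a_ne_s4b (by omega) (by omega) (by omega) (by omega) (by omega) (by omega) (by omega) (e.trans e'.symm)

open Classical in
/-- The image `a9Img` is disjoint from the previous ones. [cite: EntingJensen2009, §7.4.2, Fig. 7.10] -/
private theorem disj4_a9Img (k : ℕ) :
    Disjoint (a7Img k ∪ a8Img k) (a9Img k) := by
  refine disjoint_left.2 fun w h1 h2 => ?_
  obtain ⟨a', i', j', e', g', hb, e'⟩ := exists_of_mem_a9Img h2
  simp only [mem_union] at h1
  rcases h1 with h1 | h1
  · obtain ⟨a, i, j, d, g, ha, e⟩ := exists_of_mem_a7Img h1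
    exact s4a_ne_s4c (by omega) (by omega) (by omega) (by omega) (by omega) (by omega) (by omega) (by omega) (e.trans
        e'.symm)
  · obtain ⟨i, j, e, g, ha, e⟩ := exists_of_mem_a8Img h1
    exact s4b_ne_s4c (by omega) (by omega) (by omega) (by omega) (by omega) (by omega) (by omega) (e.trans e'.symm)

open Classical in
/-- The image `a10Img` is disjoint from the previous ones. [cite: EntingJensen2009, §7.4.2, Fig. 7.10] -/
private theorem disj4_a10Img (k : ℕ) :
    Disjoint (a7Img k ∪ a8Img k ∪ a9Img k) (a10Img k) := by
  refine disjoint_left.2 fun w h1 h2 => ?_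
  obtain ⟨i', j', e', g', hb, e'⟩ := exists_of_mem_a10Img h2
  simp only [mem_union] at h1
  rcases h1 with (h1 | h1) | h1
  · obtain ⟨a, i, j, d, g, ha, e⟩ := exists_of_mem_a7Img h1
    exact s4a_ne_s4d (by omega) (by omega) (by omega) (by omega) (by omega) (e.trans e'.symm)
  · obtain ⟨i, j, e, g, ha, e⟩ := exists_of_mem_a8Img h1
    exact s4b_ne_s4d (by omega) (by omega) (by omega) (by omega) (e.trans e'.symm)
  · obtain ⟨a, i, j, e, g, ha, e⟩ := exists_of_mem_a9Img h1
    exact s4c_ne_s4d (by omega) (by omega) (by omega) (by omega) (by omega) (e.trans e'.symm)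

open Classical in
/-- The image `a11Img` is disjoint from the previous ones. [cite: EntingJensen2009, §7.4.2, Fig. 7.10] -/
private theorem disj4_a11Img (k : ℕ) :
    Disjoint (a7Img k ∪ a8Img k ∪ a9Img k ∪ a10Img k) (a11Img k) := by
  refine disjoint_left.2 fun w h1 h2 => ?_
  obtain ⟨a', i', j', d', g', hb, e'⟩ := exists_of_mem_a11Img h2
  simp only [mem_union] at h1
  rcases h1 with ((h1 | h1) | h1) | h1
  · obtain ⟨a, i, j, d, g, ha, e⟩ := exists_of_mem_a7Img h1
    exact s4a_ne_s4e (by omega) (by omega) (by omega) (by omega) (by omega) (by omega) (by omega) (e.trans e'.symm)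
  · obtain ⟨i, j, e, g, ha, e⟩ := exists_of_mem_a8Img h1
    exact s4b_ne_s4e (by omega) (by omega) (by omega) (by omega) (by omega) (by omega) (e.trans e'.symm)
  · obtain ⟨a, i, j, e, g, ha, e⟩ := exists_of_mem_a9Img h1
    exact s4c_ne_s4e (by omega) (by omega) (by omega) (by omega) (by omega) (by omega) (by omega) (e.trans e'.symm)
  · obtain ⟨i, j, e, g, ha, e⟩ := exists_of_mem_a10Img h1
    exact s4d_ne_s4e (by omega) (by omega) (by omega) (by omega) (e.trans e'.symm)

open Classical in
/-- The image `a12Img` is disjoint from the previous ones. [cite: EntingJensen2009, §7.4.2, Fig. 7.10] -/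
private theorem disj4_a12Img (k : ℕ) :
    Disjoint (a7Img k ∪ a8Img k ∪ a9Img k ∪ a10Img k ∪ a11Img k) (a12Img k) := by
  refine disjoint_left.2 fun w h1 h2 => ?_
  obtain ⟨i', j', d', g', hb, e'⟩ := exists_of_mem_a12Img h2
  simp only [mem_union] at h1
  rcases h1 with (((h1 | h1) | h1) | h1) | h1
  · obtain ⟨a, i, j, d, g, ha, e⟩ := exists_of_mem_a7Img h1
    exact s4a_ne_s4f (by omega) (by omega) (by omega) (by omega) (by omega) (e.trans e'.symm)
  · obtain ⟨i, j, e, g, ha, e⟩ := exists_of_mem_a8Img h1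
    exact s4b_ne_s4f (by omega) (by omega) (by omega) (by omega) (e.trans e'.symm)
  · obtain ⟨a, i, j, e, g, ha, e⟩ := exists_of_mem_a9Img h1
    exact s4c_ne_s4f (by omega) (by omega) (by omega) (by omega) (by omega) (e.trans e'.symm)
  · obtain ⟨i, j, e, g, ha, e⟩ := exists_of_mem_a10Img h1
    exact s4d_ne_s4f (by omega) (by omega) (e.trans e'.symm)
  · obtain ⟨a, i, j, d, g, ha, e⟩ := exists_of_mem_a11Img h1
    exact s4e_ne_s4f (by omega) (by omega) (by omega) (by omega) (e.trans e'.symm)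

open Classical in
/-- The image `a13Img` is disjoint from the previous ones. [cite: EntingJensen2009, §7.4.2, Fig. 7.10] -/
private theorem disj4_a13Img (k : ℕ) :
    Disjoint (a7Img k ∪ a8Img k ∪ a9Img k ∪ a10Img k ∪ a11Img k ∪ a12Img k) (a13Img k) := by
  refine disjoint_left.2 fun w h1 h2 => ?_
  obtain ⟨a', i', d', e', g', hb, e'⟩ := exists_of_mem_a13Img h2
  simp only [mem_union] at h1
  rcases h1 with ((((h1 | h1) | h1) | h1) | h1) | h1
  · obtain ⟨a, i, j, d, g, ha, e⟩ := exists_of_mem_a7Img h1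
    exact s4a_ne_s4g (by omega) (by omega) (by omega) (by omega) (by omega) (by omega) (by omega) (e.trans e'.symm)
  · obtain ⟨i, j, e, g, ha, e⟩ := exists_of_mem_a8Img h1
    exact s4b_ne_s4g (by omega) (by omega) (by omega) (by omega) (by omega) (by omega) (e.trans e'.symm)
  · obtain ⟨a, i, j, e, g, ha, e⟩ := exists_of_mem_a9Img h1
    exact s4c_ne_s4g (by omega) (by omega) (by omega) (by omega) (by omega) (by omega) (by omega) (e.trans e'.symm)
  · obtain ⟨i, j, e, g, ha, e⟩ := exists_of_mem_a10Img h1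
    exact s4d_ne_s4g (by omega) (by omega) (by omega) (by omega) (e.trans e'.symm)
  · obtain ⟨a, i, j, d, g, ha, e⟩ := exists_of_mem_a11Img h1
    exact s4e_ne_s4g (by omega) (by omega) (by omega) (by omega) (by omega) (by omega) (e.trans e'.symm)
  · obtain ⟨i, j, d, g, ha, e⟩ := exists_of_mem_a12Img h1
    exact s4f_ne_s4g (by omega) (by omega) (by omega) (by omega) (e.trans e'.symm)

open Classical in
/-- The image `a14Img` is disjoint from the previous ones. [cite: EntingJensen2009, §7.4.2, Fig. 7.10] -/
private theorem disj4_a14Img (k : ℕ) :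
    Disjoint (a7Img k ∪ a8Img k ∪ a9Img k ∪ a10Img k ∪ a11Img k ∪ a12Img k ∪ a13Img k) (a14Img k) := by
  refine disjoint_left.2 fun w h1 h2 => ?_
  obtain ⟨a', i', j', d', g', hb, e'⟩ := exists_of_mem_a14Img h2
  simp only [mem_union] at h1
  rcases h1 with (((((h1 | h1) | h1) | h1) | h1) | h1) | h1
  · obtain ⟨a, i, j, d, g, ha, e⟩ := exists_of_mem_a7Img h1
    exact s4a_ne_s4h (by omega) (by omega) (by omega) (by omega) (by omega) (by omega) (e.trans e'.symm)
  · obtain ⟨i, j, e, g, ha, e⟩ := exists_of_mem_a8Img h1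
    exact s4b_ne_s4h (by omega) (by omega) (by omega) (by omega) (by omega) (e.trans e'.symm)
  · obtain ⟨a, i, j, e, g, ha, e⟩ := exists_of_mem_a9Img h1
    exact s4c_ne_s4h (by omega) (by omega) (by omega) (by omega) (by omega) (by omega) (e.trans e'.symm)
  · obtain ⟨i, j, e, g, ha, e⟩ := exists_of_mem_a10Img h1
    exact s4d_ne_s4h (by omega) (by omega) (by omega) (e.trans e'.symm)
  · obtain ⟨a, i, j, d, g, ha, e⟩ := exists_of_mem_a11Img h1
    exact s4e_ne_s4h (by omega) (by omega) (by omega) (by omega) (by omega) (e.trans e'.symm)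
  · obtain ⟨i, j, d, g, ha, e⟩ := exists_of_mem_a12Img h1
    exact s4f_ne_s4h (by omega) (by omega) (by omega) (e.trans e'.symm)
  · obtain ⟨a, i, d, e, g, ha, e⟩ := exists_of_mem_a13Img h1
    exact s4g_ne_s4h (by omega) (by omega) (by omega) (by omega) (by omega) (e.trans e'.symm)

open Classical in
/-- The image `a15Img` is disjoint from the previous ones. [cite: EntingJensen2009, §7.4.2, Fig. 7.10] -/
private theorem disj4_a15Img (k : ℕ) :
    Disjoint (a7Img k ∪ a8Img k ∪ a9Img k ∪ a10Img k ∪ a11Img k ∪ a12Img k ∪ a13Img k ∪ a14Img k) (a15Img k) := by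
  refine disjoint_left.2 fun w h1 h2 => ?_
  obtain ⟨i', j', d', g', hb, e'⟩ := exists_of_mem_a15Img h2
  simp only [mem_union] at h1
  rcases h1 with ((((((h1 | h1) | h1) | h1) | h1) | h1) | h1) | h1
  · obtain ⟨a, i, j, d, g, ha, e⟩ := exists_of_mem_a7Img h1
    exact s4a_ne_s4i (by omega) (by omega) (by omega) (by omega) (by omega) (by omega) (e.trans e'.symm)
  · obtain ⟨i, j, e, g, ha, e⟩ := exists_of_mem_a8Img h1
    exact s4b_ne_s4i (by omega) (by omega) (by omega) (by omega) (by omega) (e.trans e'.symm)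
  · obtain ⟨a, i, j, e, g, ha, e⟩ := exists_of_mem_a9Img h1
    exact s4c_ne_s4i (by omega) (by omega) (by omega) (by omega) (by omega) (by omega) (e.trans e'.symm)
  · obtain ⟨i, j, e, g, ha, e⟩ := exists_of_mem_a10Img h1
    exact s4d_ne_s4i (by omega) (by omega) (by omega) (e.trans e'.symm)
  · obtain ⟨a, i, j, d, g, ha, e⟩ := exists_of_mem_a11Img h1
    exact s4e_ne_s4i (by omega) (by omega) (by omega) (by omega) (by omega) (e.trans e'.symm)
  · obtain ⟨i, j, d, g, ha, e⟩ := exists_of_mem_a12Img h1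
    exact s4f_ne_s4i (by omega) (by omega) (by omega) (e.trans e'.symm)
  · obtain ⟨a, i, d, e, g, ha, e⟩ := exists_of_mem_a13Img h1
    exact s4g_ne_s4i (by omega) (by omega) (by omega) (by omega) (by omega) (e.trans e'.symm)
  · obtain ⟨a, i, j, d, g, ha, e⟩ := exists_of_mem_a14Img h1
    exact s4h_ne_s4i (by omega) (by omega) (by omega) (by omega) (e.trans e'.symm)

open Classical in
/-- The image `b5Img` is disjoint from the previous ones. [cite: EntingJensen2009, §7.4.2, Fig. 7.10] -/
private theorem disj4_b5Img (k : ℕ) :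
    Disjoint (a7Img k ∪ a8Img k ∪ a9Img k ∪ a10Img k ∪ a11Img k ∪ a12Img k ∪ a13Img k ∪ a14Img k
        ∪ a15Img k) (b5Img k) := by
  refine disjoint_left.2 fun w h1 h2 => ?_
  obtain ⟨a', hb, e'⟩ := exists_of_mem_b5Img h2
  simp only [mem_union] at h1
  rcases h1 with (((((((h1 | h1) | h1) | h1) | h1) | h1) | h1) | h1) | h1
  · obtain ⟨a, i, j, d, g, ha, e⟩ := exists_of_mem_a7Img h1
    exact s4a_ne_s4j (by omega) (by omega) (by omega) (by omega) (by omega) (by omega) (e.trans e'.symm)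
  · obtain ⟨i, j, e, g, ha, e⟩ := exists_of_mem_a8Img h1
    exact s4b_ne_s4j (by omega) (by omega) (by omega) (by omega) (by omega) (e.trans e'.symm)
  · obtain ⟨a, i, j, e, g, ha, e⟩ := exists_of_mem_a9Img h1
    exact s4c_ne_s4j (by omega) (by omega) (by omega) (by omega) (by omega) (by omega) (e.trans e'.symm)
  · obtain ⟨i, j, e, g, ha, e⟩ := exists_of_mem_a10Img h1
    exact s4d_ne_s4j (by omega) (by omega) (by omega) (e.trans e'.symm)
  · obtain ⟨a, i, j, d, g, ha, e⟩ := exists_of_mem_a11Img h1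
    exact s4e_ne_s4j (by omega) (by omega) (by omega) (by omega) (by omega) (e.trans e'.symm)
  · obtain ⟨i, j, d, g, ha, e⟩ := exists_of_mem_a12Img h1
    exact s4f_ne_s4j (by omega) (by omega) (by omega) (e.trans e'.symm)
  · obtain ⟨a, i, d, e, g, ha, e⟩ := exists_of_mem_a13Img h1
    exact s4g_ne_s4j (by omega) (by omega) (by omega) (by omega) (by omega) (e.trans e'.symm)
  · obtain ⟨a, i, j, d, g, ha, e⟩ := exists_of_mem_a14Img h1
    exact s4h_ne_s4j (by omega) (by omega) (by omega) (by omega) (e.trans e'.symm)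
  · obtain ⟨i, j, d, g, ha, e⟩ := exists_of_mem_a15Img h1
    exact s4i_ne_s4j (by omega) (by omega) (by omega) (by omega) (e.trans e'.symm)

open Classical in
/-- ★★ **The structural count**: `#ddddBlocks k` in terms of the index simplices.
[cite: EntingJensen2009, §7.4.2, Fig. 7.10] -/
theorem card_ddddBlocks_eq (k : ℕ) :
    #(ddddBlocks k) = 11 * #(hexIdx (k - 3)) + 8 * #(hexIdx (k - 4)) + #(hexIdx (k - 2)) + #(pentIdx (k - 2))
        + 3 * #(pentIdx (k - 3)) + #(pentIdx (k - 4)) + (k - 2) := by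
  rw [ddddBlocks, card_union_of_disjoint (disj4_b5Img k), card_union_of_disjoint (disj4_a15Img k),
      card_union_of_disjoint (disj4_a14Img k), card_union_of_disjoint (disj4_a13Img k),
      card_union_of_disjoint (disj4_a12Img k), card_union_of_disjoint (disj4_a11Img k),
      card_union_of_disjoint (disj4_a10Img k), card_union_of_disjoint (disj4_a9Img k),
      card_union_of_disjoint (disj4_a8Img k)]
  rw [card_a7Img, card_a8Img, card_a9Img, card_a10Img, card_a11Img, card_a12Img, card_a13Img, card_a14Img,
      card_a15Img, card_b5Img, card_range]
  ring

open Classical in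
/-- ★★★ **The four-down count at slack four, floor side**: `12 · #ddddBlocks k = (k − 2)(2k⁴ − 7k³ + 4k² + 7k + 6)`
(both sides vanish for `k ≤ 2`), i.e. `#ddddBlocks k = 0, 3, 27, 129, 424, 1105, 2463, 4907, 8984` for
`k = 2, …, 10` (the right side is written truncation-safely: `2k⁴ + 4k² + 7k + 6 ≥ 7k³` for every `k`).  Pieces:
`11·C(k+1,5) + 8·C(k,5) + C(k+2,5) + C(k+1,4) + 3·C(k,4) + C(k−1,4) + (k−2)`.
[cite: EntingJensen2009, §7.4.2, Fig. 7.10] [cite: MadrasSlade1993, §4.2, Definition 4.2.1 (p. 90)] -/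
theorem twelve_mul_card_ddddBlocks (k : ℕ) :
    12 * #(ddddBlocks k) = (k - 2) * (2 * k ^ 4 + 4 * k ^ 2 + 7 * k + 6 - 7 * k ^ 3) := by
  rw [card_ddddBlocks_eq]
  have z5 : #(hexIdx 0) = 0 := by have := onetwenty_mul_card_hexIdx 0; omega
  have z4 : #(pentIdx 0) = 0 := by have := twentyfour_mul_card_pentIdx 0; omega
  have o5 : #(hexIdx 1) = 1 := by have := onetwenty_mul_card_hexIdx 1; omega
  have o4 : #(pentIdx 1) = 1 := by have := twentyfour_mul_card_pentIdx 1; omega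
  obtain rfl | rfl | rfl | rfl | h4 : k = 0 ∨ k = 1 ∨ k = 2 ∨ k = 3 ∨ 4 ≤ k := by omega
  · norm_num [z5, z4]
  · norm_num [z5, z4]
  · norm_num [z5, z4]
  · norm_num [z5, z4, o5, o4]
  obtain ⟨n, rfl⟩ : ∃ n, k = n + 4 := ⟨k - 4, by omega⟩
  have e1 : n + 4 - 3 = n + 1 := by omega
  have e2 : n + 4 - 4 = n := by omega
  have e3 : n + 4 - 2 = n + 2 := by omega
  have e4 : 2 * (n + 4) ^ 4 + 4 * (n + 4) ^ 2 + 7 * (n + 4) + 6 - 7 * (n + 4) ^ 3 =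
      2 * n ^ 4 + 25 * n ^ 3 + 112 * n ^ 2 + 215 * n + 162 := by
    have : 2 * (n + 4) ^ 4 + 4 * (n + 4) ^ 2 + 7 * (n + 4) + 6 =
        7 * (n + 4) ^ 3 + (2 * n ^ 4 + 25 * n ^ 3 + 112 * n ^ 2 + 215 * n + 162) := by ring
    omega
  rw [e1, e2, e3, e4]
  have h1 := onetwenty_mul_card_hexIdx (n + 1)
  have h2 := onetwenty_mul_card_hexIdx n
  have h3 := onetwenty_mul_card_hexIdx (n + 2)
  have h4 := twentyfour_mul_card_pentIdx (n + 2)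
  have h5 := twentyfour_mul_card_pentIdx (n + 1)
  have h6 := twentyfour_mul_card_pentIdx n
  ring_nf at h1 h2 h3 h4 h5 h6 ⊢
  omega

open Classical in
/-- ★★ **Every element of `ddddBlocks k` is an irreducible positive wall bridge of length `6k + 4` with exactly `k`
visits and four down steps.** [cite: MadrasSlade1993, §4.2, Definition 4.2.1 (p. 90)]
[cite: EntingJensen2009, §7.4.2, Fig. 7.10] -/
theorem ddddBlocks_subset {k m : ℕ} (hm : m = 6 * k + 4) :
    ddddBlocks k ⊆ (ipwb m).filter fun ω => visits m ω = k ∧ #(stepsD m ω) = 4 := by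
  intro w hw
  rw [mem_filter]
  simp only [ddddBlocks, mem_union] at hw
  rcases hw with ((((((((hw | hw) | hw) | hw) | hw) | hw) | hw) | hw) | hw) | hw
  · obtain ⟨a, i, j, d, g, h, rfl⟩ := exists_of_mem_a7Img hw
    exact ⟨s4a_mem_ipwb (by omega) (by omega) (by omega) (by omega) hm,
        visits_s4a (by omega) (by omega) (by omega) (by omega) hm, by
      rw [stepsD_s4a (by omega) (by omega) (by omega) (by omega) hm, card_insert_of_notMem (by simp; omega),
        card_insert_of_notMem (by simp; omega), card_pair (by omega)]⟩
  · obtain ⟨i, j, e, g, h, rfl⟩ := exists_of_mem_a8Img hw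
    exact ⟨s4b_mem_ipwb (by omega) (by omega) (by omega) hm, visits_s4b (by omega) (by omega) (by omega) hm, by
      rw [stepsD_s4b (by omega) (by omega) (by omega) hm, card_insert_of_notMem (by simp; omega),
        card_insert_of_notMem (by simp; omega), card_pair (by omega)]⟩
  · obtain ⟨a, i, j, e, g, h, rfl⟩ := exists_of_mem_a9Img hw
    exact ⟨s4c_mem_ipwb (by omega) (by omega) (by omega) (by omega) hm,
        visits_s4c (by omega) (by omega) (by omega) (by omega) hm, by
      rw [stepsD_s4c (by omega) (by omega) (by omega) (by omega) hm, card_insert_of_notMem (by simp; omega),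
        card_insert_of_notMem (by simp; omega), card_pair (by omega)]⟩
  · obtain ⟨i, j, e, g, h, rfl⟩ := exists_of_mem_a10Img hw
    exact ⟨s4d_mem_ipwb (by omega) hm, visits_s4d (by omega) hm, by
      rw [stepsD_s4d (by omega) hm, card_insert_of_notMem (by simp; omega),
        card_insert_of_notMem (by simp; omega), card_pair (by omega)]⟩
  · obtain ⟨a, i, j, d, g, h, rfl⟩ := exists_of_mem_a11Img hw
    exact ⟨s4e_mem_ipwb (by omega) (by omega) (by omega) hm, visits_s4e (by omega) (by omega) (by omega) hm, by
      rw [stepsD_s4e (by omega) (by omega) (by omega) hm, card_insert_of_notMem (by simp; omega),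
        card_insert_of_notMem (by simp; omega), card_pair (by omega)]⟩
  · obtain ⟨i, j, d, g, h, rfl⟩ := exists_of_mem_a12Img hw
    exact ⟨s4f_mem_ipwb (by omega) hm, visits_s4f (by omega) hm, by
      rw [stepsD_s4f (by omega) hm, card_insert_of_notMem (by simp; omega),
        card_insert_of_notMem (by simp; omega), card_pair (by omega)]⟩
  · obtain ⟨a, i, d, e, g, h, rfl⟩ := exists_of_mem_a13Img hw
    exact ⟨s4g_mem_ipwb (by omega) (by omega) (by omega) hm, visits_s4g (by omega) (by omega) (by omega) hm, by
      rw [stepsD_s4g (by omega) (by omega) (by omega) hm, card_insert_of_notMem (by simp; omega),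
        card_insert_of_notMem (by simp; omega), card_pair (by omega)]⟩
  · obtain ⟨a, i, j, d, g, h, rfl⟩ := exists_of_mem_a14Img hw
    exact ⟨s4h_mem_ipwb (by omega) (by omega) hm, visits_s4h (by omega) (by omega) hm, by
      rw [stepsD_s4h (by omega) (by omega) hm, card_insert_of_notMem (by simp; omega),
        card_insert_of_notMem (by simp; omega), card_pair (by omega)]⟩
  · obtain ⟨i, j, d, g, h, rfl⟩ := exists_of_mem_a15Img hw
    exact ⟨s4i_mem_ipwb (by omega) (by omega) hm, visits_s4i (by omega) (by omega) hm, by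
      rw [stepsD_s4i (by omega) (by omega) hm, card_insert_of_notMem (by simp; omega),
        card_insert_of_notMem (by simp; omega), card_pair (by omega)]⟩
  · obtain ⟨a, h, rfl⟩ := exists_of_mem_b5Img hw
    exact ⟨s4j_mem_ipwb (by omega) (by omega) hm, visits_s4j (by omega) (by omega) hm, by
      rw [stepsD_s4j (by omega) (by omega) hm, card_insert_of_notMem (by simp; omega),
        card_insert_of_notMem (by simp; omega), card_pair (by omega)]⟩

/-- ★★★ **Floor for the four-down stratum at slack four**: at least `(k − 2)(2k⁴ − 7k³ + 4k² + 7k + 6)/12`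
irreducible positive wall bridges of length `6k + 4` with `k` visits have exactly four down steps (the lane's
enumeration says: exactly that many, `k ≤ 8`).
[cite: MadrasSlade1993, §4.2, Definition 4.2.1 (p. 90), remark before (4.2.21) (p. 94)]
[cite: EntingJensen2009, §7.4.2, Fig. 7.10] -/
theorem le_twelve_mul_card_filter_visits_four_down {k m : ℕ} (hm : m = 6 * k + 4) :
    (k - 2) * (2 * k ^ 4 + 4 * k ^ 2 + 7 * k + 6 - 7 * k ^ 3) ≤
      12 * #((ipwb m).filter fun ω => visits m ω = k ∧ #(stepsD m ω) = 4) := by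
  classical
  rw [← twelve_mul_card_ddddBlocks k]
  exact Nat.mul_le_mul_left 12 (card_le_card (ddddBlocks_subset hm))

/-- ★★★ **The quintic floor of the slack-four row**: for `k ≥ 2`,
`2k⁵ − 11k⁴ + 30k³ + 5k² − 38k + 60 ≤ 12 · #{ω ∈ ipwb (6k+4) : visits = k}` (written truncation-safely) — the floor
half of the row `N(6k+4, k) = (2k⁵ − 11k⁴ + 30k³ + 5k² − 38k + 60)/12 = 11, 33, 95, 260, 649, 1461, 2993, …` of the
lane's enumeration, from the four-down floor and the exact two- and three-down census
`two_mul_card_filter_visits_slack_four`.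
[cite: MadrasSlade1993, §4.2, Definition 4.2.1 (p. 90), remark before (4.2.21) (p. 94)]
[cite: EntingJensen2009, §7.4.2, Fig. 7.10] -/
theorem slack_four_quintic_floor {k m : ℕ} (hk : 2 ≤ k) (hm : m = 6 * k + 4) :
    2 * k ^ 5 + 30 * k ^ 3 + 5 * k ^ 2 + 60 - (11 * k ^ 4 + 38 * k) ≤ 12 * #((ipwb m).filter fun ω => visits m ω
        = k) := by
  have hrow := two_mul_card_filter_visits_slack_four hk hm
  have hfl := le_twelve_mul_card_filter_visits_four_down hm
  obtain ⟨n, rfl⟩ : ∃ n, k = n + 2 := ⟨k - 2, by omega⟩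
  have e1 : n + 2 - 2 = n := by omega
  have e2 : n + 2 - 1 = n + 1 := by omega
  have e3 : 2 * (n + 2) ^ 4 + 4 * (n + 2) ^ 2 + 7 * (n + 2) + 6 - 7 * (n + 2) ^ 3 = 2 * n ^ 4 + 9 * n ^ 3
      + 10 * n ^ 2 + 3 * n + 12 := by
    have : 2 * (n + 2) ^ 4 + 4 * (n + 2) ^ 2 + 7 * (n + 2) + 6 = 7 * (n + 2) ^ 3 + (2 * n ^ 4 + 9 * n ^ 3
        + 10 * n ^ 2 + 3 * n + 12) := by
      ring
    omega
  have e4 : 2 * (n + 2) * (n + 2) + 3 * (n + 2) - 4 = 2 * n ^ 2 + 11 * n + 10 := by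
    have : 2 * (n + 2) * (n + 2) + 3 * (n + 2) = 4 + (2 * n ^ 2 + 11 * n + 10) := by ring
    omega
  have e5 : 2 * (n + 2) ^ 5 + 30 * (n + 2) ^ 3 + 5 * (n + 2) ^ 2 + 60 - (11 * (n + 2) ^ 4 + 38 * (n + 2)) =
      2 * n ^ 5 + 9 * n ^ 4 + 22 * n ^ 3 + 81 * n ^ 2 + 150 * n + 132 := by
    have : 2 * (n + 2) ^ 5 + 30 * (n + 2) ^ 3 + 5 * (n + 2) ^ 2 + 60 =
        11 * (n + 2) ^ 4 + 38 * (n + 2) + (2 * n ^ 5 + 9 * n ^ 4 + 22 * n ^ 3 + 81 * n ^ 2 + 150 * n + 132) := by ring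
    omega
  rw [e1, e3] at hfl
  rw [e2, e4] at hrow
  rw [e5]
  ring_nf at hfl hrow ⊢
  omega

end Literature.Probability.RandomPlanarGeometry.SAW.HexBW.Wall
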